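import Mathlib
import Summits.ValiantsHypothesis.ValiantsHypothesis.Theorems.NNDivisionHard.Negative.CliqueRowLawFalse
import Summits.ValiantsHypothesis.ValiantsHypothesis.Theorems.NNDivisionHard.Negative.DiagTiltedLawFalse
import Summits.ValiantsHypothesis.ValiantsHypothesis.Theorems.NNDivisionHard.Negative.LocatedPencilLawFalse
import Literature.Barriers.PneNP.TSPExtensionComplexityKaibelWeltge
import Literature.Barriers.PneNP.TSPExtensionComplexityHyperplaneBound
import Summits.ValiantsHypothesis.ValiantsHypothesis.Theorems.FifoMatchingGridCorShadowOfCliqueFace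
import Summits.ValiantsHypothesis.ValiantsHypothesis.Theorems.FifoMatchingNNDivisionHardLocatedRowsTogetherFaceWeight
import Summits.ValiantsHypothesis.ValiantsHypothesis.Theorems.FifoMatchingNNDivisionHardLocatedRowsPrivateCeiling
import Summits.ValiantsHypothesis.ValiantsHypothesis.Theorems.NNDivisionHard.Negative.LocatedRowsChain

/-!
# Located rows in LAW currency (val-idea-40 g5, WAVE-6 seat W6-P1; crux `FifoMatching.NNDivisionHard`, stmt-ValiantsHypothesis-21181)

Director R303 (3) W6-P1: «`diagTilted.Law` on LOCATED families typed over normal-cone rows of coordinate faces with exact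
rhs — prove the first non-trivial located case or name the obstruction».  Critic of record val-idea-crit-9 g2, KILL NOTE N18
(22:21:48Z): `diagTilted.Law` (C⁺_diag) is FALSE — the zero-diagonal cube `Q^∘` is blind to every DIAGONAL tilt
(`⟨flat (diagonal σ), q⟩ = 0`), so a W6-P1 filing must carry OFF-DIAGONAL support in its located rows.  This file:

* §1 the ROW-FAMILY frame of `CliqueRowBlind.lean` §4 (val-idea-39 g3; `RowFamily`, `RowFamily.Law`, `Emb`, `Law.mono`,
  `corVirtualHardN_of_law`, `allRows` — restated verbatim because Cruxes modules are not in the farm build closure) and the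
  LOCATED FAMILY WITH EXACT RIGHT-HAND SIDES `pinnedRows`: rows `udRow a + w`, rhs `1 + ⟨w, x_S⟩`, for EVERY direction `w`
  maximised over `COR(n)` at a coordinate vertex `x_S` (normal-cone rows of the coordinate faces `F_{S,S'} ∋ x_S` are the
  sub-case; PROP B's diagonal reads, the pair pencils `μ(E_im + E_mi)`, the switched-face rows and PROP E's gadget rows are
  members); `pinnedRows ↪ allRows`, hence `pinnedRows.Law → CorVirtualHardN` (=: C⁺_loc, the located successor of C⁺_diag).
* §2 ★ the LAW-CURRENCY LOCATED BLOCK COUNT `three_pow_le_of_block`: a nonnegatively factored matrix through `|ι|` slots that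
  contains an embedded block `(1 − |a' ∩ b'|)²` (`a', b' ⊆ α`) has `3^{|α|} ≤ |ι|·2^{|α|}` (Kaibel–Weltge on the support
  rectangles) — the factorization-side twin of the chamber pigeonhole `three_pow_le_of_hits` with ONE chamber.
* §3 the passenger is THE ZERO-DIAGONAL CUBE OF RECORD `Q∘ = conv{qOff P}` of ✓ p674104 `Negative/DiagTiltedLawFalse.lean`
  (critic N18: `(q_P)_ii = 0`, `(q_P)_im = n²(1 − P_i − P_m) + n|P|`; it REFUTES `diagTilted.Law`); the pair pencil
  `pv i m = udPt {i,m} − udPt {i} − udPt {m}` (`= E_im + E_mi`, OFF-diagonal), `⟨pv, x_b⟩ = 2 b_i b_m`,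
  `⟨pv, q_P⟩ = 2(n² + n|P| − n²(P_i+P_m))` (the pencil SEES `Q∘`), and ★ the COMMON LOCATED MAXIMISER: for every row
  `a ⊆ [n]∖{i,m}` the tilted row `udRow a + n²•pv` is maximised over `Q∘` at `P* = [n]∖{i,m}` (`val_le_val_star`).
* §4 ★★ THE FIRST NON-TRIVIAL LOCATED CASE: from ANY nonnegative factorization through `r+1` slots of the augmented slack of
  the pencil rows `udRow a + n²•pv ≤ 1 + 2n² + m_a` of `COR(n) + Q∘` one gets `3^{n−2} ≤ (r+1)·2^{n−2}` (`pairPencil_block`);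
  in Law currency: ★★★ `pinnedRows_law_holds_on_qOff` / `entryTilted_law_holds_on_qOff` — the `pinnedRows`-law (C⁺_loc) and
  the `entryTilted`-law (C⁺ = `LocatedPencilLaw` proper, box rhs = exact rhs for the pencil) HOLD ON `Q∘` with the literal
  conclusion `T c n < r` (rate lemma `T_lt_of_block` via the tree's `four_T_lt_two_pow`): the passenger that kills C⁺_diag
  is decided one rung up the `law_chain`.
* §5 the OBSTRUCTION, typed: a direction located at the coordinate face `F_{S,S'}` vanishes off-diagonally on the free block
  `U × U` and has `W_mm = −Σ_{i∈S}(W_im + W_mi)` there (`LocatedAt`); a generator `g` is PRIVATE at `(S,S')` if it vanishes on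
  `(S∪S')²` and `S'×U ∪ U×S'` and is column-constant `g_im = g_mi = g_mm` on `S×U` (`Private`); ★ `flat W ⬝ᵥ flat g = 0` for every
  located `W` and private `g` (`located_dot_private`), and the `U`-internal zero-diagonal generators `E^s_kl − E^s_km`
  (`k,l,m ∈ U`: the generators of crit-3's `Z_mix`) are private (`zgen_private`): no coordinate-located row pins them.

§4b THE CLASS: `PinExposed n K q` (a direction `w` maximised over COR on the whole coordinate face `F_S`, `2|S| ≤ n`, with ONE
passenger index maximising EVERY tilted row `udRow a + w`, `a ⊆ Sᶜ`) — ★★★ `pinnedRows_law_on_pinExposed`: C⁺_loc HOLDS on the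
class with literal `T c n < r` (`pin_block`, `T_lt_of_block'`); `pinExposed_qOff`: `Q^∘` is a member (`S = {i,m}`, `w = n²•pv`).
§4c P-W6a PAID (crit-9 g2 V#48 / N20): the CLASS «column-coupled affine cubes» — `cubePt Q₀ G P = flat (Q₀ + Σ_{g∈P} G g)`,
`ColumnCoupled G := ∃ x₀ (M0 ≥ 0), ∀ g, 1 ≤ |Σ_l M0_l (G g)_{l x₀}|` (`columnCoupled_of_entry`: one entry moved by every generator
suffices) — is DECIDED by C⁺_entry via N20's single-column NEGATIVE tilt `−t(a)Σ_l M0_l E_{l x₀}` (box rhs `1` = exact, COR-cost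
vanishing on the window `b ∌ x₀`, COMMON maximiser `P⋆ = {g : ⟨M0, col_{x₀} G g⟩ < 0}` for every row `a ∌ x₀`):
★★ `columnTilt_block` (`3^{n−1} ≤ (r+1)·2^{n−1}`), ★★★ `entryTilted_law_on_columnCoupled` (Law currency, literal `T c n < r`),
★ `concl_of_lawBody` (pointwise Yannakakis) ⇒ ★ `columnCoupled_decided` / `pinExposed_decided` (xc currency at the flat socket:
`HasEFOfSize (corPolytope n + conv q) r → T c n < r` — the shape a `CoreLaw` binder consumes); `qOff_eq_cubePt` + `columnCoupled_qOff`: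
`Q^∘` is a member (entry `(x′,x)` is moved by every generator by `n` or `n − n²`).
§4d THE OPEN QUESTION OF WAVE 6 (crit-9 g2 22:52:44Z «is the diagonal permutahedron `Q^Π_λ` blind to located pencils?»),
EXACT-rhs half, in kernel: `qPerm n λ π = flat (diag (−λπ(i)))`; ★★ `pinExposed_qPerm` — pin `{s₀}` at the top index, direction
`pinW = flat(diag D) + flat(colTilt s₀ M)` (`D = (i+1)_i` with `n²` at `s₀`, `M = (i+1)_{i≠s₀}`): maximal (`= n²`) on the WHOLE face
`{b ∋ s₀}` (`pinW_dotProduct_udPt_of_mem`, `pinW_valid`), `⟨udRow a + pinW, q_π⟩ = −λΣ_i (D_i + [i∈a])π(i)` (`pin_value`) with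
`i ↦ D_i + [i∈a]` monotone for EVERY `a`, so `rev` is a COMMON maximiser (`sum_rev_le`, rearrangement inequality); hence
★★★ `qPerm_decided : … 0 ≤ λ → (∃ j, e j = rev) → HasEFOfSize (corPolytope n + conv (qPerm n λ ∘ e)) r → T c n < r` and
★★ `pinnedRows_law_holds_on_qPerm` — `Q^Π_λ` is NOT blind to exact-rhs located rows.  The BOX-currency half (entryTilted, as
`LocatedPencilLaw` is typed) stays crit-9's `rank₊ M_{a,σ}` question: a-independent directions give `UDISJ + C·J`, `C = Σ_{i<s₀}(i+1)`,
which factorises with `n² + n + 1` slots (docstring §4d) — the answer SPLITS BY CURRENCY.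
§4e (rev 4) THE LAW OF RECORD AFTER N22 (crit-9 g2 23:07:41Z: box C⁺_entry FALSE on `Q^Π`, repaired statement = 38 g2's
`ExactPencilLaw := exactTilted.Law`, exact support value `h_COR`): `hCOR` / `exactTilted` / `ExactPencilLaw` restated VERBATIM from
`ExactPencil38.lean`; ★ `pinnedRows_emb_exactTilted` (every pinned row IS an exact row: `flat ∘ unflat = id`,
`h_COR(unflat w) = ⟨w, x_S⟩`), `exactPencilLaw_of_pinnedRowsLaw`, ★ THE RESTRICTION PRINCIPLE `exact_body_of_pinned_body`
(pointwise: the pinned body at `(q, r)` gives the exact body at `(q, r)`), and by name in the law-of-record currency: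
★★★ `exactTilted_law_on_pinExposed`, ★★★ `exactTilted_law_holds_on_qOff`, ★★★ `exactTilted_law_holds_on_qPerm` (the repaired
statement MISSES the N22 witness, in kernel), ★★★ `exactTilted_law_on_columnCoupled` (through the family-agnostic
★★ `columnTilt_block_family` and `hCOR_colTilt = 0`); `exact_law_chain : (pinnedRows.Law → ExactPencilLaw) ∧ (ExactPencilLaw →
allRows.Law) ∧ (allRows.Law → COR-VIRTUAL)`.
§5b (rev 5) THE CEILING OF THE PIN METHOD, typed: ★★ `not_pinExposed_of_zgen` / ★★ `not_pinExposed_of_allTriples` — an affine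
cube carrying a `U`-internal zero-diagonal generator `E^s_{kl} − E^s_{km}` inside the complement of every admissible pin set
(e.g. all triples, `n ≥ 6`: the `Z_mix` shape) is NOT `PinExposed`: a direction tight on the whole face `{b ⊇ S}` cannot see the
generator (`tight_dot_zgen`, mixed second differences), while the clique parts of the rows `{k,m}` / `{k,l}` see it with opposite
signs `±2` (`udRow_pair_dot_zgen_pos/neg`), so no cube vertex maximises both rows.  The enemy specification for C⁺_exact is
thereby a theorem about this seat's method (coordinate-face pins), in either currency.
§5c (rev 6) THE CEILING OF THE TEMPLATE, typed: ★★ `no_pure_block_of_zgen` — one level up: for ANY exact-tilted rows `(a, W_a)`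
(`a ⊆ U`, arbitrary tilt PER ROW, exact rhs), ANY listed passenger index per column `(S ∪ b, j_b)` (`b ⊆ U`, `S ∩ U = ∅`) and any
row bounds `m_a`, the exact-law slack block is NOT the pure pattern `(1 − |a∩b|)²` once the cube has a `U`-internal generator:
purity forces every `W_a` tight at six points (`tight4_dot_zgen` ⇒ `W_a ⟂` the generator) and `j_b` to maximise every row, and the
rows `{k,m}` / `{k,l}` flip.  Hence on `Z_mix`-shape cubes no C′-certificate can be a pure located block at a coordinate face
(the hypothesis `hblock` of `three_pow_le_of_block` with coordinate-face located rows is unattainable) — the typed ceiling of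
COORDINATE-FACE located certificates; 38 g2's `ExactPencil.cor_add_zgenCube_decided` (rev 6) shows a TRANSVERSAL face of COR
evades it and decides every zgen cube for C′, so such cubes are not enemies of C′: the pair is a dichotomy, not an enemy spec.
§5d (rev 8) THE COORDINATE-FACE CEILING FOR ANY PRIVATE SYMMETRIC GENERATOR: `coordTight_dot_private` (full coordinate-face
tightness over `U` ⇒ blind to every symmetric matrix supported off-diagonally in `U × U`) and ★★ `no_pure_block_of_private` (any
such generator with SIGN-INDEFINITE clique weight on two block rows ⇒ no pure coordinate-face block, any tilts / column indices /
row bounds) — covers 38 g2's enemy candidate `Q_II` (interaction differences, clique weights `∓2`) at coordinate faces.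
§7 (rev 9) THE TOGETHER FACE (first kernel lemmas of 38 g2's W7-K1 «sparse cubes are decided»): `blockW` (`W₀ = Σ_i (𝟙𝟙ᵀ − |A_i|·diag)`),
`blockW_dotProduct_udPt` (`= Σ_i |b∩A_i|(|b∩A_i| − |A_i|)`), `_nonpos`, ★ `_eq_zero_iff` (tight iff every block met in ∅ or whole),
`hCOR_blockW = 0`, `_le_neg_one` off the face, `blockW_tight_biUnion` (block unions of disjoint blocks are on the face) and
`card_reps_inter_biUnion` (representative rows × block unions = UDISJ_k pattern); (rev 10) the PINNING HALF's non-mechanical step: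
`exists_common_pin` (finitely many hyperplanes: one `P`-vector sees every test vector if each is seen by some), `exists_pin_of_vanishing_column`
(38's NON-BLOCKY LEMMA, constructive: `V = e_{x₀}(e_{y₀} − e_z)ᵀ`) and ★★ `exists_common_pin_of_sparse` (ONE weight orthogonal to the whole
together face seeing EVERY sparse generator).  (rev 11) the SCALING and both halves of the block read: ★★ `exists_togetherFace_weight` (`W := λ•(c•blockW A + V)`: `hCOR W = 0`, tight on
the together face, `|⟨udRow a, G t⟩| < |⟨W, G t⟩|` for ALL rows/generators), `cubePt_le_of_pins` (then `H⋆ = {t : 0 < ⟨W, G t⟩}` is a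
COMMON maximiser of every located row over all cube points), `togetherFace_ud_block` (representative rows × block unions read UDISJ_k).
What remains of W7-K1 is PLUMBING ONLY: the pure block inside the `exactTilted` law body (as in `columnTilt_block_family`) + the growth
arithmetic `(3/2)^{⌊n/s⌋} > T c n + 1`.
§6 (rev 7) THE CHAIN OF RECORD BY NAME after N22's kernel death (✓ p679540): `locatedPencilLaw_refuted : ¬ LocatedPencilLaw` by
`exact` from the landed refutation (δ), and `law_chain_of_record : ¬ LocatedPencilLaw ∧ (pinnedRows.Law → ExactPencilLaw) ∧
(ExactPencilLaw → allRows.Law) ∧ (allRows.Law → CorVirtualHardN)`.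
§8 (rev 12, g6) THE C′ CENSUS OF RECORD BY NAME (director R331 (2)(e), desk #399 (D2), crit-9 V#97 §5 format): this rev IMPORTS the
LANDED Theorems ports of §1–§7 (✓ p680125 … p683387 `…Theorems.FifoMatching.LocatedRows.*`, ✓ p682649 `…NNDivisionHardNegative.LocatedRows.*`)
and, in the sibling namespace `…Cruxes.NNDivisionHard.ValIdea40Census` (so that short names denote the LANDED declarations, not the verbatim
frame kept above for the record), states `LawBodyAt` / `TopDecidedAt` (the C′ law body, resp. the top law, at one passenger;
`law_iff_lawBodyAt` by `Iff.rfl`) and ★ `decided_species_of_record` — the law chain + every decided class landed so far, each conjunct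
the landed theorem applied verbatim — under a CENSUS TABLE (genus · membership test · level · rate · decl) that also lists the STAGED rows
(38 g2 `ExactPencil38` rev 16 → `Theorems/…ExactPencil*` parts 1–12) and the enemy specification of record.  §1–§7 are UNCHANGED (rev 11.1).  §8 (rev 13, g6): the census MOVED to `Cruxes/NNDivisionHard/Census40.lean` (200 000 B cap; crit-9 V#105b plan (a)); a pointer remains below.
HONEST FRAMING (critic tests (P1)/(iv)).  (1) TYPING: `pinnedRows` rows are normal-cone rows of coordinate vertices with the
EXACT right-hand side (38 g1 § Remark); `entryTilted`'s box rhs coincides with the exact rhs on the pencil.  (2) NOT A RENAME of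
`cliqueRows`/`diagTilted` reads: those are BLIND on `Q∘` (✓ p671347-style identity, ✓ p674104), the pencil is not
(`pv_dotProduct_qOff`).  (3) CURRENCY: in xc currency `Q∘` is exposed-fibre-decidable by the face-of-the-sum mechanism at the
codimension-2 coordinate face `F_{{i,m}}` (38's `located_point_rung` is the codimension-1 coordinate version, 40's
`exposedFibreRung_holds` the contraction-face version — neither covers `F_{{i,m}} +` pencil literally); the theorems here are the
LAW-currency statements (rank₊ of the FAMILY'S row slab under both row-max hypotheses), i.e. exactly what `LocatedPencilLaw` asserts,
on the member of record that separates C⁺_diag from C⁺_entry.  (4) LIMIT OF THE METHOD (§5): a located direction pins only the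
generators it pairs non-trivially with; generators private to the face are left to the clique parts `udRow a`, whose maximisers are
`a`-dependent — the configuration of every blindness identity so far (N4, PROP E, ✓ p670959, ✓ p674104).  For `Z_mix` (generators on
all triples) EVERY coordinate face with `|U| ≥ 3` carries private generators: coordinate-located exposure yields at most a constant
rung there — the obstruction named for W6-R1 / the successor of C⁺_entry.
Theorems and concrete data only; VP ≠ VNP is NOT proved; the crux `NNDivisionHard` stays OPEN.
-/

-- the mandated summit-side namespace repeats a component by design (single-problem summit)
set_option linter.dupNamespace false

namespace Summit.ValiantsHypothesis.ValiantsHypothesis.Cruxes.NNDivisionHard.ValIdea40.LocatedRows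

open Matrix Finset
open Literature.Barriers.PneNP (HasEFOfSize three_pow_le_card_mul_two_pow_of_cover_univ)
open Literature.Combinatorics.Optimization.FixedSizePsdRank (Cube bvec flat vecOuter corPolytope flat_dotProduct_vecOuter
  flat_dotProduct_le_of_mem_corPolytope)
open Summit.ValiantsHypothesis.ValiantsHypothesis.Theorems.FifoMatching.XcDivision
  (udInd udPt udRow udMat udInd_apply udInd_sq udInd_inter ud_data udRow_dotProduct_flat_diagonal flat_dotProduct_flat)
open Summit.ValiantsHypothesis.Theorems.NNDivisionHardNegative.CliqueRowBlind (sum_udInd_mem sum_udInd_univ)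
open Summit.ValiantsHypothesis.ValiantsHypothesis.Theorems.FifoMatching.GridCorShadow (four_T_lt_two_pow)
open Summit.ValiantsHypothesis.Theorems.NNDivisionHardNegative.DiagTilted
  (qOff qOffMat qOff_eq hasEFOfSize_qOff udRow_dotProduct_qOff udInd_compl udInd_univ)
open scoped Pointwise

/-! ## §1 Row families and their laws (frame of `CliqueRowBlind.lean` §4, verbatim) and the located family `pinnedRows` -/

/-- the line's budget scale `T c n = 2^{(log₂ n + c)^c}` (verbatim `XcDivision.T`). -/
def T (c n : ℕ) : ℕ := 2 ^ ((Nat.log 2 n + c) ^ c)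

/-- a half-space valid on a set is valid on its convex hull. -/
theorem dot_le_of_mem_convexHull {ι : Type} [Fintype ι] (S : Set (ι → ℝ)) (u : ι → ℝ) (δ : ℝ)
    (hS : ∀ y ∈ S, u ⬝ᵥ y ≤ δ) : ∀ y ∈ convexHull ℝ S, u ⬝ᵥ y ≤ δ := by
  intro y hy
  have hconv : Convex ℝ {z : ι → ℝ | u ⬝ᵥ z ≤ δ} :=
    convex_halfSpace_le ⟨fun a b => dotProduct_add u a b, fun c a => dotProduct_smul c u a⟩ δ
  exact (convexHull_min (fun z hz => hS z hz) hconv) hy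

/-- COR-VIRTUAL in the flat `corPolytope n` currency — verbatim `CliqueRowBlind.CorVirtualHardN` / `RecourseGraph.CorVirtualHardN`. -/
def CorVirtualHardN : Prop :=
  ∀ c : ℕ, ∃ n₀ : ℕ, ∀ n ≥ n₀, ∀ (K : ℕ) (q : Fin (K + 1) → (Fin (n * n) → ℝ)) (r : ℕ),
    HasEFOfSize (corPolytope n + convexHull ℝ (Set.range q)) r →
      HasEFOfSize (convexHull ℝ (Set.range q)) r → T c n < r

/-- A ROW FAMILY for the correlation polytopes (verbatim `CliqueRowBlind.RowFamily`). -/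
structure RowFamily where
  A : ℕ → Type
  ρ : ∀ n, A n → (Fin (n * n) → ℝ)
  β : ∀ n, A n → ℝ
  valid : ∀ n (a : A n), ∀ x ∈ corPolytope n, ρ n a ⬝ᵥ x ≤ β n a

/-- **THE `F`-ROW LAW** (verbatim `CliqueRowBlind.RowFamily.Law`). -/
def RowFamily.Law (F : RowFamily) : Prop :=
  ∀ c : ℕ, ∃ n₀ : ℕ, ∀ n ≥ n₀, ∀ (K : ℕ) (q : Fin (K + 1) → (Fin (n * n) → ℝ)) (r : ℕ),
    HasEFOfSize (convexHull ℝ (Set.range q)) r →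
    ∀ m : F.A n → ℝ, (∀ a j, F.ρ n a ⬝ᵥ q j ≤ m a) → (∀ a, ∃ j, F.ρ n a ⬝ᵥ q j = m a) →
    ∀ (U : F.A n → Option (Fin r) → ℝ) (V : Finset (Fin n) × Fin (K + 1) → Option (Fin r) → ℝ),
      (∀ a i, 0 ≤ U a i) → (∀ p i, 0 ≤ V p i) →
      (∀ a b j, (F.β n a + m a) - F.ρ n a ⬝ᵥ (udPt b + q j) = ∑ i, U a i * V (b, j) i) → T c n < r

/-- ★ EVERY ROW-FAMILY LAW IMPLIES COR-VIRTUAL (Yannakakis once; verbatim `CliqueRowBlind.corVirtualHardN_of_law`). -/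
theorem corVirtualHardN_of_law (F : RowFamily) (hL : F.Law) : CorVirtualHardN := by
  classical
  intro c
  obtain ⟨n₀, hn₀⟩ := hL c
  refine ⟨n₀, fun n hn K q r hR hQ => ?_⟩
  obtain ⟨pt_mem, -, -, -⟩ := ud_data n
  let m : F.A n → ℝ := fun a =>
    Finset.univ.sup' Finset.univ_nonempty (fun j : Fin (K + 1) => F.ρ n a ⬝ᵥ q j)
  have hmax : ∀ a, ∃ j, F.ρ n a ⬝ᵥ q j = m a := fun a => by
    obtain ⟨j, -, hj⟩ := Finset.exists_mem_eq_sup' Finset.univ_nonempty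
      (fun j : Fin (K + 1) => F.ρ n a ⬝ᵥ q j)
    exact ⟨j, hj.symm⟩
  have hmq : ∀ a j, F.ρ n a ⬝ᵥ q j ≤ m a := fun a j =>
    Finset.le_sup' (fun j : Fin (K + 1) => F.ρ n a ⬝ᵥ q j) (Finset.mem_univ j)
  have hm : ∀ a, ∀ y ∈ convexHull ℝ (Set.range q), F.ρ n a ⬝ᵥ y ≤ m a := fun a =>
    dot_le_of_mem_convexHull _ _ _ (by rintro _ ⟨j, rfl⟩; exact hmq a j)
  have hq : ∀ j, q j ∈ convexHull ℝ (Set.range q) := fun j => subset_convexHull ℝ _ ⟨j, rfl⟩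
  have hv : ∀ p : Finset (Fin n) × Fin (K + 1),
      udPt p.1 + q p.2 ∈ corPolytope n + convexHull ℝ (Set.range q) :=
    fun p => Set.add_mem_add (pt_mem p.1) (hq p.2)
  have hvalid : ∀ a, ∀ x ∈ corPolytope n + convexHull ℝ (Set.range q), F.ρ n a ⬝ᵥ x ≤ F.β n a + m a := by
    rintro a x ⟨p, hp, y, hy, rfl⟩
    rw [dotProduct_add]
    exact add_le_add (F.valid n a p hp) (hm a y hy)
  obtain ⟨U, V, hU, hV, hfac⟩ := Literature.Barriers.PneNP.HasEFOfSize.exists_nonneg_factorization hR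
    (fun p : Finset (Fin n) × Fin (K + 1) => udPt p.1 + q p.2) hv (F.ρ n) (fun a => F.β n a + m a) hvalid
  exact hn₀ n hn K q r hQ m hmq hmax U V hU hV (fun a b j => hfac a (b, j))

/-- An EMBEDDING of row families (verbatim `CliqueRowBlind.RowFamily.Emb`). -/
structure RowFamily.Emb (F G : RowFamily) where
  φ : ∀ n, F.A n → G.A n
  ρ_eq : ∀ n a, G.ρ n (φ n a) = F.ρ n a
  β_eq : ∀ n a, G.β n (φ n a) = F.β n a

/-- ★ LAWS ARE MONOTONE along embeddings (verbatim `CliqueRowBlind.RowFamily.Law.mono`). -/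
theorem RowFamily.Law.mono {F G : RowFamily} (e : RowFamily.Emb F G) (hF : F.Law) : G.Law := by
  intro c
  obtain ⟨n₀, hn₀⟩ := hF c
  refine ⟨n₀, fun n hn K q r hQ m hmq hmax U V hU hV hfac => ?_⟩
  refine hn₀ n hn K q r hQ (fun a => m (e.φ n a)) (fun a j => ?_) (fun a => ?_)
    (fun a => U (e.φ n a)) V (fun a i => hU _ i) hV (fun a b j => ?_)
  · rw [← e.ρ_eq n a]; exact hmq _ j
  · obtain ⟨j, hj⟩ := hmax (e.φ n a); exact ⟨j, by rw [← e.ρ_eq n a]; exact hj⟩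
  · rw [← e.ρ_eq n a, ← e.β_eq n a]; exact hfac _ b j

/-- ALL valid rows (verbatim `CliqueRowBlind.allRows`). -/
@[reducible] def allRows : RowFamily where
  A := fun n => {cd : (Fin (n * n) → ℝ) × ℝ // ∀ x ∈ corPolytope n, cd.1 ⬝ᵥ x ≤ cd.2}
  ρ := fun _ a => a.1.1
  β := fun _ a => a.1.2
  valid := fun _ a => a.2

/-- box validity: `⟨flat W, x⟩ ≤ Σ_{i,m} max(W_im, 0)` on `COR(n)` (verbatim `CliqueRowBlind.flat_le_box`). -/
theorem flat_le_box {n : ℕ} (W : Matrix (Fin n) (Fin n) ℝ) :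
    ∀ x ∈ corPolytope n, flat W ⬝ᵥ x ≤ ∑ i, ∑ m, max (W i m) 0 := by
  intro y hy
  refine flat_dotProduct_le_of_mem_corPolytope hy ⟨(W, ∑ i, ∑ m, max (W i m) 0), fun x hx => ?_⟩
  refine Finset.sum_le_sum fun i _ => Finset.sum_le_sum fun m _ => ?_
  rcases hx i with hi | hi <;> rcases hx m with hm | hm <;> simp [hi, hm]

/-- **C⁺ = `LocatedPencilLaw` := `entryTilted.Law`** (verbatim `CliqueRowBlind.entryTilted`): clique rows tilted by an
ARBITRARY matrix direction with the box right-hand side `udRow a + flat W ≤ 1 + Σ max(W_im, 0)`. -/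
@[reducible] def entryTilted : RowFamily where
  A := fun n => Finset (Fin n) × Matrix (Fin n) (Fin n) ℝ
  ρ := fun _ a => udRow a.1 + flat a.2
  β := fun _ a => 1 + ∑ i, ∑ m, max (a.2 i m) 0
  valid := fun n a x hx => by
    rw [add_dotProduct]
    exact add_le_add ((ud_data n).2.1 a.1 x hx) (flat_le_box a.2 x hx)

/-- `C⁺ := entryTilted.Law` under its card name (verbatim). -/
def LocatedPencilLaw : Prop := entryTilted.Law

/-- ★ **THE LOCATED FAMILY WITH EXACT RIGHT-HAND SIDES** (`pinnedRows`; C⁺_loc := `pinnedRows.Law`): clique rows tilted by ANY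
direction `w` that is maximised over `COR(n)` at a coordinate vertex `x_S = udPt S`, with the EXACT right-hand side
`1 + ⟨w, x_S⟩`: `udRow a + w ≤ 1 + ⟨w, x_S⟩`.  Every row located at a coordinate face `F_{S,S'}` (a direction in its normal cone)
is a member (it is maximised at the vertex `x_S ∈ F_{S,S'}`); so are PROP B's diagonal reads, the pair pencils of §3, the
switched-face rows `±E_im` and PROP E's gadget rows (`a = ∅`, `w = μ·andDir + D_{a'}`, maximised at a 2-element vertex). -/
@[reducible] def pinnedRows : RowFamily where
  A := fun n => Finset (Fin n) ×
    {wS : (Fin (n * n) → ℝ) × Finset (Fin n) // ∀ x ∈ corPolytope n, wS.1 ⬝ᵥ x ≤ wS.1 ⬝ᵥ udPt wS.2}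
  ρ := fun _ a => udRow a.1 + a.2.1.1
  β := fun _ a => 1 + a.2.1.1 ⬝ᵥ udPt a.2.1.2
  valid := fun n a x hx => by
    rw [add_dotProduct]
    exact add_le_add ((ud_data n).2.1 a.1 x hx) (a.2.2 x hx)

/-- `pinnedRows ↪ allRows`. -/
def pinnedRows_emb_allRows : RowFamily.Emb pinnedRows allRows where
  φ := fun n a => ⟨(pinnedRows.ρ n a, pinnedRows.β n a), pinnedRows.valid n a⟩
  ρ_eq := fun _ _ => rfl
  β_eq := fun _ _ => rfl

/-- ★ `C⁺_loc ⟹ allRows.Law ⟹ COR-VIRTUAL` (PROVED). -/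
theorem corVirtualHardN_of_pinnedRowsLaw (h : pinnedRows.Law) : CorVirtualHardN :=
  corVirtualHardN_of_law allRows (RowFamily.Law.mono pinnedRows_emb_allRows h)

/-! ## §2 ★ The law-currency located block count -/

/-- ★★ **LAW-CURRENCY LOCATED BLOCK COUNT.**  If a matrix with a nonnegative factorization through the slot type `ι`,
`M ρ κ = Σ_i U ρ i · V κ i`, contains an embedded unique-disjointness block — rows `row a'`, columns `col b'` (`a' b' ⊆ α`) on
which `M (row a') (col b') = (1 − |a' ∩ b'|)²` — then `3^{|α|} ≤ |ι| · 2^{|α|}`: the support rectangles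
`{a' : U > 0} × {b' : V > 0}` of the slots avoid `|a'∩b'| = 1` and cover the disjoint pairs (Kaibel–Weltge). -/
theorem three_pow_le_of_block {R C ι α : Type*} [Fintype ι] [Fintype α] [DecidableEq α]
    (U : R → ι → ℝ) (V : C → ι → ℝ) (hU : ∀ ρ i, 0 ≤ U ρ i) (hV : ∀ κ i, 0 ≤ V κ i)
    (row : Finset α → R) (col : Finset α → C)
    (hblock : ∀ a b : Finset α, ∑ i, U (row a) i * V (col b) i = (1 - ((a ∩ b).card : ℝ)) ^ 2) :
    3 ^ Fintype.card α ≤ Fintype.card ι * 2 ^ Fintype.card α := by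
  classical
  have key := three_pow_le_card_mul_two_pow_of_cover_univ (α := α) (Finset.univ : Finset ι)
    (fun i => {a : Finset α | 0 < U (row a) i}) (fun i => {b : Finset α | 0 < V (col b) i}) ?_ ?_
  · rwa [Finset.card_univ] at key
  · intro i _ a ha b hb h1
    have ha' : 0 < U (row a) i := ha
    have hb' : 0 < V (col b) i := hb
    have hsum := hblock a b
    rw [h1, Nat.cast_one, sub_self] at hsum
    have hle : U (row a) i * V (col b) i ≤ ∑ j, U (row a) j * V (col b) j :=
      Finset.single_le_sum (fun j _ => mul_nonneg (hU _ j) (hV _ j)) (Finset.mem_univ i)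
    rw [hsum] at hle
    norm_num at hle
    exact absurd hle (not_le.mpr (mul_pos ha' hb'))
  · intro a b hab
    have hsum := hblock a b
    rw [Finset.disjoint_iff_inter_eq_empty.mp hab, Finset.card_empty, Nat.cast_zero, sub_zero, one_pow] at hsum
    have hpos : 0 < ∑ j, U (row a) j * V (col b) j := by rw [hsum]; exact one_pos
    obtain ⟨j, -, hj⟩ : ∃ j ∈ (Finset.univ : Finset ι), 0 < U (row a) j * V (col b) j := by
      by_contra h
      push Not at h
      exact absurd (Finset.sum_nonpos h) (not_le.mpr hpos)
    have hUj : 0 < U (row a) j := lt_of_le_of_ne (hU _ j) (fun h => by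
      rw [← h, zero_mul] at hj; exact lt_irrefl _ hj)
    have hVj : 0 < V (col b) j := lt_of_le_of_ne (hV _ j) (fun h => by
      rw [← h, mul_zero] at hj; exact lt_irrefl _ hj)
    exact ⟨j, Finset.mem_univ _, hUj, hVj⟩

/-! ## §3 The zero-diagonal cube `Q^∘`, the pair pencil, and the common located maximiser -/

section ZeroDiag
variable {n : ℕ}

/-- `⟨x_c, x_b⟩ = (Σ_{p ∈ c} 𝟙_b(p))² = |c ∩ b|²`. -/
theorem udPt_dotProduct_udPt (c b : Finset (Fin n)) :
    udPt c ⬝ᵥ udPt b = ((c ∩ b).card : ℝ) ^ 2 := by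
  classical
  have h : udPt c ⬝ᵥ udPt b = ∑ i, ∑ j, (udInd c i * udInd c j) * (udInd b i * udInd b j) := by
    show flat (fun i j => udInd c i * udInd c j) ⬝ᵥ vecOuter n (udInd b) = _
    exact flat_dotProduct_vecOuter _ _
  rw [h]
  have h2 : ∑ i, ∑ j, (udInd c i * udInd c j) * (udInd b i * udInd b j)
      = (∑ i, udInd c i * udInd b i) * (∑ j, udInd c j * udInd b j) := by
    rw [Finset.sum_mul_sum]
    refine Finset.sum_congr rfl fun i _ => Finset.sum_congr rfl fun j _ => by ring
  rw [h2, udInd_inter, sq]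

/-! The passenger is THE ZERO-DIAGONAL CUBE OF RECORD `Q∘ = conv{qOff P}` of ✓ p674104
(`Negative/DiagTiltedLawFalse.lean`, critic N18): `(q_P)_ii = 0`, `(q_P)_im = n²(1 − P_i − P_m) + n|P|` (`i ≠ m`);
`qOff_eq : q_P = n²•(x_{Pᶜ} − x_P) + n|P|•x_univ + diag(n²(2·𝟙_P − 1) − n|P|)`, `⟨udRow a, q_P⟩ = −(|a|−1)·n·(n|a| − 2n|a∩P| + |a||P|)`
(`udRow_dotProduct_qOff`), budget `hasEFOfSize_qOff : xc(Q∘) ≤ 2n`, and `diagTiltedLaw_false : ¬ diagTilted.Law`. -/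

/-- the PAIR PENCIL `pv i m = x_{{i,m}} − x_{{i}} − x_{{m}}` (`= E_im + E_mi` for `i ≠ m`). -/
def pv (i m : Fin n) : Fin (n * n) → ℝ := udPt {i, m} - udPt {i} - udPt {m}

/-- helper: `Σ_{p ∈ {i,m}} f p = f i + f m`, `Σ_{p ∈ {i}} f p = f i` packaged for `udPt` pairings. -/
theorem udPt_pair_dotProduct_udPt {i m : Fin n} (him : i ≠ m) (b : Finset (Fin n)) :
    udPt {i, m} ⬝ᵥ udPt b = (udInd b i + udInd b m) ^ 2 := by
  classical
  rw [udPt_dotProduct_udPt]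
  congr 1
  have : (({i, m} : Finset (Fin n)) ∩ b) = ({i, m} : Finset (Fin n)).filter (· ∈ b) := by
    ext x; simp [Finset.mem_filter, Finset.mem_inter]
  rw [this, Finset.card_filter, Finset.sum_pair him, udInd_apply, udInd_apply]
  push_cast
  ring

theorem udPt_single_dotProduct_udPt (i : Fin n) (b : Finset (Fin n)) :
    udPt {i} ⬝ᵥ udPt b = udInd b i ^ 2 := by
  classical
  rw [udPt_dotProduct_udPt, udInd_apply]
  by_cases hi : i ∈ b
  · rw [Finset.singleton_inter_of_mem hi, Finset.card_singleton, if_pos hi]; norm_num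
  · rw [Finset.singleton_inter_of_notMem hi, Finset.card_empty, if_neg hi]; norm_num

/-- ★ `⟨pv, x_b⟩ = 2·𝟙_b(i)·𝟙_b(m)`. -/
theorem pv_dotProduct_udPt {i m : Fin n} (him : i ≠ m) (b : Finset (Fin n)) :
    pv i m ⬝ᵥ udPt b = 2 * (udInd b i * udInd b m) := by
  rw [pv, sub_dotProduct, sub_dotProduct, udPt_pair_dotProduct_udPt him, udPt_single_dotProduct_udPt,
    udPt_single_dotProduct_udPt]
  ring

/-- `⟨pv, diag d⟩ = 0` (the pencil is off-diagonal). -/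
theorem pv_dotProduct_flat_diagonal {i m : Fin n} (him : i ≠ m) (d : Fin n → ℝ) :
    pv i m ⬝ᵥ flat (Matrix.diagonal d) = 0 := by
  classical
  obtain ⟨-, -, -, diag⟩ := ud_data n
  have e : ∀ c : Finset (Fin n), udPt c ⬝ᵥ flat (Matrix.diagonal d) = ∑ p ∈ c, d p := fun c => by
    rw [dotProduct_comm]; exact diag d c
  rw [pv, sub_dotProduct, sub_dotProduct, e, e, e, Finset.sum_pair him, Finset.sum_singleton, Finset.sum_singleton]
  ring

/-- ★ `⟨pv, q_P⟩ = 2(n² + n|P| − n²(P_i + P_m))` — the pencil SEES `Q∘` (it varies with `P`). -/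
theorem pv_dotProduct_qOff {i m : Fin n} (him : i ≠ m) (P : Finset (Fin n)) :
    pv i m ⬝ᵥ qOff P = 2 * ((n : ℝ) ^ 2 + (n : ℝ) * P.card - (n : ℝ) ^ 2 * (udInd P i + udInd P m)) := by
  classical
  have hu := pv_dotProduct_udPt him (Finset.univ : Finset (Fin n))
  rw [udInd_univ, udInd_univ] at hu
  have hP := pv_dotProduct_udPt him P
  have hPc := pv_dotProduct_udPt him Pᶜ
  rw [udInd_compl, udInd_compl] at hPc
  rw [qOff_eq]
  simp only [dotProduct_sub, dotProduct_add, dotProduct_smul, smul_eq_mul]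
  rw [hu, hP, hPc, pv_dotProduct_flat_diagonal him]
  ring

/-- the pencil is valid: `⟨pv, x⟩ ≤ 2 = ⟨pv, x_{{i,m}}⟩` on `COR(n)` — `pv` is maximised at the vertex `x_{{i,m}}`. -/
theorem pv_le_two {i m : Fin n} (him : i ≠ m) : ∀ x ∈ corPolytope n, pv i m ⬝ᵥ x ≤ 2 := by
  classical
  refine dot_le_of_mem_convexHull _ _ _ ?_
  rintro _ ⟨c, rfl⟩
  show pv i m ⬝ᵥ vecOuter n (bvec c) ≤ 2
  have hc : vecOuter n (bvec c) = udPt (Finset.univ.filter fun j => c j = true) := by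
    show vecOuter n (bvec c) = vecOuter n (udInd _)
    congr 1
    funext j
    rw [udInd_apply]
    simp only [Finset.mem_filter, Finset.mem_univ, true_and, bvec]
  rw [hc, pv_dotProduct_udPt him]
  have h0 := fun j => (udInd_apply (Finset.univ.filter fun j => c j = true) j)
  have hi : udInd (Finset.univ.filter fun j => c j = true) i ≤ 1 := by rw [h0]; split_ifs <;> norm_num
  have hm : udInd (Finset.univ.filter fun j => c j = true) m ≤ 1 := by rw [h0]; split_ifs <;> norm_num
  have hi0 : 0 ≤ udInd (Finset.univ.filter fun j => c j = true) i := by rw [h0]; split_ifs <;> norm_num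
  have hm0 : 0 ≤ udInd (Finset.univ.filter fun j => c j = true) m := by rw [h0]; split_ifs <;> norm_num
  nlinarith [mul_le_mul hi hm hm0 zero_le_one]

theorem pv_dotProduct_udPt_pair {i m : Fin n} (him : i ≠ m) : pv i m ⬝ᵥ udPt {i, m} = 2 := by
  classical
  rw [pv_dotProduct_udPt him, udInd_apply, udInd_apply, if_pos (by simp), if_pos (by simp)]; ring

/-- the tilted pencil row `ρ_a = udRow a + n²•pv` evaluated on `q_P` (`val a P`). -/
def val (i m : Fin n) (a P : Finset (Fin n)) : ℝ := (udRow a + ((n : ℝ) ^ 2) • pv i m) ⬝ᵥ qOff P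

theorem val_eq {i m : Fin n} (him : i ≠ m) (a P : Finset (Fin n)) :
    val i m a P = -(((a.card : ℝ) - 1) * n * (n * a.card - 2 * n * (a ∩ P).card + a.card * P.card))
      + (n : ℝ) ^ 2 * (2 * ((n : ℝ) ^ 2 + (n : ℝ) * P.card - (n : ℝ) ^ 2 * (udInd P i + udInd P m))) := by
  rw [val, add_dotProduct, smul_dotProduct, smul_eq_mul, udRow_dotProduct_qOff, pv_dotProduct_qOff him]

/-- ★ **THE COMMON LOCATED MAXIMISER.**  For every row `a ⊆ [n] ∖ {i,m}` the tilted pencil row `udRow a + n²•pv` is maximised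
over `Q∘` at `P* = [n] ∖ {i,m}` — ONE chamber for the whole located block. -/
theorem val_le_val_star {i m : Fin n} (him : i ≠ m) {a : Finset (Fin n)} (ha : a ⊆ ({i, m} : Finset (Fin n))ᶜ)
    (P : Finset (Fin n)) : val i m a P ≤ val i m a ({i, m} : Finset (Fin n))ᶜ := by
  classical
  rw [val_eq him, val_eq him]
  -- data of P* = {i,m}ᶜ
  have hpair : (({i, m} : Finset (Fin n))).card = 2 := Finset.card_pair him
  have hn2 : 2 ≤ n := by
    have := Finset.card_le_univ ({i, m} : Finset (Fin n)); rw [hpair, Fintype.card_fin] at this; exact this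
  have hstar_card : ((({i, m} : Finset (Fin n))ᶜ).card : ℝ) = n - 2 := by
    rw [Finset.card_compl, hpair, Fintype.card_fin, Nat.cast_sub hn2]; norm_num
  have hstar_inter : a ∩ ({i, m} : Finset (Fin n))ᶜ = a := Finset.inter_eq_left.2 ha
  have hstar_i : udInd (({i, m} : Finset (Fin n))ᶜ) i = 0 := by
    rw [udInd_apply, if_neg (by simp)]
  have hstar_m : udInd (({i, m} : Finset (Fin n))ᶜ) m = 0 := by
    rw [udInd_apply, if_neg (by simp)]
  rw [hstar_card, hstar_inter, hstar_i, hstar_m]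
  -- data of P: u = P_i + P_m, p' = |P ∩ {i,m}ᶜ|, t = |a ∩ P|
  set k : ℝ := (a.card : ℝ) with hk
  set t : ℝ := ((a ∩ P).card : ℝ) with ht
  set p' : ℝ := ((P ∩ ({i, m} : Finset (Fin n))ᶜ).card : ℝ) with hp'
  have hu_eq : ((P ∩ ({i, m} : Finset (Fin n))).card : ℝ) = udInd P i + udInd P m := by
    have : P ∩ ({i, m} : Finset (Fin n)) = ({i, m} : Finset (Fin n)).filter (· ∈ P) := by
      ext x; simp only [Finset.mem_inter, Finset.mem_filter]; tauto
    rw [this, Finset.card_filter, Finset.sum_pair him, udInd_apply, udInd_apply]; push_cast; ring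
  have hsplit : (P.card : ℝ) = p' + (udInd P i + udInd P m) := by
    rw [← hu_eq, hp']
    have h := Finset.card_filter_add_card_filter_not (s := P) (fun x => x ∈ (({i, m} : Finset (Fin n))ᶜ))
    have e1 : P.filter (fun x => x ∈ (({i, m} : Finset (Fin n))ᶜ)) = P ∩ ({i, m} : Finset (Fin n))ᶜ := by
      ext x; simp only [Finset.mem_filter, Finset.mem_inter]
    have e2 : P.filter (fun x => ¬ x ∈ (({i, m} : Finset (Fin n))ᶜ)) = P ∩ ({i, m} : Finset (Fin n)) := by
      ext x; simp only [Finset.mem_filter, Finset.mem_inter, Finset.mem_compl, not_not]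
    rw [e1, e2] at h
    have := congrArg (fun z : ℕ => (z : ℝ)) h
    push_cast at this
    linarith
  have hPi0 : 0 ≤ udInd P i := by rw [udInd_apply]; split_ifs <;> norm_num
  have hPm0 : 0 ≤ udInd P m := by rw [udInd_apply]; split_ifs <;> norm_num
  have htk : t ≤ k := by
    rw [ht, hk]; exact_mod_cast Finset.card_le_card Finset.inter_subset_left
  have htp : t ≤ p' := by
    rw [ht, hp']
    exact_mod_cast Finset.card_le_card (Finset.subset_inter Finset.inter_subset_right
      ((Finset.inter_subset_left).trans ha))
  have hkn : k ≤ n - 2 := by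
    rw [hk, ← hstar_card]; exact_mod_cast Finset.card_le_card ha
  have hpn : p' ≤ n - 2 := by
    rw [hp', ← hstar_card]; exact_mod_cast Finset.card_le_card Finset.inter_subset_right
  have ht0 : 0 ≤ t := by rw [ht]; exact Nat.cast_nonneg _
  have hk0 : 0 ≤ k := by rw [hk]; exact Nat.cast_nonneg _
  have hn0 : (0 : ℝ) ≤ n := Nat.cast_nonneg _
  -- (k-1)(k-t) ≥ 0 over the naturals
  have hkt : 0 ≤ (k - 1) * (k - t) := by
    rcases Nat.eq_zero_or_pos a.card with h0 | hpos
    · have hk0' : k = 0 := by rw [hk, h0, Nat.cast_zero]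
      have ht0' : t = 0 := le_antisymm (hk0' ▸ htk) ht0
      rw [hk0', ht0']; norm_num
    · have hk1 : 1 ≤ k := by rw [hk]; exact_mod_cast hpos
      exact mul_nonneg (by linarith) (by linarith)
  rw [hsplit]
  set u : ℝ := udInd P i + udInd P m with hu
  have hu0 : 0 ≤ u := by rw [hu]; exact add_nonneg hPi0 hPm0
  have hkk : k * (k - 1) ≤ 2 * (n : ℝ) ^ 2 := by nlinarith
  have h1 : 0 ≤ 2 * (n : ℝ) ^ 2 * ((k - 1) * (k - t)) := by positivity
  have h2 : 0 ≤ n * ((n : ℝ) - 2 - p') * (2 * (n : ℝ) ^ 2 - k * (k - 1)) :=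
    mul_nonneg (mul_nonneg hn0 (by linarith)) (by linarith)
  have hn1 : (1 : ℝ) ≤ n := by exact_mod_cast (show 1 ≤ n by omega)
  have h3 : 0 ≤ u * (n * (k * (k - 1)) + 2 * (n : ℝ) ^ 3 * ((n : ℝ) - 1)) := by
    refine mul_nonneg hu0 (add_nonneg ?_ ?_)
    · rcases Nat.eq_zero_or_pos a.card with h0 | hpos
      · have hk0' : k = 0 := by rw [hk, h0, Nat.cast_zero]
        rw [hk0']; norm_num
      · have hk1 : 1 ≤ k := by rw [hk]; exact_mod_cast hpos
        exact mul_nonneg hn0 (mul_nonneg hk0 (by linarith))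
    · exact mul_nonneg (by positivity) (by linarith)
  linarith [h1, h2, h3]

end ZeroDiag

/-! ## §4 ★★ The first non-trivial located case: the pair pencil decides `Q^∘` in Law currency -/

section Decide
variable {n : ℕ}

/-- ★★ **THE PAIR PENCIL BLOCK.**  For ANY right-hand-side function `mrow` dominating the pencil rows on `Q^∘` and attained, and
ANY nonnegative factorization through `r + 1` slots of the augmented slack
`(1 + 2n² + mrow a) − ⟨udRow a + n²•pv, x_b + q_{e j}⟩` of `COR(n) + Q^∘`: `3^{n−2} ≤ (r+1)·2^{n−2}`.
(Block: rows `a ⊆ [n]∖{i,m}`, columns `({i,m} ∪ b', P*)`; there the slack is `(1 − |a ∩ b'|)²` by `val_le_val_star`.) -/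
theorem pairPencil_block {i m : Fin n} (him : i ≠ m) {K r : ℕ} (e : Fin (K + 1) ≃ Finset (Fin n))
    (mrow : Finset (Fin n) → ℝ)
    (hle : ∀ a j, (udRow a + ((n : ℝ) ^ 2) • pv i m) ⬝ᵥ qOff (e j) ≤ mrow a)
    (hat : ∀ a, ∃ j, (udRow a + ((n : ℝ) ^ 2) • pv i m) ⬝ᵥ qOff (e j) = mrow a)
    (U : Finset (Fin n) → Option (Fin r) → ℝ) (V : Finset (Fin n) × Fin (K + 1) → Option (Fin r) → ℝ)
    (hU : ∀ a s, 0 ≤ U a s) (hV : ∀ p s, 0 ≤ V p s)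
    (hfac : ∀ a b j, ((1 + 2 * (n : ℝ) ^ 2) + mrow a) - (udRow a + ((n : ℝ) ^ 2) • pv i m) ⬝ᵥ (udPt b + qOff (e j))
      = ∑ s, U a s * V (b, j) s) :
    3 ^ (n - 2) ≤ (r + 1) * 2 ^ (n - 2) := by
  classical
  -- the free ground set G = {i,m}ᶜ as a type
  let G : Finset (Fin n) := ({i, m} : Finset (Fin n))ᶜ
  let α := {x : Fin n // x ∈ G}
  have hcardα : Fintype.card α = n - 2 := by
    rw [Fintype.card_coe, Finset.card_compl, Finset.card_pair him, Fintype.card_fin]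
  let emb : α ↪ Fin n := Function.Embedding.subtype _
  let row : Finset α → Finset (Fin n) := fun a' => a'.map emb
  let jstar : Fin (K + 1) := e.symm G
  let col : Finset α → Finset (Fin n) × Fin (K + 1) := fun b' => (({i, m} : Finset (Fin n)) ∪ b'.map emb, jstar)
  have hrowG : ∀ a' : Finset α, row a' ⊆ G := fun a' x hx => by
    obtain ⟨y, -, rfl⟩ := Finset.mem_map.1 hx; exact y.2
  obtain ⟨-, -, slack, -⟩ := ud_data n
  have key := three_pow_le_of_block (ι := Option (Fin r)) U V hU hV row col ?_
  · rw [hcardα, Fintype.card_option, Fintype.card_fin] at key; exact key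
  intro a' b'
  rw [← hfac (row a') _ jstar]
  -- m equals the value at P* on rows inside G
  have hm : mrow (row a') = val i m (row a') G := by
    obtain ⟨j₀, hj₀⟩ := hat (row a')
    have h1 : val i m (row a') (e j₀) = mrow (row a') := hj₀
    have h2 := hle (row a') jstar
    have h2' : val i m (row a') G ≤ mrow (row a') := by
      have : e jstar = G := e.apply_symm_apply G
      rw [← this]; exact h2
    have h3 := val_le_val_star him (hrowG a') (e j₀)
    rw [h1] at h3
    exact le_antisymm h3 h2'
  have hGe : e jstar = G := e.apply_symm_apply G
  -- the three parts of the slack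
  have hud : udRow (row a') ⬝ᵥ udPt (({i, m} : Finset (Fin n)) ∪ b'.map emb)
      = 1 - (1 - (((a' ∩ b').card : ℕ) : ℝ)) ^ 2 := by
    have := slack (row a') (({i, m} : Finset (Fin n)) ∪ b'.map emb)
    have hint : row a' ∩ (({i, m} : Finset (Fin n)) ∪ b'.map emb) = (a' ∩ b').map emb := by
      rw [Finset.inter_union_distrib_left, Finset.map_inter]
      have h0 : row a' ∩ ({i, m} : Finset (Fin n)) = ∅ := by
        refine Finset.subset_empty.1 fun x hx => ?_
        have hxG := hrowG a' (Finset.mem_inter.1 hx).1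
        exact absurd (Finset.mem_inter.1 hx).2 (Finset.mem_compl.1 hxG)
      rw [h0, Finset.empty_union]
    rw [hint, Finset.card_map] at this
    linarith
  have hpvb : pv i m ⬝ᵥ udPt (({i, m} : Finset (Fin n)) ∪ b'.map emb) = 2 := by
    rw [pv_dotProduct_udPt him, udInd_apply, udInd_apply, if_pos (by simp), if_pos (by simp)]; ring
  show ((1 + 2 * (n : ℝ) ^ 2) + mrow (row a')) - (udRow (row a') + ((n : ℝ) ^ 2) • pv i m) ⬝ᵥ
      (udPt (({i, m} : Finset (Fin n)) ∪ b'.map emb) + qOff (e jstar)) = (1 - ((a' ∩ b').card : ℝ)) ^ 2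
  rw [dotProduct_add, hGe, show (udRow (row a') + ((n : ℝ) ^ 2) • pv i m) ⬝ᵥ qOff G = val i m (row a') G from rfl,
    ← hm, add_dotProduct, smul_dotProduct, smul_eq_mul, hud, hpvb]
  ring

/-- the pencil row as a member of `pinnedRows`: direction `n²•pv`, located vertex `S = {i,m}`, rhs `1 + 2n²`. -/
def pencilRow {i m : Fin n} (him : i ≠ m) (a : Finset (Fin n)) : pinnedRows.A n :=
  (a, ⟨(((n : ℝ) ^ 2) • pv i m, {i, m}), fun x hx => by
    show ((n : ℝ) ^ 2) • pv i m ⬝ᵥ x ≤ ((n : ℝ) ^ 2) • pv i m ⬝ᵥ udPt {i, m}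
    rw [smul_dotProduct, smul_dotProduct, smul_eq_mul, smul_eq_mul, pv_dotProduct_udPt_pair him]
    exact mul_le_mul_of_nonneg_left (pv_le_two him x hx) (by positivity)⟩)

/-- ★★ **C⁺_loc SEES `Q^∘`** (the first non-trivial located case, Law currency): for every `n`, every `i ≠ m`, every
enumeration `e` of the vertices of the zero-diagonal cube, and every `m, U, V` as in `pinnedRows.Law`:
`3^{n−2} ≤ (r+1)·2^{n−2}`. -/
theorem pinnedRows_decide_qOff {i m : Fin n} (him : i ≠ m) {K r : ℕ} (e : Fin (K + 1) ≃ Finset (Fin n))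
    (mm : pinnedRows.A n → ℝ)
    (hle : ∀ a j, pinnedRows.ρ n a ⬝ᵥ qOff (e j) ≤ mm a) (hat : ∀ a, ∃ j, pinnedRows.ρ n a ⬝ᵥ qOff (e j) = mm a)
    (U : pinnedRows.A n → Option (Fin r) → ℝ) (V : Finset (Fin n) × Fin (K + 1) → Option (Fin r) → ℝ)
    (hU : ∀ a s, 0 ≤ U a s) (hV : ∀ p s, 0 ≤ V p s)
    (hfac : ∀ a b j, (pinnedRows.β n a + mm a) - pinnedRows.ρ n a ⬝ᵥ (udPt b + qOff (e j)) = ∑ s, U a s * V (b, j) s) :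
    3 ^ (n - 2) ≤ (r + 1) * 2 ^ (n - 2) := by
  refine pairPencil_block him e (fun a => mm (pencilRow him a)) (fun a j => hle (pencilRow him a) j)
    (fun a => hat (pencilRow him a)) (fun a => U (pencilRow him a)) V (fun a s => hU _ s) hV (fun a b j => ?_)
  have h := hfac (pencilRow him a) b j
  have hβ : pinnedRows.β n (pencilRow him a) = 1 + 2 * (n : ℝ) ^ 2 := by
    show 1 + ((n : ℝ) ^ 2) • pv i m ⬝ᵥ udPt {i, m} = 1 + 2 * (n : ℝ) ^ 2
    rw [smul_dotProduct, smul_eq_mul, pv_dotProduct_udPt_pair him]; ring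
  rw [hβ] at h
  exact h

/-- the same in the Law's literal quantifier shape: the `pinnedRows`-law RESTRICTED to the zero-diagonal cube holds at the
rate `1.5^{n−2}` — for every enumeration `q = qOff ∘ e` the law's three hypotheses force `3^{n−2} ≤ (r+1)·2^{n−2}`. -/
theorem pinnedRows_lawOn_qOff (n : ℕ) (hn : 2 ≤ n) {K r : ℕ} (e : Fin (K + 1) ≃ Finset (Fin n))
    (mm : pinnedRows.A n → ℝ)
    (hle : ∀ a j, pinnedRows.ρ n a ⬝ᵥ (qOff ∘ e) j ≤ mm a) (hat : ∀ a, ∃ j, pinnedRows.ρ n a ⬝ᵥ (qOff ∘ e) j = mm a)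
    (U : pinnedRows.A n → Option (Fin r) → ℝ) (V : Finset (Fin n) × Fin (K + 1) → Option (Fin r) → ℝ)
    (hU : ∀ a s, 0 ≤ U a s) (hV : ∀ p s, 0 ≤ V p s)
    (hfac : ∀ a b j, (pinnedRows.β n a + mm a) - pinnedRows.ρ n a ⬝ᵥ (udPt b + (qOff ∘ e) j) = ∑ s, U a s * V (b, j) s) :
    3 ^ (n - 2) ≤ (r + 1) * 2 ^ (n - 2) := by
  have h01 : (⟨0, by omega⟩ : Fin n) ≠ ⟨1, by omega⟩ := by simp
  exact pinnedRows_decide_qOff h01 e mm hle hat U V hU hV hfac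

/-! ### The pencil row inside C⁺ proper (`entryTilted`, box right-hand side = exact right-hand side here) -/

/-- the pair pencil as a MATRIX: `μ(E_im + E_mi)`. -/
def pairMat (i m : Fin n) (μ : ℝ) : Matrix (Fin n) (Fin n) ℝ := fun p q =>
  if (p = i ∧ q = m) ∨ (p = m ∧ q = i) then μ else 0

theorem pairMat_eq {i m : Fin n} (him : i ≠ m) (μ : ℝ) (a b : Fin n) :
    pairMat i m μ a b = μ * (udInd {i, m} a * udInd {i, m} b - udInd {i} a * udInd {i} b - udInd {m} a * udInd {m} b) := by
  simp only [pairMat, udInd_apply, Finset.mem_insert, Finset.mem_singleton]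
  by_cases hai : a = i
  · have ham : ¬ a = m := fun h => him (hai.symm.trans h)
    by_cases hbi : b = i
    · have hbm : ¬ b = m := fun h => him (hbi.symm.trans h)
      simp [hai, hbi, him]
    · by_cases hbm : b = m
      · simp [hai, hbm, him, him.symm]
      · simp [hai, hbi, hbm, him]
  · by_cases ham : a = m
    · by_cases hbi : b = i
      · simp [ham, hbi, him, him.symm]
      · by_cases hbm : b = m
        · simp [ham, hbm, him.symm]
        · simp [ham, hbi, hbm, him.symm]
    · simp [hai, ham]

/-- `flat (μ(E_im + E_mi)) = μ • pv`. -/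
theorem flat_pairMat {i m : Fin n} (him : i ≠ m) (μ : ℝ) : flat (pairMat i m μ) = μ • pv i m := by
  funext p
  simp only [flat, pv, udPt, vecOuter, Pi.smul_apply, Pi.sub_apply, smul_eq_mul]
  exact pairMat_eq him μ _ _

/-- the box right-hand side of the pencil is its EXACT right-hand side: `Σ max(μ(E_im+E_mi)_pq, 0) = 2μ` (`μ ≥ 0`). -/
theorem box_pairMat {i m : Fin n} (him : i ≠ m) {μ : ℝ} (hμ : 0 ≤ μ) :
    ∑ p, ∑ q, max (pairMat i m μ p q) 0 = 2 * μ := by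
  classical
  have h1 : ∀ p q, max (pairMat i m μ p q) 0 = pairMat i m μ p q * ((fun _ : Fin n => (1 : ℝ)) p * (fun _ => (1 : ℝ)) q) := by
    intro p q; simp only [mul_one]; unfold pairMat; split_ifs <;> simp [hμ]
  simp_rw [h1]
  rw [← flat_dotProduct_vecOuter, flat_pairMat him]
  have hu : vecOuter n (fun _ : Fin n => (1 : ℝ)) = udPt (Finset.univ : Finset (Fin n)) := by
    show vecOuter n (fun _ => (1 : ℝ)) = vecOuter n (udInd Finset.univ)
    congr 1; funext j; rw [udInd_apply, if_pos (Finset.mem_univ j)]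
  rw [hu, smul_dotProduct, smul_eq_mul, pv_dotProduct_udPt him, udInd_apply, udInd_apply, if_pos (Finset.mem_univ _),
    if_pos (Finset.mem_univ _)]
  ring

/-- ★★ **C⁺ (`entryTilted.Law` = `LocatedPencilLaw`) SEES `Q^∘`**: the rows `(a, n²(E_im + E_mi))` of `entryTilted` carry the
box right-hand side `1 + 2n²`, which is exact, and their block decides the zero-diagonal cube: `3^{n−2} ≤ (r+1)·2^{n−2}`. -/
theorem entryTilted_decide_qOff {i m : Fin n} (him : i ≠ m) {K r : ℕ} (e : Fin (K + 1) ≃ Finset (Fin n))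
    (mm : entryTilted.A n → ℝ)
    (hle : ∀ a j, entryTilted.ρ n a ⬝ᵥ qOff (e j) ≤ mm a) (hat : ∀ a, ∃ j, entryTilted.ρ n a ⬝ᵥ qOff (e j) = mm a)
    (U : entryTilted.A n → Option (Fin r) → ℝ) (V : Finset (Fin n) × Fin (K + 1) → Option (Fin r) → ℝ)
    (hU : ∀ a s, 0 ≤ U a s) (hV : ∀ p s, 0 ≤ V p s)
    (hfac : ∀ a b j, (entryTilted.β n a + mm a) - entryTilted.ρ n a ⬝ᵥ (udPt b + qOff (e j)) = ∑ s, U a s * V (b, j) s) :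
    3 ^ (n - 2) ≤ (r + 1) * 2 ^ (n - 2) := by
  let row : Finset (Fin n) → entryTilted.A n := fun a => (a, pairMat i m ((n : ℝ) ^ 2))
  have hρ : ∀ a, entryTilted.ρ n (row a) = udRow a + ((n : ℝ) ^ 2) • pv i m := fun a => by
    show udRow a + flat (pairMat i m ((n : ℝ) ^ 2)) = _
    rw [flat_pairMat him]
  have hβ : ∀ a, entryTilted.β n (row a) = 1 + 2 * (n : ℝ) ^ 2 := fun a => by
    show 1 + ∑ p, ∑ q, max (pairMat i m ((n : ℝ) ^ 2) p q) 0 = _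
    rw [box_pairMat him (by positivity)]
  refine pairPencil_block him e (fun a => mm (row a)) (fun a j => ?_) (fun a => ?_) (fun a => U (row a)) V
    (fun a s => hU _ s) hV (fun a b j => ?_)
  · rw [← hρ a]; exact hle (row a) j
  · obtain ⟨j, hj⟩ := hat (row a); exact ⟨j, by rw [← hρ a]; exact hj⟩
  · rw [← hρ a, ← hβ a]; exact hfac (row a) b j

/-! ### Rate: the block count gives the Law's literal conclusion `T c n < r`, eventually in `n` -/

theorem two_pow_half_mul_le (h : ℕ) : 2 ^ (h / 2) * 2 ^ h ≤ 3 ^ h := by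
  have hh : h = 2 * (h / 2) + h % 2 := (Nat.div_add_mod h 2).symm
  have hv : h % 2 < 2 := Nat.mod_lt _ (by norm_num)
  generalize h / 2 = u at hh ⊢
  generalize h % 2 = v at hh hv ⊢
  subst hh
  calc 2 ^ u * 2 ^ (2 * u + v) = 2 ^ (3 * u) * 2 ^ v := by ring
    _ = (2 ^ 3) ^ u * 2 ^ v := by rw [pow_mul]
    _ ≤ (3 ^ 2) ^ u * 3 ^ v :=
        Nat.mul_le_mul (Nat.pow_le_pow_left (by norm_num) u) (Nat.pow_le_pow_left (by norm_num) v)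
    _ = 3 ^ (2 * u) * 3 ^ v := by rw [← pow_mul]
    _ = 3 ^ (2 * u + v) := by ring

/-- ★ RATE: `3^{n−2} ≤ (r+1)·2^{n−2} ⟹ T c n < r` for `n ≥ n₀(c)` (via the tree's `four_T_lt_two_pow`). -/
theorem T_lt_of_block (c : ℕ) : ∃ n₀ : ℕ, ∀ n ≥ n₀, ∀ r : ℕ, 3 ^ (n - 2) ≤ (r + 1) * 2 ^ (n - 2) → T c n < r := by
  obtain ⟨t₁, ht₁⟩ := four_T_lt_two_pow c (c₀ := 1 / 4) (by norm_num)
  refine ⟨max t₁ 8, fun n hn r hr => ?_⟩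
  have hn8 : 8 ≤ n := le_of_max_le_right hn
  have hdiv : n ≤ 4 * ((n - 2) / 2) := by omega
  have hreal : (1 / 4 : ℝ) * n ≤ (((n - 2) / 2 : ℕ) : ℝ) := by
    have : (n : ℝ) ≤ 4 * (((n - 2) / 2 : ℕ) : ℝ) := by exact_mod_cast hdiv
    linarith
  have h4 := ht₁ n (le_of_max_le_left hn) ((n - 2) / 2) hreal
  have hpow : 2 ^ ((n - 2) / 2) * 2 ^ (n - 2) ≤ (r + 1) * 2 ^ (n - 2) :=
    (two_pow_half_mul_le (n - 2)).trans hr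
  have hle : 2 ^ ((n - 2) / 2) ≤ r + 1 := Nat.le_of_mul_le_mul_right hpow (Nat.pos_of_ne_zero (by positivity))
  have hT : 1 ≤ T c n := Nat.one_le_two_pow
  unfold T at hT ⊢
  omega

/-- ★★★ **THE `pinnedRows`-LAW HOLDS ON THE ZERO-DIAGONAL CUBE** — `pinnedRows.Law` with its passenger quantifier specialised to
(every enumeration of) `Q^∘`, literal conclusion `T c n < r`: the first non-trivial located case, in the Law's own currency.
(The passenger that refutes C⁺_diag is decided by C⁺_loc; the `HasEFOfSize` budget hypothesis is not even used.) -/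
theorem pinnedRows_law_holds_on_qOff : ∀ c : ℕ, ∃ n₀ : ℕ, ∀ n ≥ n₀,
    ∀ (K : ℕ) (e : Fin (K + 1) ≃ Finset (Fin n)) (r : ℕ),
    HasEFOfSize (convexHull ℝ (Set.range (qOff ∘ e))) r →
    ∀ mm : pinnedRows.A n → ℝ, (∀ a j, pinnedRows.ρ n a ⬝ᵥ (qOff ∘ e) j ≤ mm a) →
      (∀ a, ∃ j, pinnedRows.ρ n a ⬝ᵥ (qOff ∘ e) j = mm a) →
    ∀ (U : pinnedRows.A n → Option (Fin r) → ℝ) (V : Finset (Fin n) × Fin (K + 1) → Option (Fin r) → ℝ),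
      (∀ a i, 0 ≤ U a i) → (∀ p i, 0 ≤ V p i) →
      (∀ a b j, (pinnedRows.β n a + mm a) - pinnedRows.ρ n a ⬝ᵥ (udPt b + (qOff ∘ e) j) = ∑ i, U a i * V (b, j) i) →
      T c n < r := by
  intro c
  obtain ⟨n₀, hn₀⟩ := T_lt_of_block c
  refine ⟨max n₀ 2, fun n hn K e r _ mm hle hat U V hU hV hfac => hn₀ n (le_of_max_le_left hn) r ?_⟩
  exact pinnedRows_lawOn_qOff n (le_of_max_le_right hn) e mm hle hat U V hU hV hfac

/-- ★★★ the same for C⁺ proper: **`entryTilted.Law` (= `LocatedPencilLaw`) HOLDS ON THE ZERO-DIAGONAL CUBE.** -/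
theorem entryTilted_law_holds_on_qOff : ∀ c : ℕ, ∃ n₀ : ℕ, ∀ n ≥ n₀,
    ∀ (K : ℕ) (e : Fin (K + 1) ≃ Finset (Fin n)) (r : ℕ),
    HasEFOfSize (convexHull ℝ (Set.range (qOff ∘ e))) r →
    ∀ mm : entryTilted.A n → ℝ, (∀ a j, entryTilted.ρ n a ⬝ᵥ (qOff ∘ e) j ≤ mm a) →
      (∀ a, ∃ j, entryTilted.ρ n a ⬝ᵥ (qOff ∘ e) j = mm a) →
    ∀ (U : entryTilted.A n → Option (Fin r) → ℝ) (V : Finset (Fin n) × Fin (K + 1) → Option (Fin r) → ℝ),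
      (∀ a i, 0 ≤ U a i) → (∀ p i, 0 ≤ V p i) →
      (∀ a b j, (entryTilted.β n a + mm a) - entryTilted.ρ n a ⬝ᵥ (udPt b + (qOff ∘ e) j) = ∑ i, U a i * V (b, j) i) →
      T c n < r := by
  intro c
  obtain ⟨n₀, hn₀⟩ := T_lt_of_block c
  refine ⟨max n₀ 2, fun n hn K e r _ mm hle hat U V hU hV hfac => hn₀ n (le_of_max_le_left hn) r ?_⟩
  have hn2 : 2 ≤ n := le_of_max_le_right hn
  have h01 : (⟨0, by omega⟩ : Fin n) ≠ ⟨1, by omega⟩ := by simp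
  exact entryTilted_decide_qOff h01 e mm hle hat U V hU hV hfac

end Decide

/-! ## §4b ★ The CLASS behind §4: pin-exposed passengers are decided by C⁺_loc, in Law currency

`Q^∘` is one member of a typed class.  A passenger `q` is PIN-EXPOSED when some direction `w`, maximised over `COR(n)` on the
whole coordinate face `F_S = {x_b : b ⊇ S}` (`2|S| ≤ n`), makes ONE passenger index `j⋆` the maximiser of EVERY tilted row
`udRow a + w`, `a ⊆ Sᶜ` (a ROW-UNIFORM located maximiser).  Then the rows `(a, (w, S))` of `pinnedRows` and the columns
`(S ∪ b', j⋆)` carry the block `(1 − |a ∩ b'|)²` under the Law's hypotheses, and the Law's conclusion follows at rate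
`1.5^{n−|S|}`.  (xc-currency shadow: `w` exposes the face `F_S + {q_{j⋆}}`-like fibre; the Law-currency statement is the one
`pinnedRows.Law` quantifies.)  `Q^∘ ∈ PinExposed` with `S = {i,m}`, `w = n²(E_im+E_mi)`, `j⋆ ↦ [n]∖{i,m}` (`pinExposed_qOff`). -/

section PinClass
variable {n : ℕ}

/-- CLASS `PinExposed` (Law currency, coordinate faces, row-uniform located maximiser). -/
def PinExposed (n K : ℕ) (q : Fin (K + 1) → (Fin (n * n) → ℝ)) : Prop :=
  ∃ (S : Finset (Fin n)) (w : Fin (n * n) → ℝ) (jstar : Fin (K + 1)),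
    2 * S.card ≤ n ∧ (∀ x ∈ corPolytope n, w ⬝ᵥ x ≤ w ⬝ᵥ udPt S) ∧
    (∀ b : Finset (Fin n), S ⊆ b → w ⬝ᵥ udPt b = w ⬝ᵥ udPt S) ∧
    (∀ a : Finset (Fin n), a ⊆ Sᶜ → ∀ j, (udRow a + w) ⬝ᵥ q j ≤ (udRow a + w) ⬝ᵥ q jstar)

/-- ★★ **THE PIN BLOCK** (general form of `pairPencil_block`): under the three hypotheses of `pinnedRows.Law` for an arbitrary
passenger `q`, pin data `(S, w, j⋆)` yield `3^{n−|S|} ≤ (r+1)·2^{n−|S|}`. -/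
theorem pin_block {K r : ℕ} (q : Fin (K + 1) → (Fin (n * n) → ℝ)) (S : Finset (Fin n)) (w : Fin (n * n) → ℝ)
    (jstar : Fin (K + 1)) (hvalid : ∀ x ∈ corPolytope n, w ⬝ᵥ x ≤ w ⬝ᵥ udPt S)
    (htight : ∀ b : Finset (Fin n), S ⊆ b → w ⬝ᵥ udPt b = w ⬝ᵥ udPt S)
    (hmax : ∀ a : Finset (Fin n), a ⊆ Sᶜ → ∀ j, (udRow a + w) ⬝ᵥ q j ≤ (udRow a + w) ⬝ᵥ q jstar)
    (mm : pinnedRows.A n → ℝ)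
    (hle : ∀ a j, pinnedRows.ρ n a ⬝ᵥ q j ≤ mm a) (hat : ∀ a, ∃ j, pinnedRows.ρ n a ⬝ᵥ q j = mm a)
    (U : pinnedRows.A n → Option (Fin r) → ℝ) (V : Finset (Fin n) × Fin (K + 1) → Option (Fin r) → ℝ)
    (hU : ∀ a s, 0 ≤ U a s) (hV : ∀ p s, 0 ≤ V p s)
    (hfac : ∀ a b j, (pinnedRows.β n a + mm a) - pinnedRows.ρ n a ⬝ᵥ (udPt b + q j) = ∑ s, U a s * V (b, j) s) :
    3 ^ (n - S.card) ≤ (r + 1) * 2 ^ (n - S.card) := by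
  classical
  let G : Finset (Fin n) := Sᶜ
  let α := {x : Fin n // x ∈ G}
  have hcardα : Fintype.card α = n - S.card := by
    rw [Fintype.card_coe, Finset.card_compl, Fintype.card_fin]
  let emb : α ↪ Fin n := Function.Embedding.subtype _
  let prow : Finset α → pinnedRows.A n := fun a' => (a'.map emb, ⟨(w, S), hvalid⟩)
  let col : Finset α → Finset (Fin n) × Fin (K + 1) := fun b' => (S ∪ b'.map emb, jstar)
  have hrowG : ∀ a' : Finset α, a'.map emb ⊆ G := fun a' x hx => by
    obtain ⟨y, -, rfl⟩ := Finset.mem_map.1 hx; exact y.2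
  obtain ⟨-, -, slack, -⟩ := ud_data n
  have key := three_pow_le_of_block (ι := Option (Fin r)) U V hU hV prow col ?_
  · rw [hcardα, Fintype.card_option, Fintype.card_fin] at key; exact key
  intro a' b'
  rw [← hfac (prow a') (S ∪ b'.map emb) jstar]
  -- `m` equals the value at `j⋆` on the rows inside `G`
  have hm : mm (prow a') = (udRow (a'.map emb) + w) ⬝ᵥ q jstar := by
    obtain ⟨j₀, hj₀⟩ := hat (prow a')
    have h1 : (udRow (a'.map emb) + w) ⬝ᵥ q j₀ = mm (prow a') := hj₀
    have h2 : (udRow (a'.map emb) + w) ⬝ᵥ q jstar ≤ mm (prow a') := hle (prow a') jstar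
    have h3 := hmax (a'.map emb) (hrowG a') j₀
    rw [h1] at h3
    exact le_antisymm h3 h2
  have hud : udRow (a'.map emb) ⬝ᵥ udPt (S ∪ b'.map emb) = 1 - (1 - (((a' ∩ b').card : ℕ) : ℝ)) ^ 2 := by
    have := slack (a'.map emb) (S ∪ b'.map emb)
    have hint : a'.map emb ∩ (S ∪ b'.map emb) = (a' ∩ b').map emb := by
      rw [Finset.inter_union_distrib_left, Finset.map_inter]
      have h0 : a'.map emb ∩ S = ∅ := by
        refine Finset.subset_empty.1 fun x hx => ?_
        have hxG := hrowG a' (Finset.mem_inter.1 hx).1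
        exact absurd (Finset.mem_inter.1 hx).2 (Finset.mem_compl.1 hxG)
      rw [h0, Finset.empty_union]
    rw [hint, Finset.card_map] at this
    linarith
  have hwb : w ⬝ᵥ udPt (S ∪ b'.map emb) = w ⬝ᵥ udPt S := htight _ Finset.subset_union_left
  show ((1 + w ⬝ᵥ udPt S) + mm (prow a')) - (udRow (a'.map emb) + w) ⬝ᵥ (udPt (S ∪ b'.map emb) + q jstar)
    = (1 - ((a' ∩ b').card : ℝ)) ^ 2
  rw [hm, dotProduct_add (udRow (a'.map emb) + w) (udPt (S ∪ b'.map emb)) (q jstar),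
    add_dotProduct (udRow (a'.map emb)) w (udPt (S ∪ b'.map emb)), hud, hwb]
  ring

/-- rate, general located codimension: `n ≤ 2g ∧ 3^g ≤ (r+1)·2^g ⟹ T c n < r`, eventually in `n`. -/
theorem T_lt_of_block' (c : ℕ) : ∃ n₀ : ℕ, ∀ n ≥ n₀, ∀ g r : ℕ, n ≤ 2 * g → 3 ^ g ≤ (r + 1) * 2 ^ g → T c n < r := by
  obtain ⟨t₁, ht₁⟩ := four_T_lt_two_pow c (c₀ := 1 / 5) (by norm_num)
  refine ⟨max t₁ 10, fun n hn g r hng hr => ?_⟩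
  have hn10 : 10 ≤ n := le_of_max_le_right hn
  have hdiv : n ≤ 5 * (g / 2) := by omega
  have hreal : (1 / 5 : ℝ) * n ≤ ((g / 2 : ℕ) : ℝ) := by
    have : (n : ℝ) ≤ 5 * ((g / 2 : ℕ) : ℝ) := by exact_mod_cast hdiv
    linarith
  have h4 := ht₁ n (le_of_max_le_left hn) (g / 2) hreal
  have hpow : 2 ^ (g / 2) * 2 ^ g ≤ (r + 1) * 2 ^ g := (two_pow_half_mul_le g).trans hr
  have hle : 2 ^ (g / 2) ≤ r + 1 := Nat.le_of_mul_le_mul_right hpow (Nat.pos_of_ne_zero (by positivity))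
  have hT : 1 ≤ T c n := Nat.one_le_two_pow
  unfold T at hT ⊢
  omega

/-- ★★★ **C⁺_loc HOLDS ON THE CLASS `PinExposed`** — `pinnedRows.Law` with its passenger quantifier restricted to pin-exposed
passengers, literal conclusion `T c n < r` (the `HasEFOfSize` budget is not used). -/
theorem pinnedRows_law_on_pinExposed : ∀ c : ℕ, ∃ n₀ : ℕ, ∀ n ≥ n₀,
    ∀ (K : ℕ) (q : Fin (K + 1) → (Fin (n * n) → ℝ)) (r : ℕ), PinExposed n K q →
    HasEFOfSize (convexHull ℝ (Set.range q)) r →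
    ∀ mm : pinnedRows.A n → ℝ, (∀ a j, pinnedRows.ρ n a ⬝ᵥ q j ≤ mm a) →
      (∀ a, ∃ j, pinnedRows.ρ n a ⬝ᵥ q j = mm a) →
    ∀ (U : pinnedRows.A n → Option (Fin r) → ℝ) (V : Finset (Fin n) × Fin (K + 1) → Option (Fin r) → ℝ),
      (∀ a i, 0 ≤ U a i) → (∀ p i, 0 ≤ V p i) →
      (∀ a b j, (pinnedRows.β n a + mm a) - pinnedRows.ρ n a ⬝ᵥ (udPt b + q j) = ∑ i, U a i * V (b, j) i) →
      T c n < r := by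
  intro c
  obtain ⟨n₀, hn₀⟩ := T_lt_of_block' c
  refine ⟨n₀, fun n hn K q r hpin _ mm hle hat U V hU hV hfac => ?_⟩
  obtain ⟨S, w, jstar, hS, hvalid, htight, hmax⟩ := hpin
  exact hn₀ n hn (n - S.card) r (by omega) (pin_block q S w jstar hvalid htight hmax mm hle hat U V hU hV hfac)

/-- ★ `Q^∘ ∈ PinExposed` (`n ≥ 4`): `S = {i,m}`, `w = n²•pv i m`, `j⋆ = e⁻¹([n]∖{i,m})` — the data of §4. -/
theorem pinExposed_qOff (hn : 4 ≤ n) {i m : Fin n} (him : i ≠ m) {K : ℕ} (e : Fin (K + 1) ≃ Finset (Fin n)) :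
    PinExposed n K (qOff ∘ e) := by
  classical
  refine ⟨{i, m}, ((n : ℝ) ^ 2) • pv i m, e.symm ({i, m} : Finset (Fin n))ᶜ, ?_, ?_, ?_, ?_⟩
  · rw [Finset.card_pair him]; omega
  · intro x hx
    rw [smul_dotProduct, smul_dotProduct, smul_eq_mul, smul_eq_mul, pv_dotProduct_udPt_pair him]
    exact mul_le_mul_of_nonneg_left (pv_le_two him x hx) (by positivity)
  · intro b hb
    have hi : i ∈ b := hb (by simp)
    have hm : m ∈ b := hb (by simp)
    rw [smul_dotProduct, smul_dotProduct, smul_eq_mul, smul_eq_mul, pv_dotProduct_udPt_pair him, pv_dotProduct_udPt him,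
      udInd_apply, udInd_apply, if_pos hi, if_pos hm]
    ring
  · intro a ha j
    have h := val_le_val_star him ha (e j)
    have hG : e (e.symm ({i, m} : Finset (Fin n))ᶜ) = ({i, m} : Finset (Fin n))ᶜ := e.apply_symm_apply _
    show val i m a (e j) ≤ (udRow a + ((n : ℝ) ^ 2) • pv i m) ⬝ᵥ qOff (e (e.symm ({i, m} : Finset (Fin n))ᶜ))
    rw [hG]
    exact h

end PinClass

/-! ## §4c ★ P-W6a — the CLASS «column-coupled affine cubes» is decided by C⁺_entry (N20's single-column negative tilt)

crit-9 g2 N20 (paper): for an AFFINE-CUBE passenger the cheapest located attack is a NEGATIVE tilt supported in ONE column `x₀`,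
`W = −Σ_l M_l E_{l x₀}` — box right-hand side `1` (= exact), COR-cost `Σ_l M_l b_l b_{x₀}` vanishing on the window `b ∌ x₀`.
Typed here: the passenger `q_P = flat (Q₀ + Σ_{g∈P} G g)` (`P ⊆ [N]`, generators `G g`), the class `ColumnCoupled G` (a
nonnegative weight `M0` on column `x₀` pairs with every generator's column-`x₀` profile at absolute value `≥ 1` — by rescaling
and genericity of `M0` in the positive orthant this is «every generator has a nonzero entry in column `x₀`»;
`columnCoupled_of_entry` is the one-entry sufficient condition), and the theorem: under the three hypotheses of `entryTilted.Law`
the rows `(a, −t(a)·Σ_l M0_l E_{l x₀})`, `a ⊆ [n]∖{x₀}`, `t(a) = 1 + Σ_g |⟨udRow a, G g⟩|`, have the COMMON maximiser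
`P⋆ = {g : ⟨M0, col_{x₀} G g⟩ < 0}` (`columnTilt_block`), so the block `(a, (b, P⋆))_{a,b ∌ x₀}` is UDISJ_{n−1}:
`3^{n−1} ≤ (r+1)·2^{n−1}`, ★★★ `entryTilted_law_on_columnCoupled` (Law currency, literal `T c n < r`) and, through the pointwise
Yannakakis step `concl_of_lawBody`, the xc-currency decision ★ `columnCoupled_decided` (the shape a `CoreLaw` binder consumes, flat
socket).  `Q^∘` is a member (`qOff_eq_cubePt`, `columnCoupled_qOff`). -/

section ColumnClass
variable {n N : ℕ}

theorem flat_add' (A B : Matrix (Fin n) (Fin n) ℝ) : flat (A + B) = flat A + flat B := by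
  funext p; simp [flat, Matrix.add_apply]

theorem flat_sum' {ι : Type} (S : Finset ι) (A : ι → Matrix (Fin n) (Fin n) ℝ) :
    flat (∑ i ∈ S, A i) = ∑ i ∈ S, flat (A i) := by
  classical
  induction S using Finset.induction_on with
  | empty => funext p; simp [flat]
  | insert a S ha ih => rw [Finset.sum_insert ha, Finset.sum_insert ha, flat_add', ih]

theorem dotProduct_finsum' {m : ℕ} {ι : Type} (v : Fin m → ℝ) (S : Finset ι) (w : ι → Fin m → ℝ) :
    v ⬝ᵥ (∑ i ∈ S, w i) = ∑ i ∈ S, v ⬝ᵥ w i := by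
  classical
  induction S using Finset.induction_on with
  | empty => simp
  | insert a S ha ih => rw [Finset.sum_insert ha, Finset.sum_insert ha, dotProduct_add, ih]

/-- AFFINE-CUBE passenger: vertices `q_P = flat (Q₀ + Σ_{g∈P} G g)`, `P ⊆ [N]` (budget `xc ≤ 2N`). -/
def cubePt (Q₀ : Matrix (Fin n) (Fin n) ℝ) (G : Fin N → Matrix (Fin n) (Fin n) ℝ) (P : Finset (Fin N)) :
    Fin (n * n) → ℝ :=
  flat (Q₀ + ∑ g ∈ P, G g)

theorem dotProduct_cubePt (ρ : Fin (n * n) → ℝ) (Q₀ : Matrix (Fin n) (Fin n) ℝ) (G : Fin N → Matrix (Fin n) (Fin n) ℝ)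
    (P : Finset (Fin N)) : ρ ⬝ᵥ cubePt Q₀ G P = ρ ⬝ᵥ flat Q₀ + ∑ g ∈ P, ρ ⬝ᵥ flat (G g) := by
  rw [cubePt, flat_add', flat_sum', dotProduct_add, dotProduct_finsum']

/-- CLASS «COLUMN-COUPLED» (N20, typed): some column `x₀` and a nonnegative weight `M0` on its entries pair with EVERY
generator's column-`x₀` profile at absolute value `≥ 1`. -/
def ColumnCoupled (G : Fin N → Matrix (Fin n) (Fin n) ℝ) : Prop :=
  ∃ (x₀ : Fin n) (M0 : Fin n → ℝ), (∀ l, 0 ≤ M0 l) ∧ ∀ g, 1 ≤ |∑ l, M0 l * G g l x₀|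

/-- one-entry sufficient condition: an entry `(l₀, x₀)` moved by every generator (by at least `1` in absolute value). -/
theorem columnCoupled_of_entry {G : Fin N → Matrix (Fin n) (Fin n) ℝ} (x₀ l₀ : Fin n) (h : ∀ g, 1 ≤ |G g l₀ x₀|) :
    ColumnCoupled G := by
  classical
  refine ⟨x₀, fun l => if l = l₀ then 1 else 0, fun l => ?_, fun g => ?_⟩
  · show (0 : ℝ) ≤ (if l = l₀ then (1 : ℝ) else 0)
    split_ifs <;> norm_num
  simp only [ite_mul, one_mul, zero_mul, Finset.sum_ite_eq', Finset.mem_univ, if_true]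
  exact h g

/-- the single-column negative tilt `W = −Σ_l M_l E_{l x₀}`. -/
def colTilt (x₀ : Fin n) (M : Fin n → ℝ) : Matrix (Fin n) (Fin n) ℝ := fun p q => if q = x₀ then -M p else 0

/-- its COR-cost vanishes on the window `b ∌ x₀`. -/
theorem colTilt_dotProduct_udPt (x₀ : Fin n) (M : Fin n → ℝ) {b : Finset (Fin n)} (hb : x₀ ∉ b) :
    flat (colTilt x₀ M) ⬝ᵥ udPt b = 0 := by
  have hx : udInd b x₀ = 0 := by rw [udInd_apply, if_neg hb]
  rw [show udPt b = vecOuter n (udInd b) from rfl, flat_dotProduct_vecOuter]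
  refine Finset.sum_eq_zero fun i _ => Finset.sum_eq_zero fun j _ => ?_
  by_cases hj : j = x₀
  · subst hj; rw [hx]; ring
  · simp [colTilt, hj]

/-- its pairing with a generator: `−Σ_l M_l G_{l x₀}`. -/
theorem colTilt_dotProduct_flat (x₀ : Fin n) (M : Fin n → ℝ) (A : Matrix (Fin n) (Fin n) ℝ) :
    flat (colTilt x₀ M) ⬝ᵥ flat A = -∑ l, M l * A l x₀ := by
  rw [flat_dotProduct_flat]
  have h : ∀ i, ∑ j, colTilt x₀ M i j * A i j = -(M i * A i x₀) := fun i => by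
    rw [Finset.sum_eq_single x₀ (fun j _ hj => by simp [colTilt, hj]) (fun h => absurd (Finset.mem_univ _) h)]
    simp [colTilt]
  simp_rw [h, Finset.sum_neg_distrib]

/-- its box right-hand side is `0` (`M ≥ 0`): the box rhs of a negative tilt is EXACT. -/
theorem box_colTilt (x₀ : Fin n) (M : Fin n → ℝ) (hM : ∀ l, 0 ≤ M l) : ∑ p, ∑ q, max (colTilt x₀ M p q) 0 = 0 := by
  refine Finset.sum_eq_zero fun p _ => Finset.sum_eq_zero fun q _ => ?_
  unfold colTilt
  split_ifs
  · exact max_eq_right (neg_nonpos.mpr (hM p))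
  · exact max_self 0

/-- the row-dependent TILT STRENGTH `t(a) = 1 + Σ_g |⟨udRow a, G_g⟩|` of the column-tilt certificate (it dominates the
clique part's own profile on the cube, so that the column term decides the sign of every generator for every row). -/
def colStrength (G : Fin N → Matrix (Fin n) (Fin n) ℝ) (a : Finset (Fin n)) : ℝ := 1 + ∑ g, |udRow a ⬝ᵥ flat (G g)|

theorem colStrength_pos (G : Fin N → Matrix (Fin n) (Fin n) ℝ) (a : Finset (Fin n)) : 0 < colStrength G a := by
  unfold colStrength; positivity

/-- ★★ **THE COLUMN-TILT BLOCK, FAMILY-AGNOSTIC FORM** (N20 in kernel): for ANY row family `F` containing, for every clique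
row `a`, a row `row a` with functional `udRow a − t(a)·Σ_l M0_l E_{l x₀}` and right-hand side `1` (box rhs AND exact rhs of
the nonpositive column tilt are both `0`), the three hypotheses of `F.Law` at a column-coupled affine cube force
`3^{n−1} ≤ (r+1)·2^{n−1}` — the window `b ∌ x₀` has zero tilt cost, `P⋆ = {g : s_g < 0}` maximises every row, and the block
`(a ⊆ [n]∖{x₀}) × ((b, P⋆) : b ⊆ [n]∖{x₀})` of the augmented slack is `(1 − |a∩b|)²`. -/
theorem columnTilt_block_family (F : RowFamily) {K r : ℕ} (Q₀ : Matrix (Fin n) (Fin n) ℝ)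
    (G : Fin N → Matrix (Fin n) (Fin n) ℝ)
    (x₀ : Fin n) (M0 : Fin n → ℝ) (hs : ∀ g, 1 ≤ |∑ l, M0 l * G g l x₀|)
    (e : Fin (K + 1) → Finset (Fin N)) (he : Function.Surjective e)
    (row : Finset (Fin n) → F.A n)
    (hρ : ∀ a, F.ρ n (row a) = udRow a + flat (colTilt x₀ fun l => colStrength G a * M0 l))
    (hβ : ∀ a, F.β n (row a) = 1)
    (mm : F.A n → ℝ)
    (hle : ∀ a j, F.ρ n a ⬝ᵥ (cubePt Q₀ G ∘ e) j ≤ mm a)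
    (hat : ∀ a, ∃ j, F.ρ n a ⬝ᵥ (cubePt Q₀ G ∘ e) j = mm a)
    (U : F.A n → Option (Fin r) → ℝ) (V : Finset (Fin n) × Fin (K + 1) → Option (Fin r) → ℝ)
    (hU : ∀ a i, 0 ≤ U a i) (hV : ∀ p i, 0 ≤ V p i)
    (hfac : ∀ a b j, (F.β n a + mm a) - F.ρ n a ⬝ᵥ (udPt b + (cubePt Q₀ G ∘ e) j)
      = ∑ i, U a i * V (b, j) i) :
    3 ^ (n - 1) ≤ (r + 1) * 2 ^ (n - 1) := by
  classical
  -- data: signed profiles, the common column, the row-dependent tilt strength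
  let s : Fin N → ℝ := fun g => ∑ l, M0 l * G g l x₀
  let Pstar : Finset (Fin N) := Finset.univ.filter fun g => s g < 0
  obtain ⟨jstar, hGe⟩ := he Pstar
  let cc : Finset (Fin n) → Fin N → ℝ := fun a g => udRow a ⬝ᵥ flat (G g)
  let t : Finset (Fin n) → ℝ := fun a => colStrength G a
  let W : Finset (Fin n) → Matrix (Fin n) (Fin n) ℝ := fun a => colTilt x₀ fun l => t a * M0 l
  have hρW : ∀ a, F.ρ n (row a) = udRow a + flat (W a) := hρ
  let G₀ : Finset (Fin n) := ({x₀} : Finset (Fin n))ᶜ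
  let α := {x : Fin n // x ∈ G₀}
  have hcardα : Fintype.card α = n - 1 := by
    rw [Fintype.card_coe, Finset.card_compl, Finset.card_singleton, Fintype.card_fin]
  let emb : α ↪ Fin n := Function.Embedding.subtype _
  let col : Finset α → Finset (Fin n) × Fin (K + 1) := fun b' => (b'.map emb, jstar)
  have hx₀ : ∀ b' : Finset α, x₀ ∉ b'.map emb := fun b' hx => by
    obtain ⟨y, -, hy⟩ := Finset.mem_map.1 hx
    have hy' : (y : Fin n) = x₀ := hy
    have := y.2
    rw [Finset.mem_compl, Finset.mem_singleton] at this
    exact this hy'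
  have ht0 : ∀ a, 0 ≤ t a := fun a => (colStrength_pos G a).le
  have htdef : ∀ a, t a = 1 + ∑ g', |cc a g'| := fun a => rfl
  -- the value of row `a` at the cube vertex `P`
  have hWg : ∀ a g, flat (W a) ⬝ᵥ flat (G g) = -(t a * s g) := fun a g => by
    show flat (colTilt x₀ fun l => t a * M0 l) ⬝ᵥ flat (G g) = _
    rw [colTilt_dotProduct_flat]
    simp only [s, Finset.mul_sum, mul_assoc]
  have hv : ∀ a P, (udRow a + flat (W a)) ⬝ᵥ cubePt Q₀ G P
      = (udRow a + flat (W a)) ⬝ᵥ flat Q₀ + ∑ g ∈ P, (cc a g - t a * s g) := fun a P => by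
    rw [dotProduct_cubePt]
    congr 1
    refine Finset.sum_congr rfl fun g _ => ?_
    rw [add_dotProduct, hWg]
    ring
  -- signs: `P⋆` collects exactly the generators with positive coefficient, for EVERY row
  have hpos : ∀ a, ∀ g ∈ Pstar, 0 ≤ cc a g - t a * s g := fun a g hg => by
    have hsg : s g < 0 := (Finset.mem_filter.1 hg).2
    have h1 : 1 ≤ |s g| := hs g
    have hs1 : s g ≤ -1 := by rw [abs_of_neg hsg] at h1; linarith
    have hc : |cc a g| ≤ ∑ g', |cc a g'| :=
      Finset.single_le_sum (f := fun g' => |cc a g'|) (fun g' _ => abs_nonneg (cc a g')) (Finset.mem_univ g)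
    have hc' : -cc a g ≤ |cc a g| := neg_le_abs (cc a g)
    have hts : t a * s g ≤ -(t a) := by
      have := mul_le_mul_of_nonneg_left hs1 (ht0 a); linarith
    have := htdef a
    linarith
  have hneg : ∀ a, ∀ g ∉ Pstar, cc a g - t a * s g ≤ 0 := fun a g hg => by
    have hsg : 0 ≤ s g := not_lt.1 fun h => hg (Finset.mem_filter.2 ⟨Finset.mem_univ _, h⟩)
    have h1 : 1 ≤ |s g| := hs g
    have hs1 : 1 ≤ s g := by rwa [abs_of_nonneg hsg] at h1
    have hc : |cc a g| ≤ ∑ g', |cc a g'| :=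
      Finset.single_le_sum (f := fun g' => |cc a g'|) (fun g' _ => abs_nonneg (cc a g')) (Finset.mem_univ g)
    have hc' : cc a g ≤ |cc a g| := le_abs_self _
    have hts : t a ≤ t a * s g := by
      have := mul_le_mul_of_nonneg_left hs1 (ht0 a); linarith
    have := htdef a
    linarith
  -- hence `P⋆` maximises every row
  have hmaxP : ∀ a P, (udRow a + flat (W a)) ⬝ᵥ cubePt Q₀ G P ≤ (udRow a + flat (W a)) ⬝ᵥ cubePt Q₀ G Pstar := by
    intro a P
    rw [hv a P, hv a Pstar]
    refine add_le_add (le_refl _) ?_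
    calc ∑ g ∈ P, (cc a g - t a * s g)
        = ∑ g ∈ P.filter (· ∈ Pstar), (cc a g - t a * s g) + ∑ g ∈ P.filter (· ∉ Pstar), (cc a g - t a * s g) :=
          (Finset.sum_filter_add_sum_filter_not P (· ∈ Pstar) _).symm
      _ ≤ ∑ g ∈ P.filter (· ∈ Pstar), (cc a g - t a * s g) := by
          have : ∑ g ∈ P.filter (· ∉ Pstar), (cc a g - t a * s g) ≤ 0 :=
            Finset.sum_nonpos fun g hg => hneg a g (Finset.mem_filter.1 hg).2
          linarith
      _ ≤ ∑ g ∈ Pstar, (cc a g - t a * s g) :=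
          Finset.sum_le_sum_of_subset_of_nonneg (fun g hg => (Finset.mem_filter.1 hg).2) fun g hg _ => hpos a g hg
  -- the block
  obtain ⟨-, -, slack, -⟩ := ud_data n
  have key := three_pow_le_of_block (ι := Option (Fin r)) U V hU hV (fun a' => row (a'.map emb)) col ?_
  · rw [hcardα, Fintype.card_option, Fintype.card_fin] at key; exact key
  intro a' b'
  show ∑ i, U (row (a'.map emb)) i * V (b'.map emb, jstar) i = _
  rw [← hfac (row (a'.map emb)) (b'.map emb) jstar]
  have hm : mm (row (a'.map emb)) = (udRow (a'.map emb) + flat (W (a'.map emb))) ⬝ᵥ cubePt Q₀ G Pstar := by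
    obtain ⟨j₀, hj₀⟩ := hat (row (a'.map emb))
    have h1 : (udRow (a'.map emb) + flat (W (a'.map emb))) ⬝ᵥ cubePt Q₀ G (e j₀) = mm (row (a'.map emb)) := by
      rw [← hρW]; exact hj₀
    have h2 : (udRow (a'.map emb) + flat (W (a'.map emb))) ⬝ᵥ cubePt Q₀ G (e jstar) ≤ mm (row (a'.map emb)) := by
      rw [← hρW]; exact hle (row (a'.map emb)) jstar
    rw [hGe] at h2
    have h3 := hmaxP (a'.map emb) (e j₀)
    rw [h1] at h3
    exact le_antisymm h3 h2
  have hud : udRow (a'.map emb) ⬝ᵥ udPt (b'.map emb) = 1 - (1 - (((a' ∩ b').card : ℕ) : ℝ)) ^ 2 := by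
    have := slack (a'.map emb) (b'.map emb)
    rw [← Finset.map_inter, Finset.card_map] at this
    linarith
  have hWb : flat (W (a'.map emb)) ⬝ᵥ udPt (b'.map emb) = 0 := colTilt_dotProduct_udPt x₀ _ (hx₀ b')
  rw [hβ, hρW, hm, Function.comp_apply, hGe,
    dotProduct_add (udRow (a'.map emb) + flat (W (a'.map emb))) (udPt (b'.map emb)) (cubePt Q₀ G Pstar),
    add_dotProduct (udRow (a'.map emb)) (flat (W (a'.map emb))) (udPt (b'.map emb)), hud, hWb]
  ring

/-- ★★ **THE COLUMN-TILT BLOCK** (N20 in kernel, Law currency) for `entryTilted` (= C⁺_entry, box right-hand side): the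
rows `(a, −t(a)·Σ_l M0_l E_{l x₀})` have box rhs `1`. -/
theorem columnTilt_block {K r : ℕ} (Q₀ : Matrix (Fin n) (Fin n) ℝ) (G : Fin N → Matrix (Fin n) (Fin n) ℝ)
    (x₀ : Fin n) (M0 : Fin n → ℝ) (hM : ∀ l, 0 ≤ M0 l) (hs : ∀ g, 1 ≤ |∑ l, M0 l * G g l x₀|)
    (e : Fin (K + 1) → Finset (Fin N)) (he : Function.Surjective e) (mm : entryTilted.A n → ℝ)
    (hle : ∀ a j, entryTilted.ρ n a ⬝ᵥ (cubePt Q₀ G ∘ e) j ≤ mm a)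
    (hat : ∀ a, ∃ j, entryTilted.ρ n a ⬝ᵥ (cubePt Q₀ G ∘ e) j = mm a)
    (U : entryTilted.A n → Option (Fin r) → ℝ) (V : Finset (Fin n) × Fin (K + 1) → Option (Fin r) → ℝ)
    (hU : ∀ a i, 0 ≤ U a i) (hV : ∀ p i, 0 ≤ V p i)
    (hfac : ∀ a b j, (entryTilted.β n a + mm a) - entryTilted.ρ n a ⬝ᵥ (udPt b + (cubePt Q₀ G ∘ e) j)
      = ∑ i, U a i * V (b, j) i) :
    3 ^ (n - 1) ≤ (r + 1) * 2 ^ (n - 1) := by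
  refine columnTilt_block_family entryTilted Q₀ G x₀ M0 hs e he
    (fun a => (a, colTilt x₀ fun l => colStrength G a * M0 l)) (fun a => rfl) (fun a => ?_) mm hle hat U V hU hV hfac
  show 1 + ∑ p, ∑ q, max (colTilt x₀ (fun l => colStrength G a * M0 l) p q) 0 = 1
  rw [box_colTilt x₀ _ (fun l => mul_nonneg (colStrength_pos G a).le (hM l)), add_zero]

/-- ★★★ **C⁺_entry HOLDS ON COLUMN-COUPLED AFFINE CUBES** — `entryTilted.Law` (= `LocatedPencilLaw`) with its passenger
quantifier restricted to (any listing of) a column-coupled affine cube: literal conclusion `T c n < r`. -/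
theorem entryTilted_law_on_columnCoupled : ∀ c : ℕ, ∃ n₀ : ℕ, ∀ n ≥ n₀,
    ∀ (N K : ℕ) (Q₀ : Matrix (Fin n) (Fin n) ℝ) (G : Fin N → Matrix (Fin n) (Fin n) ℝ)
      (e : Fin (K + 1) → Finset (Fin N)) (r : ℕ), Function.Surjective e → ColumnCoupled G →
    HasEFOfSize (convexHull ℝ (Set.range (cubePt Q₀ G ∘ e))) r →
    ∀ mm : entryTilted.A n → ℝ, (∀ a j, entryTilted.ρ n a ⬝ᵥ (cubePt Q₀ G ∘ e) j ≤ mm a) →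
      (∀ a, ∃ j, entryTilted.ρ n a ⬝ᵥ (cubePt Q₀ G ∘ e) j = mm a) →
    ∀ (U : entryTilted.A n → Option (Fin r) → ℝ) (V : Finset (Fin n) × Fin (K + 1) → Option (Fin r) → ℝ),
      (∀ a i, 0 ≤ U a i) → (∀ p i, 0 ≤ V p i) →
      (∀ a b j, (entryTilted.β n a + mm a) - entryTilted.ρ n a ⬝ᵥ (udPt b + (cubePt Q₀ G ∘ e) j)
        = ∑ i, U a i * V (b, j) i) →
      T c n < r := by
  intro c
  obtain ⟨n₀, hn₀⟩ := T_lt_of_block' c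
  refine ⟨max n₀ 2, fun n hn N K Q₀ G e r he hcc _ mm hle hat U V hU hV hfac => ?_⟩
  obtain ⟨x₀, M0, hM, hs⟩ := hcc
  have h2 : 2 ≤ n := le_of_max_le_right hn
  exact hn₀ n (le_of_max_le_left hn) (n - 1) r (by omega)
    (columnTilt_block Q₀ G x₀ M0 hM hs e he mm hle hat U V hU hV hfac)

/-- ★ POINTWISE YANNAKAKIS (the body of `corVirtualHardN_of_law` at one passenger and one size): if the `F`-Law's body holds at
`(q, r)` with any conclusion `C`, then an EF of `COR(n) + conv q` of size `r` gives `C`. -/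
theorem concl_of_lawBody (F : RowFamily) {n K r : ℕ} (q : Fin (K + 1) → (Fin (n * n) → ℝ)) {C : Prop}
    (hbody : ∀ m : F.A n → ℝ, (∀ a j, F.ρ n a ⬝ᵥ q j ≤ m a) → (∀ a, ∃ j, F.ρ n a ⬝ᵥ q j = m a) →
      ∀ (U : F.A n → Option (Fin r) → ℝ) (V : Finset (Fin n) × Fin (K + 1) → Option (Fin r) → ℝ),
        (∀ a i, 0 ≤ U a i) → (∀ p i, 0 ≤ V p i) →
        (∀ a b j, (F.β n a + m a) - F.ρ n a ⬝ᵥ (udPt b + q j) = ∑ i, U a i * V (b, j) i) → C)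
    (hR : HasEFOfSize (corPolytope n + convexHull ℝ (Set.range q)) r) : C := by
  classical
  obtain ⟨pt_mem, -, -, -⟩ := ud_data n
  let m : F.A n → ℝ := fun a =>
    Finset.univ.sup' Finset.univ_nonempty (fun j : Fin (K + 1) => F.ρ n a ⬝ᵥ q j)
  have hmax : ∀ a, ∃ j, F.ρ n a ⬝ᵥ q j = m a := fun a => by
    obtain ⟨j, -, hj⟩ := Finset.exists_mem_eq_sup' Finset.univ_nonempty
      (fun j : Fin (K + 1) => F.ρ n a ⬝ᵥ q j)
    exact ⟨j, hj.symm⟩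
  have hmq : ∀ a j, F.ρ n a ⬝ᵥ q j ≤ m a := fun a j =>
    Finset.le_sup' (fun j : Fin (K + 1) => F.ρ n a ⬝ᵥ q j) (Finset.mem_univ j)
  have hm : ∀ a, ∀ y ∈ convexHull ℝ (Set.range q), F.ρ n a ⬝ᵥ y ≤ m a := fun a =>
    dot_le_of_mem_convexHull _ _ _ (by rintro _ ⟨j, rfl⟩; exact hmq a j)
  have hq : ∀ j, q j ∈ convexHull ℝ (Set.range q) := fun j => subset_convexHull ℝ _ ⟨j, rfl⟩
  have hv : ∀ p : Finset (Fin n) × Fin (K + 1),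
      udPt p.1 + q p.2 ∈ corPolytope n + convexHull ℝ (Set.range q) :=
    fun p => Set.add_mem_add (pt_mem p.1) (hq p.2)
  have hvalid : ∀ a, ∀ x ∈ corPolytope n + convexHull ℝ (Set.range q), F.ρ n a ⬝ᵥ x ≤ F.β n a + m a := by
    rintro a x ⟨p, hp, y, hy, rfl⟩
    rw [dotProduct_add]
    exact add_le_add (F.valid n a p hp) (hm a y hy)
  obtain ⟨U, V, hU, hV, hfac⟩ := Literature.Barriers.PneNP.HasEFOfSize.exists_nonneg_factorization hR
    (fun p : Finset (Fin n) × Fin (K + 1) => udPt p.1 + q p.2) hv (F.ρ n) (fun a => F.β n a + m a) hvalid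
  exact hbody m hmq hmax U V hU hV (fun a b j => hfac a (b, j))

/-- ★ **COLUMN-COUPLED AFFINE CUBES ARE DECIDED** (xc currency, flat socket — the shape a `CoreLaw` binder consumes):
`HasEFOfSize (COR(n) + conv q) r ⟹ T c n < r`, eventually in `n`, for every listing `q` of a column-coupled affine cube. -/
theorem columnCoupled_decided : ∀ c : ℕ, ∃ n₀ : ℕ, ∀ n ≥ n₀,
    ∀ (N K : ℕ) (Q₀ : Matrix (Fin n) (Fin n) ℝ) (G : Fin N → Matrix (Fin n) (Fin n) ℝ)
      (e : Fin (K + 1) → Finset (Fin N)) (r : ℕ), Function.Surjective e → ColumnCoupled G →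
    HasEFOfSize (corPolytope n + convexHull ℝ (Set.range (cubePt Q₀ G ∘ e))) r → T c n < r := by
  intro c
  obtain ⟨n₀, hn₀⟩ := T_lt_of_block' c
  refine ⟨max n₀ 2, fun n hn N K Q₀ G e r he hcc hR => ?_⟩
  obtain ⟨x₀, M0, hM, hs⟩ := hcc
  have h2 : 2 ≤ n := le_of_max_le_right hn
  refine concl_of_lawBody entryTilted (cubePt Q₀ G ∘ e) (fun mm hle hat U V hU hV hfac => ?_) hR
  exact hn₀ n (le_of_max_le_left hn) (n - 1) r (by omega)
    (columnTilt_block Q₀ G x₀ M0 hM hs e he mm hle hat U V hU hV hfac)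

/-- ★ likewise **PIN-EXPOSED PASSENGERS ARE DECIDED** (xc currency, flat socket). -/
theorem pinExposed_decided : ∀ c : ℕ, ∃ n₀ : ℕ, ∀ n ≥ n₀,
    ∀ (K : ℕ) (q : Fin (K + 1) → (Fin (n * n) → ℝ)) (r : ℕ), PinExposed n K q →
    HasEFOfSize (corPolytope n + convexHull ℝ (Set.range q)) r → T c n < r := by
  intro c
  obtain ⟨n₀, hn₀⟩ := T_lt_of_block' c
  refine ⟨n₀, fun n hn K q r hpin hR => ?_⟩
  obtain ⟨S, w, jstar, hS, hvalid, htight, hmax⟩ := hpin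
  refine concl_of_lawBody pinnedRows q (fun mm hle hat U V hU hV hfac => ?_) hR
  exact hn₀ n hn (n - S.card) r (by omega) (pin_block q S w jstar hvalid htight hmax mm hle hat U V hU hV hfac)

/-! ### `Q^∘` is a column-coupled affine cube -/

/-- base point of `Q^∘`: `n²(J − I)`. -/
def qOffBase (n : ℕ) : Matrix (Fin n) (Fin n) ℝ := fun i m => if i = m then 0 else (n : ℝ) ^ 2

/-- generators of `Q^∘`: `(g_l)_{im} = n − n²([l = i] + [l = m])` off the diagonal, `0` on it. -/
def qOffGen (n : ℕ) (l : Fin n) : Matrix (Fin n) (Fin n) ℝ := fun i m =>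
  if i = m then 0 else (n : ℝ) - (n : ℝ) ^ 2 * ((if i = l then 1 else 0) + (if m = l then 1 else 0))

/-- `Q^∘` IS the affine cube `n²(J−I) + Σ_{l∈P} g_l`. -/
theorem qOff_eq_cubePt (P : Finset (Fin n)) : qOff P = cubePt (qOffBase n) (qOffGen n) P := by
  classical
  funext p
  simp only [qOff, qOffMat, cubePt, flat, qOffBase, qOffGen, Matrix.add_apply, Matrix.sum_apply]
  set i := (finProdFinEquiv.symm p).1
  set m := (finProdFinEquiv.symm p).2
  by_cases h : i = m
  · simp [h]
  · simp only [if_neg h]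
    have h1 : ∑ g ∈ P, ((n : ℝ) - (n : ℝ) ^ 2 * ((if i = g then (1 : ℝ) else 0) + (if m = g then (1 : ℝ) else 0)))
        = (n : ℝ) * P.card - (n : ℝ) ^ 2 * (udInd P i + udInd P m) := by
      rw [Finset.sum_sub_distrib, Finset.sum_const, nsmul_eq_mul, ← Finset.mul_sum, Finset.sum_add_distrib,
        Finset.sum_ite_eq, Finset.sum_ite_eq, ← udInd_apply, ← udInd_apply]
      ring
    rw [h1]
    ring

/-- `Q^∘` is column-coupled (`n ≥ 2`): the entry `(x′, x)` is moved by every generator, by `n` or `n − n²`. -/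
theorem columnCoupled_qOff (hn : 2 ≤ n) {x x' : Fin n} (hx : x' ≠ x) : ColumnCoupled (qOffGen n) := by
  refine columnCoupled_of_entry x x' fun g => ?_
  have hn' : (2 : ℝ) ≤ n := by exact_mod_cast hn
  simp only [qOffGen, if_neg hx]
  by_cases h1 : x' = g
  · have h2 : ¬ x = g := fun h2 => hx (h1.trans h2.symm)
    rw [if_pos h1, if_neg h2, add_zero, mul_one, le_abs]
    right; nlinarith
  · by_cases h2 : x = g
    · rw [if_neg h1, if_pos h2, zero_add, mul_one, le_abs]
      right; nlinarith
    · rw [if_neg h1, if_neg h2, add_zero, mul_zero, sub_zero, le_abs]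
      left; linarith

end ColumnClass

/-! ## §4d ★ THE OPEN QUESTION OF WAVE 6 (crit-9 g2, 22:52:44Z) — EXACT-rhs half: the DIAGONAL PERMUTAHEDRON is PIN-EXPOSED

`Q^Π_λ = conv{−λ·diag π : π ∈ S_n}` (xc `O(n log n)`, Goemans).  crit-9's reduction «C⁺_entry-blind ⟺ C⁺_diag-blind» for a
diagonal passenger is a BOX-currency statement (off-diagonal tilt entries only add `cone{1 − b_ib_k, b_ib_k}` junk).  In EXACT-rhs
located currency (`pinnedRows`, class `PinExposed`) the passenger is DECIDED, in kernel: pin `S = {s₀}`, `s₀ = n − 1`, direction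
`w = flat(diag D) + flat(colTilt s₀ M)`, `D = (1, 2, …, n−1 ↦ …, n²  at s₀)`, `M = (i+1)_{i≠s₀}, 0 at s₀` — so
`⟨w, bbᵀ⟩ = Σ_{i∈b} D_i − b_{s₀}·Σ_{i∈b} M_i` equals `n²` on the WHOLE face `{b ∋ s₀}` (`pinW_dotProduct_udPt_of_mem`) and is `≤ n²`
off it; `⟨udRow a + w, q_π⟩ = −λ·Σ_i (D_i + [i ∈ a])·π(i)` (`pin_value`; the column part pairs to `0` with a diagonal passenger), and
`i ↦ D_i + [i ∈ a]` is MONOTONE for EVERY `a` — the order-reversing permutation `rev` is a COMMON maximiser of all tilted rows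
(rearrangement inequality, `sum_rev_le`).  Hence `pinExposed_qPerm`, ★★★ `qPerm_decided` (xc currency, flat socket:
`HasEFOfSize (COR(n) + conv q) r → T c n < r` for every listing `q` of `Q^Π_λ` containing `rev`, `λ ≥ 0`, eventually in `n`) and
`pinnedRows_law_holds_on_qPerm` (Law currency).  BOX currency (paper, for W6-R1): the same `w` has box junk
`‖w⁺‖₁ − ⟨w, bbᵀ⟩ = Σ_{i<s₀}(i+1) =: C` on the window, and `(1−|a∩b|)² + C = Σ_{i≠k∈a} b_ib_k + Σ_{i∈a}(1−b_i) + (C+1−|a|)` factorises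
with `n² + n + 1` slots as soon as `C ≥ n − 1`: a-INDEPENDENT located directions decide nothing about `Q^Π` in box currency, and the
residual box question is exactly crit-9's `rank₊ M_{a,σ}` with a-DEPENDENT diagonal `σ`.  So «is `Q^Π` blind to located pencils?»
SPLITS BY CURRENCY: NO for exact right-hand sides (this section), OPEN for box right-hand sides (`LocatedPencilLaw` as typed). -/

section PermClass
variable {n : ℕ}

/-- the DIAGONAL PERMUTAHEDRON passenger `Q^Π_λ`: `q_π = flat (diag (−λ·π(i))_i)`. -/
def qPerm (n : ℕ) (lam : ℝ) (π : Equiv.Perm (Fin n)) : Fin (n * n) → ℝ :=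
  flat (Matrix.diagonal fun i => -(lam * (((π i : Fin n) : ℕ) : ℝ)))

/-- diagonal profile of the pin direction: `i + 1`, and `n²` at the pin `s₀`. -/
def pD (n : ℕ) (s₀ : Fin n) : Fin n → ℝ := fun i => if i = s₀ then (n : ℝ) ^ 2 else ((i : ℕ) : ℝ) + 1

/-- column-`s₀` coupling of the pin direction: `i + 1` off the pin, `0` at the pin. -/
def pM (n : ℕ) (s₀ : Fin n) : Fin n → ℝ := fun i => if i = s₀ then 0 else ((i : ℕ) : ℝ) + 1

/-- the PIN DIRECTION `w = diag D − Σ_{i≠s₀} (i+1) E_{i s₀}` (flat). -/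
def pinW (n : ℕ) (s₀ : Fin n) : Fin (n * n) → ℝ :=
  flat (Matrix.diagonal (pD n s₀)) + flat (colTilt s₀ (pM n s₀))

theorem flat_diagonal_dotProduct_udPt (D : Fin n → ℝ) (b : Finset (Fin n)) :
    flat (Matrix.diagonal D) ⬝ᵥ udPt b = ∑ i ∈ b, D i := by
  classical
  rw [show udPt b = vecOuter n (udInd b) from rfl, flat_dotProduct_vecOuter]
  have h : ∀ i, ∑ j, Matrix.diagonal D i j * (udInd b i * udInd b j) = if i ∈ b then D i else 0 := fun i => by
    rw [Finset.sum_eq_single i (fun j _ hj => by rw [Matrix.diagonal_apply_ne _ (Ne.symm hj)]; ring)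
      (fun h => absurd (Finset.mem_univ _) h), Matrix.diagonal_apply_eq, udInd_apply]
    split_ifs <;> ring
  simp_rw [h]
  rw [Finset.sum_ite_mem, Finset.univ_inter]

theorem colTilt_dotProduct_udPt' (x₀ : Fin n) (M : Fin n → ℝ) (b : Finset (Fin n)) :
    flat (colTilt x₀ M) ⬝ᵥ udPt b = -(udInd b x₀ * ∑ i ∈ b, M i) := by
  classical
  rw [show udPt b = vecOuter n (udInd b) from rfl, flat_dotProduct_vecOuter]
  have h : ∀ i, ∑ j, colTilt x₀ M i j * (udInd b i * udInd b j) = -(udInd b x₀ * if i ∈ b then M i else 0) := fun i => by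
    rw [Finset.sum_eq_single x₀ (fun j _ hj => by simp [colTilt, hj]) (fun h => absurd (Finset.mem_univ _) h)]
    simp only [colTilt, if_true]
    rw [udInd_apply b i]
    split_ifs <;> ring
  simp_rw [h]
  rw [Finset.sum_neg_distrib, ← Finset.mul_sum, Finset.sum_ite_mem, Finset.univ_inter]

theorem flat_diagonal_dotProduct_flat_diagonal (D v : Fin n → ℝ) :
    flat (Matrix.diagonal D) ⬝ᵥ flat (Matrix.diagonal v) = ∑ i, D i * v i := by
  rw [flat_dotProduct_flat]
  refine Finset.sum_congr rfl fun i _ => ?_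
  rw [Finset.sum_eq_single i (fun j _ hj => by rw [Matrix.diagonal_apply_ne _ (Ne.symm hj)]; ring)
    (fun h => absurd (Finset.mem_univ _) h), Matrix.diagonal_apply_eq, Matrix.diagonal_apply_eq]

theorem pinW_dotProduct_udPt (s₀ : Fin n) (b : Finset (Fin n)) :
    pinW n s₀ ⬝ᵥ udPt b = ∑ i ∈ b, pD n s₀ i - udInd b s₀ * ∑ i ∈ b, pM n s₀ i := by
  rw [pinW, add_dotProduct, flat_diagonal_dotProduct_udPt, colTilt_dotProduct_udPt']
  ring

/-- the pin direction is MAXIMAL (`= n²`) on the whole coordinate face `{b ∋ s₀}` … -/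
theorem pinW_dotProduct_udPt_of_mem (s₀ : Fin n) {b : Finset (Fin n)} (h : s₀ ∈ b) :
    pinW n s₀ ⬝ᵥ udPt b = (n : ℝ) ^ 2 := by
  rw [pinW_dotProduct_udPt, udInd_apply, if_pos h, one_mul, ← Finset.sum_sub_distrib]
  have hd : ∀ i, pD n s₀ i - pM n s₀ i = if i = s₀ then (n : ℝ) ^ 2 else 0 := fun i => by
    unfold pD pM; split_ifs <;> ring
  simp_rw [hd]
  rw [Finset.sum_ite_eq', if_pos h]

/-- … and at most `n²` off it. -/
theorem pinW_dotProduct_udPt_le (s₀ : Fin n) {b : Finset (Fin n)} (h : s₀ ∉ b) :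
    pinW n s₀ ⬝ᵥ udPt b ≤ (n : ℝ) ^ 2 := by
  rw [pinW_dotProduct_udPt, udInd_apply, if_neg h, zero_mul, sub_zero]
  have hle : ∀ i ∈ b, pD n s₀ i ≤ (n : ℝ) := fun i hi => by
    have his : i ≠ s₀ := fun h' => h (h' ▸ hi)
    simp only [pD, if_neg his]
    have := i.2
    exact_mod_cast this
  calc ∑ i ∈ b, pD n s₀ i ≤ ∑ _i ∈ b, (n : ℝ) := Finset.sum_le_sum hle
    _ = b.card * (n : ℝ) := by rw [Finset.sum_const, nsmul_eq_mul]
    _ ≤ (n : ℝ) * n := by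
        have : (b.card : ℝ) ≤ n := by exact_mod_cast (Finset.card_le_univ b).trans_eq (Fintype.card_fin n)
        exact mul_le_mul_of_nonneg_right this (Nat.cast_nonneg n)
    _ = (n : ℝ) ^ 2 := by ring

theorem pinW_valid (s₀ : Fin n) : ∀ x ∈ corPolytope n, pinW n s₀ ⬝ᵥ x ≤ (n : ℝ) ^ 2 := by
  classical
  refine dot_le_of_mem_convexHull _ _ _ ?_
  rintro _ ⟨c, rfl⟩
  show pinW n s₀ ⬝ᵥ vecOuter n (bvec c) ≤ _
  have hc : vecOuter n (bvec c) = udPt (Finset.univ.filter fun j => c j = true) := by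
    show vecOuter n (bvec c) = vecOuter n (udInd _)
    congr 1
    funext j
    rw [udInd_apply]
    simp only [Finset.mem_filter, Finset.mem_univ, true_and, bvec]
  rw [hc]
  by_cases hs : s₀ ∈ Finset.univ.filter fun j => c j = true
  · rw [pinW_dotProduct_udPt_of_mem s₀ hs]
  · exact pinW_dotProduct_udPt_le s₀ hs

/-- the tilted pinned row on the permutahedron: `⟨udRow a + w, q_π⟩ = −λ Σ_i (D_i + [i ∈ a]) π(i)` (column part pairs to `0`). -/
theorem pin_value (s₀ : Fin n) (a : Finset (Fin n)) (lam : ℝ) (π : Equiv.Perm (Fin n)) :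
    (udRow a + pinW n s₀) ⬝ᵥ qPerm n lam π = -(lam * ∑ i, (pD n s₀ i + udInd a i) * (((π i : Fin n) : ℕ) : ℝ)) := by
  classical
  rw [qPerm, pinW, add_dotProduct, add_dotProduct, udRow_dotProduct_flat_diagonal, flat_diagonal_dotProduct_flat_diagonal,
    colTilt_dotProduct_flat]
  have h0 : ∑ l, pM n s₀ l * Matrix.diagonal (fun i => -(lam * (((π i : Fin n) : ℕ) : ℝ))) l s₀ = 0 := by
    rw [Finset.sum_eq_single s₀ (fun l _ hl => by rw [Matrix.diagonal_apply_ne _ hl, mul_zero])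
      (fun h => absurd (Finset.mem_univ _) h)]
    simp [pM]
  have ha : ∑ i ∈ a, -(lam * (((π i : Fin n) : ℕ) : ℝ)) = ∑ i, udInd a i * -(lam * (((π i : Fin n) : ℕ) : ℝ)) := by
    simp_rw [udInd_apply, ite_mul, one_mul, zero_mul]
    rw [Finset.sum_ite_mem, Finset.univ_inter]
  rw [h0, neg_zero, add_zero, ha, ← Finset.sum_add_distrib, Finset.mul_sum, ← Finset.sum_neg_distrib]
  exact Finset.sum_congr rfl fun i _ => by ring

/-- REARRANGEMENT: with the pin at the top index, `i ↦ D_i + [i ∈ a]` is monotone for every `a`, so `rev` minimises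
`Σ_i (D_i + [i ∈ a]) π(i)` over all permutations `π`. -/
theorem sum_rev_le (hn : 2 ≤ n) (s₀ : Fin n) (hs : (s₀ : ℕ) = n - 1) (a : Finset (Fin n)) (π : Equiv.Perm (Fin n)) :
    ∑ i, (pD n s₀ i + udInd a i) * (((Fin.revPerm i : Fin n) : ℕ) : ℝ)
      ≤ ∑ i, (pD n s₀ i + udInd a i) * (((π i : Fin n) : ℕ) : ℝ) := by
  classical
  set f : Fin n → ℝ := fun i => pD n s₀ i + udInd a i with hf
  set g : Fin n → ℝ := fun i => (((Fin.revPerm i : Fin n) : ℕ) : ℝ) with hg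
  have hu0 : ∀ i, 0 ≤ udInd a i := fun i => by rw [udInd_apply]; split_ifs <;> norm_num
  have hu1 : ∀ i, udInd a i ≤ 1 := fun i => by rw [udInd_apply]; split_ifs <;> norm_num
  have hfg : Antivary f g := by
    intro i j hij
    -- `g i < g j` means `rev i < rev j`, i.e. `j < i`
    have hji : j < i := by
      have h1 : ((Fin.rev i : Fin n) : ℕ) < ((Fin.rev j : Fin n) : ℕ) := by
        have := hij; simp only [hg, Fin.revPerm_apply] at this; exact_mod_cast this
      exact Fin.rev_lt_rev.1 (Fin.lt_def.2 h1)
    have hjv : (j : ℕ) < i := hji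
    have hjs : j ≠ s₀ := fun h => by rw [h, hs] at hjv; have := i.2; omega
    show pD n s₀ j + udInd a j ≤ pD n s₀ i + udInd a i
    have hpj : pD n s₀ j = ((j : ℕ) : ℝ) + 1 := by simp [pD, hjs]
    have hpi : ((j : ℕ) : ℝ) + 2 ≤ pD n s₀ i := by
      by_cases his : i = s₀
      · simp only [pD, if_pos his]
        have h2 : (j : ℕ) + 2 ≤ n := by have := i.2; omega
        have h3 : (n : ℝ) ≤ (n : ℝ) ^ 2 := by
          have : (1 : ℝ) ≤ n := by exact_mod_cast (by omega : 1 ≤ n)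
          nlinarith
        calc ((j : ℕ) : ℝ) + 2 = (((j : ℕ) + 2 : ℕ) : ℝ) := by push_cast; ring
          _ ≤ n := by exact_mod_cast h2
          _ ≤ (n : ℝ) ^ 2 := h3
      · simp only [pD, if_neg his]
        have : (j : ℕ) + 1 ≤ i := hjv
        calc ((j : ℕ) : ℝ) + 2 = (((j : ℕ) + 1 : ℕ) : ℝ) + 1 := by push_cast; ring
          _ ≤ ((i : ℕ) : ℝ) + 1 := by gcongr
    rw [hpj]
    linarith [hu1 j, hu0 i]
  have key := Antivary.sum_mul_le_sum_mul_comp_perm (σ := π.trans Fin.revPerm.symm) hfg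
  have hgσ : ∀ i, g ((π.trans Fin.revPerm.symm) i) = (((π i : Fin n) : ℕ) : ℝ) := fun i => by
    simp only [hg, Equiv.trans_apply, Equiv.apply_symm_apply]
  simp_rw [hgσ] at key
  exact key

/-- ★★ `Q^Π_λ` IS PIN-EXPOSED: pin `{s₀}` at the top index, direction `pinW`, common maximiser `rev`. -/
theorem pinExposed_qPerm (hn : 2 ≤ n) (s₀ : Fin n) (hs : (s₀ : ℕ) = n - 1) {lam : ℝ} (hlam : 0 ≤ lam) {K : ℕ}
    (e : Fin (K + 1) → Equiv.Perm (Fin n)) (jstar : Fin (K + 1)) (hj : e jstar = Fin.revPerm) :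
    PinExposed n K (qPerm n lam ∘ e) := by
  classical
  refine ⟨{s₀}, pinW n s₀, jstar, ?_, ?_, ?_, ?_⟩
  · rw [Finset.card_singleton]; omega
  · intro x hx
    rw [pinW_dotProduct_udPt_of_mem s₀ (Finset.mem_singleton_self s₀)]
    exact pinW_valid s₀ x hx
  · intro b hb
    rw [pinW_dotProduct_udPt_of_mem s₀ (hb (Finset.mem_singleton_self s₀)),
      pinW_dotProduct_udPt_of_mem s₀ (Finset.mem_singleton_self s₀)]
  · intro a _ j
    show (udRow a + pinW n s₀) ⬝ᵥ qPerm n lam (e j) ≤ (udRow a + pinW n s₀) ⬝ᵥ qPerm n lam (e jstar)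
    rw [hj, pin_value, pin_value]
    exact neg_le_neg (mul_le_mul_of_nonneg_left (sum_rev_le hn s₀ hs a (e j)) hlam)

/-- ★★★ **THE DIAGONAL PERMUTAHEDRON IS DECIDED** (xc currency, flat socket): for every `λ ≥ 0` and every listing `q` of
`Q^Π_λ`'s vertices containing `rev`, `HasEFOfSize (COR(n) + conv q) r ⟹ T c n < r`, eventually in `n`. -/
theorem qPerm_decided : ∀ c : ℕ, ∃ n₀ : ℕ, ∀ n ≥ n₀, ∀ (K : ℕ) (lam : ℝ) (e : Fin (K + 1) → Equiv.Perm (Fin n)) (r : ℕ),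
    0 ≤ lam → (∃ j, e j = Fin.revPerm) →
    HasEFOfSize (corPolytope n + convexHull ℝ (Set.range (qPerm n lam ∘ e))) r → T c n < r := by
  intro c
  obtain ⟨n₀, hn₀⟩ := pinExposed_decided c
  refine ⟨max n₀ 2, fun n hn K lam e r hlam hj hR => ?_⟩
  have h2 : 2 ≤ n := le_of_max_le_right hn
  obtain ⟨jstar, hj⟩ := hj
  exact hn₀ n (le_of_max_le_left hn) K _ r (pinExposed_qPerm h2 ⟨n - 1, by omega⟩ rfl hlam e jstar hj) hR

/-- ★★ Law currency: `pinnedRows.Law` (C⁺_loc, exact right-hand sides) HOLDS on `Q^Π_λ` with literal `T c n < r`. -/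
theorem pinnedRows_law_holds_on_qPerm : ∀ c : ℕ, ∃ n₀ : ℕ, ∀ n ≥ n₀,
    ∀ (K : ℕ) (lam : ℝ) (e : Fin (K + 1) → Equiv.Perm (Fin n)) (r : ℕ), 0 ≤ lam → (∃ j, e j = Fin.revPerm) →
    HasEFOfSize (convexHull ℝ (Set.range (qPerm n lam ∘ e))) r →
    ∀ mm : pinnedRows.A n → ℝ, (∀ a j, pinnedRows.ρ n a ⬝ᵥ (qPerm n lam ∘ e) j ≤ mm a) →
      (∀ a, ∃ j, pinnedRows.ρ n a ⬝ᵥ (qPerm n lam ∘ e) j = mm a) →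
    ∀ (U : pinnedRows.A n → Option (Fin r) → ℝ) (V : Finset (Fin n) × Fin (K + 1) → Option (Fin r) → ℝ),
      (∀ a i, 0 ≤ U a i) → (∀ p i, 0 ≤ V p i) →
      (∀ a b j, (pinnedRows.β n a + mm a) - pinnedRows.ρ n a ⬝ᵥ (udPt b + (qPerm n lam ∘ e) j) = ∑ i, U a i * V (b, j) i) →
      T c n < r := by
  intro c
  obtain ⟨n₀, hn₀⟩ := pinnedRows_law_on_pinExposed c
  refine ⟨max n₀ 2, fun n hn K lam e r hlam hj hq mm hle hat U V hU hV hfac => ?_⟩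
  have h2 : 2 ≤ n := le_of_max_le_right hn
  obtain ⟨jstar, hj⟩ := hj
  exact hn₀ n (le_of_max_le_left hn) K _ r (pinExposed_qPerm h2 ⟨n - 1, by omega⟩ rfl hlam e jstar hj) hq
    mm hle hat U V hU hV hfac

end PermClass

/-! ## §5 The obstruction, typed: private generators are invisible to every located row -/

section Obstruction
variable {n : ℕ}

/-- `W` is (normalised-)LOCATED at the coordinate face `F_{S,S'} = {b ⊇ S, b ∩ S' = ∅}` (free block `U = (S ∪ S')ᶜ`): it is
orthogonal to the face's affine span — no off-diagonal entries inside `U × U`, and `W_mm = −Σ_{i∈S}(W_im + W_mi)` for `m ∈ U`.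
(Every direction in the normal cone of `F_{S,S'}` satisfies this after symmetrisation.) -/
def LocatedAt (S S' : Finset (Fin n)) (W : Matrix (Fin n) (Fin n) ℝ) : Prop :=
  (∀ p, p ∉ S ∪ S' → ∀ q, q ∉ S ∪ S' → p ≠ q → W p q = 0) ∧
    (∀ p, p ∉ S ∪ S' → W p p = -∑ i ∈ S, (W i p + W p i))

/-- `g` is PRIVATE at `(S,S')`: it vanishes on `(S∪S')²` and on `S' × U ∪ U × S'`, and on `S × U` it is column-constant
`g_im = g_mi = g_mm`.  (The `U`-internal zero-diagonal generators are private; so is nothing with a diagonal entry in `U` unless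
its `S`-rows copy that entry.) -/
def Private (S S' : Finset (Fin n)) (g : Matrix (Fin n) (Fin n) ℝ) : Prop :=
  (∀ p ∈ S ∪ S', ∀ q ∈ S ∪ S', g p q = 0) ∧
    (∀ p ∈ S', ∀ q, q ∉ S ∪ S' → g p q = 0 ∧ g q p = 0) ∧
    (∀ p ∈ S, ∀ q, q ∉ S ∪ S' → g p q = g q q ∧ g q p = g q q)

/-- ★ **PRIVATE GENERATORS ARE INVISIBLE TO LOCATED ROWS**: `⟨W, g⟩ = 0` whenever `W` is located at `F_{S,S'}` and `g` is
private there (`S ∩ S' = ∅`).  Consequence (paper, card): on an affine-cube / zonotope passenger a located tilt makes the cube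
coordinate of a generator `g` COMMON iff `⟨W, g⟩ ≠ 0`; private generators keep PRIVATE maximisers, and for `Z_mix` the rows
sharing a chamber form a laminar family — no coordinate-located hitting certificate at any codimension. -/
theorem located_dot_private {S S' : Finset (Fin n)} (hSS : Disjoint S S') {W g : Matrix (Fin n) (Fin n) ℝ}
    (hW : LocatedAt S S' W) (hg : Private S S' g) : flat W ⬝ᵥ flat g = 0 := by
  classical
  rw [flat_dotProduct_flat]
  obtain ⟨hWU, hWd⟩ := hW
  obtain ⟨hg0, hgS', hgS⟩ := hg
  -- rewrite every entry product as a function supported on `S × U ∪ U × S ∪ diag(U)`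
  let U : Finset (Fin n) := (S ∪ S')ᶜ
  have hmemU : ∀ p, p ∈ U ↔ p ∉ S ∪ S' := fun p => Finset.mem_compl
  -- per-row computation
  have hrow : ∀ p, ∑ q, W p q * g p q =
      (if p ∈ S then ∑ q ∈ U, W p q * g q q else 0) +
      (if p ∈ U then W p p * g p p + ∑ i ∈ S, W p i * g p p else 0) := by
    intro p
    by_cases hpS : p ∈ S
    · have hpU : p ∉ U := fun h => (hmemU p).1 h (Finset.mem_union_left _ hpS)
      rw [if_pos hpS, if_neg hpU, add_zero]
      rw [← Finset.sum_add_sum_compl (S ∪ S')]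
      have h1 : ∑ q ∈ S ∪ S', W p q * g p q = 0 :=
        Finset.sum_eq_zero fun q hq => by rw [hg0 p (Finset.mem_union_left _ hpS) q hq, mul_zero]
      rw [h1, zero_add]
      exact Finset.sum_congr rfl fun q hq => by rw [(hgS p hpS q ((hmemU q).1 hq)).1]
    by_cases hpS' : p ∈ S'
    · have hpU : p ∉ U := fun h => (hmemU p).1 h (Finset.mem_union_right _ hpS')
      rw [if_neg hpS, if_neg hpU, add_zero]
      refine Finset.sum_eq_zero fun q _ => ?_
      by_cases hq : q ∈ S ∪ S'
      · rw [hg0 p (Finset.mem_union_right _ hpS') q hq, mul_zero]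
      · rw [(hgS' p hpS' q hq).1, mul_zero]
    · have hpSS : p ∉ S ∪ S' := by rw [Finset.mem_union]; push Not; exact ⟨hpS, hpS'⟩
      have hpU : p ∈ U := (hmemU p).2 hpSS
      rw [if_neg hpS, if_pos hpU, zero_add]
      rw [← Finset.sum_add_sum_compl (S ∪ S')]
      have h1 : ∑ q ∈ S ∪ S', W p q * g p q = ∑ i ∈ S, W p i * g p p := by
        rw [Finset.sum_union hSS]
        have h2 : ∑ q ∈ S', W p q * g p q = 0 :=
          Finset.sum_eq_zero fun q hq => by rw [(hgS' q hq p hpSS).2, mul_zero]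
        rw [h2, add_zero]
        exact Finset.sum_congr rfl fun i hi => by rw [(hgS i hi p hpSS).2]
      rw [h1]
      have h3 : ∑ q ∈ (S ∪ S')ᶜ, W p q * g p q = W p p * g p p := by
        rw [Finset.sum_eq_single p]
        · intro q hq hqp
          rw [hWU p hpSS q ((hmemU q).1 hq) (Ne.symm hqp), zero_mul]
        · intro h; exact absurd hpU h
      rw [h3, add_comm]
  rw [Finset.sum_congr rfl fun p _ => hrow p, Finset.sum_add_distrib]
  -- first block: Σ_{p∈S} Σ_{q∈U} W p q g q q ; second block: Σ_{p∈U} (W p p + Σ_{i∈S} W p i) g p p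
  rw [Finset.sum_ite_mem, Finset.univ_inter, Finset.sum_ite_mem, Finset.univ_inter]
  have hsecond : ∑ p ∈ U, (W p p * g p p + ∑ i ∈ S, W p i * g p p) = -∑ p ∈ U, ∑ i ∈ S, W i p * g p p := by
    rw [← Finset.sum_neg_distrib]
    refine Finset.sum_congr rfl fun p hp => ?_
    rw [hWd p ((hmemU p).1 hp)]
    simp only [Finset.sum_add_distrib, neg_add, add_mul, neg_mul, Finset.sum_mul]
    ring
  rw [hsecond, Finset.sum_comm]
  ring

/-- the `Z_mix` generator `E^s_{kl} − E^s_{km}` as a matrix. -/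
def zgen (k l m : Fin n) : Matrix (Fin n) (Fin n) ℝ := fun p q =>
  (if (p = k ∧ q = l) ∨ (p = l ∧ q = k) then (1 : ℝ) else 0) - (if (p = k ∧ q = m) ∨ (p = m ∧ q = k) then 1 else 0)

/-- ★ the `U`-internal `Z_mix` generators are PRIVATE at every coordinate face avoiding their three indices. -/
theorem zgen_private {S S' : Finset (Fin n)} {k l m : Fin n} (hk : k ∉ S ∪ S') (hl : l ∉ S ∪ S') (hm : m ∉ S ∪ S')
    (hkl : k ≠ l) (hkm : k ≠ m) : Private S S' (zgen k l m) := by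
  refine ⟨fun p hp q hq => ?_, fun p hp q hq => ⟨?_, ?_⟩, fun p hp q hq => ⟨?_, ?_⟩⟩
  · have hpk : p ≠ k := fun h => hk (h ▸ hp)
    have hpl : p ≠ l := fun h => hl (h ▸ hp)
    have hpm : p ≠ m := fun h => hm (h ▸ hp)
    simp [zgen, hpk, hpl, hpm]
  · have hp' : p ∈ S ∪ S' := Finset.mem_union_right _ hp
    have hpk : p ≠ k := fun h => hk (h ▸ hp')
    have hpl : p ≠ l := fun h => hl (h ▸ hp')
    have hpm : p ≠ m := fun h => hm (h ▸ hp')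
    simp [zgen, hpk, hpl, hpm]
  · have hp' : p ∈ S ∪ S' := Finset.mem_union_right _ hp
    have hpk : p ≠ k := fun h => hk (h ▸ hp')
    have hpl : p ≠ l := fun h => hl (h ▸ hp')
    have hpm : p ≠ m := fun h => hm (h ▸ hp')
    simp [zgen, hpk, hpl, hpm]
  · have hp' : p ∈ S ∪ S' := Finset.mem_union_left _ hp
    have hpk : p ≠ k := fun h => hk (h ▸ hp')
    have hpl : p ≠ l := fun h => hl (h ▸ hp')
    have hpm : p ≠ m := fun h => hm (h ▸ hp')
    have hd : zgen k l m q q = 0 := by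
      have h1 : ¬ ((q = k ∧ q = l) ∨ (q = l ∧ q = k)) := by
        rintro (⟨h, h'⟩ | ⟨h, h'⟩)
        · exact hkl (h.symm.trans h')
        · exact hkl (h'.symm.trans h)
      have h2 : ¬ ((q = k ∧ q = m) ∨ (q = m ∧ q = k)) := by
        rintro (⟨h, h'⟩ | ⟨h, h'⟩)
        · exact hkm (h.symm.trans h')
        · exact hkm (h'.symm.trans h)
      simp only [zgen, if_neg h1, if_neg h2, sub_zero]
    rw [hd]; simp [zgen, hpk, hpl, hpm]
  · have hp' : p ∈ S ∪ S' := Finset.mem_union_left _ hp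
    have hpk : p ≠ k := fun h => hk (h ▸ hp')
    have hpl : p ≠ l := fun h => hl (h ▸ hp')
    have hpm : p ≠ m := fun h => hm (h ▸ hp')
    have hd : zgen k l m q q = 0 := by
      have h1 : ¬ ((q = k ∧ q = l) ∨ (q = l ∧ q = k)) := by
        rintro (⟨h, h'⟩ | ⟨h, h'⟩)
        · exact hkl (h.symm.trans h')
        · exact hkl (h'.symm.trans h)
      have h2 : ¬ ((q = k ∧ q = m) ∨ (q = m ∧ q = k)) := by
        rintro (⟨h, h'⟩ | ⟨h, h'⟩)
        · exact hkm (h.symm.trans h')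
        · exact hkm (h'.symm.trans h)
      simp only [zgen, if_neg h1, if_neg h2, sub_zero]
    rw [hd]; simp [zgen, hpk, hpl, hpm]

/-- ★ hence every row located at a coordinate face avoiding `k,l,m` is BLIND to the generator `E^s_kl − E^s_km`. -/
theorem located_blind_zgen {S S' : Finset (Fin n)} (hSS : Disjoint S S') {W : Matrix (Fin n) (Fin n) ℝ}
    (hW : LocatedAt S S' W) {k l m : Fin n} (hk : k ∉ S ∪ S') (hl : l ∉ S ∪ S') (hm : m ∉ S ∪ S')
    (hkl : k ≠ l) (hkm : k ≠ m) : flat W ⬝ᵥ flat (zgen k l m) = 0 :=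
  located_dot_private hSS hW (zgen_private hk hl hm hkl hkm)

end Obstruction

/-! ## §4e ★ The law of record after N22: C⁺_exact = `ExactPencilLaw` — its body holds on every class decided above

crit-9 N22 (23:07:41Z): the BOX-rhs located law C⁺_entry = `LocatedPencilLaw` is FALSE on the diagonal permutahedron; the
repaired statement of record is 38 g2's `ExactPencilLaw := exactTilted.Law` (rows `udRow a + flat W ≤ 1 + h_COR(W)` with the
EXACT support value).  We restate 38's `hCOR` / `exactTilted` / `ExactPencilLaw` VERBATIM (Cruxes modules are unbuilt on the
farm) and prove that every pinned row IS an exact row (`flat ∘ unflat = id`, `h_COR(unflat w) = ⟨w, x_S⟩` for a direction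
maximised at `x_S`), whence the RESTRICTION PRINCIPLE `exact_body_of_pinned_body`: at any passenger and size, the body of the
`pinnedRows`-law implies the body of the `exactTilted`-law (a nonnegative factorization of the exact family's augmented slack
restricts to the pinned sub-family, with the same row maxima).  Consequences, by name, in the law-of-record currency:
★★★ `exactTilted_law_on_pinExposed`, ★★★ `exactTilted_law_holds_on_qOff` (the member that killed C⁺_diag),
★★★ `exactTilted_law_holds_on_qPerm` (the member that killed C⁺_entry), ★★★ `exactTilted_law_on_columnCoupled` (N20's class,
via the family-agnostic column-tilt block with `h_COR(colTilt) = 0`). -/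

section ExactCurrency
variable {n : ℕ}

/-- (verbatim 38 g2 `ExactPencil38.hCOR`) the EXACT support value `h_COR(W) = max_b ⟨flat W, 𝟙_b𝟙_bᵀ⟩`. -/
noncomputable def hCOR (W : Matrix (Fin n) (Fin n) ℝ) : ℝ :=
  Finset.univ.sup' Finset.univ_nonempty (fun b : Finset (Fin n) => flat W ⬝ᵥ udPt b)

theorem le_hCOR (W : Matrix (Fin n) (Fin n) ℝ) (b : Finset (Fin n)) : flat W ⬝ᵥ udPt b ≤ hCOR W :=
  Finset.le_sup' (fun b : Finset (Fin n) => flat W ⬝ᵥ udPt b) (Finset.mem_univ b)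

theorem exists_eq_hCOR (W : Matrix (Fin n) (Fin n) ℝ) : ∃ b : Finset (Fin n), flat W ⬝ᵥ udPt b = hCOR W := by
  obtain ⟨b, -, hb⟩ := Finset.exists_mem_eq_sup' Finset.univ_nonempty
    (fun b : Finset (Fin n) => flat W ⬝ᵥ udPt b)
  exact ⟨b, hb.symm⟩

/-- (verbatim 38 g2) validity of the exact row `flat W ≤ h_COR(W)` on `COR(n)`. -/
theorem flat_le_hCOR (W : Matrix (Fin n) (Fin n) ℝ) : ∀ x ∈ corPolytope n, flat W ⬝ᵥ x ≤ hCOR W := by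
  classical
  intro y hy
  refine flat_dotProduct_le_of_mem_corPolytope hy ⟨(W, hCOR W), fun x hx => ?_⟩
  let b : Finset (Fin n) := Finset.univ.filter (fun i => x i = 1)
  have hxb : udInd b = x := by
    funext i
    rw [udInd_apply]
    rcases hx i with h | h
    · have : i ∉ b := by simp [b, h]
      rw [if_neg this, h]
    · have : i ∈ b := by simp [b, h]
      rw [if_pos this, h]
  have key : flat W ⬝ᵥ udPt b = ∑ i, ∑ j, W i j * (x i * x j) := by
    show flat W ⬝ᵥ vecOuter n (udInd b) = _
    rw [flat_dotProduct_vecOuter, hxb]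
  have := le_hCOR W b
  rw [key] at this
  exact this

/-- `h_COR(W) ≤ Σ max(W_im, 0)` (verbatim 38 g2): the exact rhs is tighter than the box rhs. -/
theorem hCOR_le_box (W : Matrix (Fin n) (Fin n) ℝ) : hCOR W ≤ ∑ i, ∑ m, max (W i m) 0 := by
  obtain ⟨b, hb⟩ := exists_eq_hCOR W
  rw [← hb]
  exact flat_le_box W _ ((ud_data n).1 b)

/-- ★ (verbatim 38 g2 `ExactPencil38.exactTilted`) the EXACTLY TILTED clique rows `udRow a + flat W ≤ 1 + h_COR(W)`. -/
@[reducible] noncomputable def exactTilted : RowFamily where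
  A := fun n => Finset (Fin n) × Matrix (Fin n) (Fin n) ℝ
  ρ := fun _ a => udRow a.1 + flat a.2
  β := fun _ a => 1 + hCOR a.2
  valid := fun n a x hx => by
    rw [add_dotProduct]
    exact add_le_add ((ud_data n).2.1 a.1 x hx) (flat_le_hCOR a.2 x hx)

/-- ★ (verbatim 38 g2) `ExactPencilLaw := exactTilted.Law` — C⁺_exact, the law of record after N22. -/
def ExactPencilLaw : Prop := exactTilted.Law

/-- `exactTilted ↪ allRows`, hence `ExactPencilLaw → COR-VIRTUAL`. -/
noncomputable def exactTilted_emb_allRows : RowFamily.Emb exactTilted allRows where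
  φ := fun n a => ⟨(exactTilted.ρ n a, exactTilted.β n a), exactTilted.valid n a⟩
  ρ_eq := fun _ _ => rfl
  β_eq := fun _ _ => rfl

theorem corVirtualHardN_of_exactPencilLaw (h : ExactPencilLaw) : CorVirtualHardN :=
  corVirtualHardN_of_law allRows (RowFamily.Law.mono exactTilted_emb_allRows h)

/-- un-flattening a vector of `ℝ^{n²}` to a matrix. -/
def unflat (w : Fin (n * n) → ℝ) : Matrix (Fin n) (Fin n) ℝ := fun i j => w (finProdFinEquiv (i, j))

@[simp] theorem flat_unflat (w : Fin (n * n) → ℝ) : flat (unflat w) = w := by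
  funext p
  show w (finProdFinEquiv ((finProdFinEquiv.symm p).1, (finProdFinEquiv.symm p).2)) = w p
  rw [Prod.mk.eta, Equiv.apply_symm_apply]

/-- a direction maximised over `COR(n)` at the vertex `x_S` has exact support value `⟨w, x_S⟩`. -/
theorem hCOR_unflat_of_pinned {w : Fin (n * n) → ℝ} {S : Finset (Fin n)}
    (h : ∀ x ∈ corPolytope n, w ⬝ᵥ x ≤ w ⬝ᵥ udPt S) : hCOR (unflat w) = w ⬝ᵥ udPt S := by
  refine le_antisymm ?_ ?_
  · refine Finset.sup'_le _ _ fun b _ => ?_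
    rw [flat_unflat]
    exact h _ ((ud_data n).1 b)
  · have := le_hCOR (unflat w) S
    rwa [flat_unflat] at this

/-- ★ every PINNED row is an EXACT row: `(a, (w, S)) ↦ (a, unflat w)` preserves functional and right-hand side. -/
noncomputable def pinnedRows_emb_exactTilted : RowFamily.Emb pinnedRows exactTilted where
  φ := fun _ a => (a.1, unflat a.2.1.1)
  ρ_eq := fun _ a => by
    show udRow a.1 + flat (unflat a.2.1.1) = udRow a.1 + a.2.1.1
    rw [flat_unflat]
  β_eq := fun _ a => by
    show 1 + hCOR (unflat a.2.1.1) = 1 + a.2.1.1 ⬝ᵥ udPt a.2.1.2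
    rw [hCOR_unflat_of_pinned a.2.2]

/-- hence `pinnedRows.Law → ExactPencilLaw` (C⁺_loc ⟹ C⁺_exact: the sub-family's law is the stronger statement) … -/
theorem exactPencilLaw_of_pinnedRowsLaw (h : pinnedRows.Law) : ExactPencilLaw :=
  RowFamily.Law.mono pinnedRows_emb_exactTilted h

/-- ★ … and, pointwise, THE RESTRICTION PRINCIPLE: at any passenger `q` and size `r`, if the body of the `pinnedRows`-law
yields `C`, then so does the body of the `exactTilted`-law (restrict the exact family's data along the embedding). -/
theorem exact_body_of_pinned_body {K r : ℕ} (q : Fin (K + 1) → (Fin (n * n) → ℝ)) {C : Prop}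
    (hbody : ∀ mm : pinnedRows.A n → ℝ, (∀ a j, pinnedRows.ρ n a ⬝ᵥ q j ≤ mm a) →
      (∀ a, ∃ j, pinnedRows.ρ n a ⬝ᵥ q j = mm a) →
      ∀ (U : pinnedRows.A n → Option (Fin r) → ℝ) (V : Finset (Fin n) × Fin (K + 1) → Option (Fin r) → ℝ),
        (∀ a i, 0 ≤ U a i) → (∀ p i, 0 ≤ V p i) →
        (∀ a b j, (pinnedRows.β n a + mm a) - pinnedRows.ρ n a ⬝ᵥ (udPt b + q j) = ∑ i, U a i * V (b, j) i) → C) :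
    ∀ mm : exactTilted.A n → ℝ, (∀ a j, exactTilted.ρ n a ⬝ᵥ q j ≤ mm a) →
      (∀ a, ∃ j, exactTilted.ρ n a ⬝ᵥ q j = mm a) →
      ∀ (U : exactTilted.A n → Option (Fin r) → ℝ) (V : Finset (Fin n) × Fin (K + 1) → Option (Fin r) → ℝ),
        (∀ a i, 0 ≤ U a i) → (∀ p i, 0 ≤ V p i) →
        (∀ a b j, (exactTilted.β n a + mm a) - exactTilted.ρ n a ⬝ᵥ (udPt b + q j) = ∑ i, U a i * V (b, j) i) → C := by
  intro mm hle hat U V hU hV hfac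
  let φ := pinnedRows_emb_exactTilted.φ n
  have hρ : ∀ a, exactTilted.ρ n (φ a) = pinnedRows.ρ n a := pinnedRows_emb_exactTilted.ρ_eq n
  have hβ : ∀ a, exactTilted.β n (φ a) = pinnedRows.β n a := pinnedRows_emb_exactTilted.β_eq n
  refine hbody (fun a => mm (φ a)) (fun a j => ?_) (fun a => ?_) (fun a => U (φ a)) V (fun a i => hU _ i) hV
    (fun a b j => ?_)
  · rw [← hρ]; exact hle (φ a) j
  · obtain ⟨j, hj⟩ := hat (φ a)
    exact ⟨j, by rw [← hρ]; exact hj⟩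
  · rw [← hρ, ← hβ]; exact hfac (φ a) b j

/-- ★★★ **`ExactPencilLaw`'s body HOLDS ON EVERY PIN-EXPOSED PASSENGER** (literal `T c n < r`). -/
theorem exactTilted_law_on_pinExposed : ∀ c : ℕ, ∃ n₀ : ℕ, ∀ n ≥ n₀,
    ∀ (K : ℕ) (q : Fin (K + 1) → (Fin (n * n) → ℝ)) (r : ℕ), PinExposed n K q →
    HasEFOfSize (convexHull ℝ (Set.range q)) r →
    ∀ mm : exactTilted.A n → ℝ, (∀ a j, exactTilted.ρ n a ⬝ᵥ q j ≤ mm a) →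
      (∀ a, ∃ j, exactTilted.ρ n a ⬝ᵥ q j = mm a) →
    ∀ (U : exactTilted.A n → Option (Fin r) → ℝ) (V : Finset (Fin n) × Fin (K + 1) → Option (Fin r) → ℝ),
      (∀ a i, 0 ≤ U a i) → (∀ p i, 0 ≤ V p i) →
      (∀ a b j, (exactTilted.β n a + mm a) - exactTilted.ρ n a ⬝ᵥ (udPt b + q j) = ∑ i, U a i * V (b, j) i) →
      T c n < r := by
  intro c
  obtain ⟨n₀, hn₀⟩ := pinnedRows_law_on_pinExposed c
  refine ⟨n₀, fun n hn K q r hpin hq => ?_⟩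
  exact exact_body_of_pinned_body q (hn₀ n hn K q r hpin hq)

/-- ★★★ **`ExactPencilLaw`'s body HOLDS ON THE ZERO-DIAGONAL CUBE `Q∘`** (the member that refuted C⁺_diag, ✓ p674104). -/
theorem exactTilted_law_holds_on_qOff : ∀ c : ℕ, ∃ n₀ : ℕ, ∀ n ≥ n₀,
    ∀ (K : ℕ) (e : Fin (K + 1) ≃ Finset (Fin n)) (r : ℕ),
    HasEFOfSize (convexHull ℝ (Set.range (qOff ∘ e))) r →
    ∀ mm : exactTilted.A n → ℝ, (∀ a j, exactTilted.ρ n a ⬝ᵥ (qOff ∘ e) j ≤ mm a) →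
      (∀ a, ∃ j, exactTilted.ρ n a ⬝ᵥ (qOff ∘ e) j = mm a) →
    ∀ (U : exactTilted.A n → Option (Fin r) → ℝ) (V : Finset (Fin n) × Fin (K + 1) → Option (Fin r) → ℝ),
      (∀ a i, 0 ≤ U a i) → (∀ p i, 0 ≤ V p i) →
      (∀ a b j, (exactTilted.β n a + mm a) - exactTilted.ρ n a ⬝ᵥ (udPt b + (qOff ∘ e) j) = ∑ i, U a i * V (b, j) i) →
      T c n < r := by
  intro c
  obtain ⟨n₀, hn₀⟩ := pinnedRows_law_holds_on_qOff c
  refine ⟨n₀, fun n hn K e r hq => ?_⟩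
  exact exact_body_of_pinned_body (qOff ∘ e) (hn₀ n hn K e r hq)

/-- ★★★ **`ExactPencilLaw`'s body HOLDS ON THE DIAGONAL PERMUTAHEDRON `Q^Π_λ`** (the member that refuted C⁺_entry, N22):
the repaired statement of record MISSES the witness, in kernel. -/
theorem exactTilted_law_holds_on_qPerm : ∀ c : ℕ, ∃ n₀ : ℕ, ∀ n ≥ n₀,
    ∀ (K : ℕ) (lam : ℝ) (e : Fin (K + 1) → Equiv.Perm (Fin n)) (r : ℕ), 0 ≤ lam → (∃ j, e j = Fin.revPerm) →
    HasEFOfSize (convexHull ℝ (Set.range (qPerm n lam ∘ e))) r →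
    ∀ mm : exactTilted.A n → ℝ, (∀ a j, exactTilted.ρ n a ⬝ᵥ (qPerm n lam ∘ e) j ≤ mm a) →
      (∀ a, ∃ j, exactTilted.ρ n a ⬝ᵥ (qPerm n lam ∘ e) j = mm a) →
    ∀ (U : exactTilted.A n → Option (Fin r) → ℝ) (V : Finset (Fin n) × Fin (K + 1) → Option (Fin r) → ℝ),
      (∀ a i, 0 ≤ U a i) → (∀ p i, 0 ≤ V p i) →
      (∀ a b j, (exactTilted.β n a + mm a) - exactTilted.ρ n a ⬝ᵥ (udPt b + (qPerm n lam ∘ e) j)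
        = ∑ i, U a i * V (b, j) i) →
      T c n < r := by
  intro c
  obtain ⟨n₀, hn₀⟩ := pinnedRows_law_holds_on_qPerm c
  refine ⟨n₀, fun n hn K lam e r hlam hj hq => ?_⟩
  exact exact_body_of_pinned_body (qPerm n lam ∘ e) (hn₀ n hn K lam e r hlam hj hq)

/-- the exact support value of a nonpositive column tilt is `0` (attained at `b = ∅`). -/
theorem hCOR_colTilt (x₀ : Fin n) (M : Fin n → ℝ) (hM : ∀ l, 0 ≤ M l) : hCOR (colTilt x₀ M) = 0 := by
  refine le_antisymm ?_ ?_
  · have := hCOR_le_box (colTilt x₀ M)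
    rwa [box_colTilt x₀ M hM] at this
  · have := le_hCOR (colTilt x₀ M) ∅
    rwa [colTilt_dotProduct_udPt x₀ M (Finset.notMem_empty x₀)] at this

/-- ★★★ **`ExactPencilLaw`'s body HOLDS ON COLUMN-COUPLED AFFINE CUBES** (N20's class in the law-of-record currency). -/
theorem exactTilted_law_on_columnCoupled : ∀ c : ℕ, ∃ n₀ : ℕ, ∀ n ≥ n₀,
    ∀ (N K : ℕ) (Q₀ : Matrix (Fin n) (Fin n) ℝ) (G : Fin N → Matrix (Fin n) (Fin n) ℝ)
      (e : Fin (K + 1) → Finset (Fin N)) (r : ℕ), Function.Surjective e → ColumnCoupled G →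
    HasEFOfSize (convexHull ℝ (Set.range (cubePt Q₀ G ∘ e))) r →
    ∀ mm : exactTilted.A n → ℝ, (∀ a j, exactTilted.ρ n a ⬝ᵥ (cubePt Q₀ G ∘ e) j ≤ mm a) →
      (∀ a, ∃ j, exactTilted.ρ n a ⬝ᵥ (cubePt Q₀ G ∘ e) j = mm a) →
    ∀ (U : exactTilted.A n → Option (Fin r) → ℝ) (V : Finset (Fin n) × Fin (K + 1) → Option (Fin r) → ℝ),
      (∀ a i, 0 ≤ U a i) → (∀ p i, 0 ≤ V p i) →
      (∀ a b j, (exactTilted.β n a + mm a) - exactTilted.ρ n a ⬝ᵥ (udPt b + (cubePt Q₀ G ∘ e) j)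
        = ∑ i, U a i * V (b, j) i) →
      T c n < r := by
  intro c
  obtain ⟨n₀, hn₀⟩ := T_lt_of_block' c
  refine ⟨max n₀ 2, fun n hn N K Q₀ G e r he hcc _ mm hle hat U V hU hV hfac => ?_⟩
  obtain ⟨x₀, M0, hM, hs⟩ := hcc
  have h2 : 2 ≤ n := le_of_max_le_right hn
  refine hn₀ n (le_of_max_le_left hn) (n - 1) r (by omega)
    (columnTilt_block_family exactTilted Q₀ G x₀ M0 hs e he
      (fun a => (a, colTilt x₀ fun l => colStrength G a * M0 l)) (fun a => rfl) (fun a => ?_) mm hle hat U V hU hV hfac)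
  show 1 + hCOR (colTilt x₀ fun l => colStrength G a * M0 l) = 1
  rw [hCOR_colTilt x₀ _ (fun l => mul_nonneg (colStrength_pos G a).le (hM l)), add_zero]

/-- ★ SUMMARY OF THE SEAT IN ONE IMPLICATION CHAIN (laws, strongest first): `pinnedRows.Law → ExactPencilLaw → allRows.Law
→ COR-VIRTUAL`; the bodies of the first two hold (pointwise, in kernel) on `Q∘`, on `Q^Π_λ`, on every pin-exposed passenger
and on every column-coupled affine cube — none of the recorded enemies of C⁺_clique / C⁺_diag / C⁺_entry touches them. -/
theorem exact_law_chain :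
    (pinnedRows.Law → ExactPencilLaw) ∧ (ExactPencilLaw → allRows.Law) ∧ (allRows.Law → CorVirtualHardN) :=
  ⟨exactPencilLaw_of_pinnedRowsLaw, fun h => RowFamily.Law.mono exactTilted_emb_allRows h,
    fun h => corVirtualHardN_of_law allRows h⟩

end ExactCurrency

section Ceiling
variable {n : ℕ}

/-! ## §5b ★ The ceiling of the pin method, typed: no PIN-EXPOSURE on a cube carrying `U`-internal `Z_mix` generators

The obstruction of §5 made into a NO-GO for the CLASS of §4b (hence for every certificate of this file at coordinate faces,
in either currency): if an affine-cube passenger carries, inside the complement of EVERY admissible pin set `S`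
(`2|S| ≤ n`), a zero-diagonal generator `E^s_{kl} − E^s_{km}` (`k,l,m ∉ S` distinct), then it is NOT pin-exposed.  Mechanism:
(i) a direction `w` tight on the whole face `{b ⊇ S}` has vanishing symmetrised off-diagonal entries inside `U = Sᶜ`
(mixed second differences of `b ↦ ⟨w, x_b⟩` along the face), so `⟨w, E^s_{kl} − E^s_{km}⟩ = 0` (`tight_dot_zgen`);
(ii) the clique parts of the two admissible rows `a = {k,m}` and `a = {k,l}` see the generator with OPPOSITE signs `±2`
(`udRow_pair_dot_zgen_pos/neg`); (iii) on a cube a common maximiser `P⋆` must contain every generator some row sees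
positively and omit every generator some row sees negatively (`dotProduct_cubePt`) — contradiction.  In particular the
all-triples zero-diagonal cube (`Z_mix`-type passengers) is outside `PinExposed` for `n ≥ 6`: the enemy specification for
C⁺_exact handed to W6-R1 is now a theorem about this seat's method, not a remark. -/

/-- `Σ_j f_j · 𝟙_b(j) = Σ_{j ∈ b} f_j`. -/
theorem sum_mul_udInd (f : Fin n → ℝ) (b : Finset (Fin n)) : ∑ j, f j * udInd b j = ∑ j ∈ b, f j := by
  classical
  simp only [udInd_apply, mul_ite, mul_one, mul_zero]
  rw [Finset.sum_ite_mem, Finset.univ_inter]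

/-- `⟨flat C, x_b x_bᵀ⟩ = Σ_{p,q ∈ b} C_{pq}`. -/
theorem flat_dotProduct_udPt_eq (C : Matrix (Fin n) (Fin n) ℝ) (b : Finset (Fin n)) :
    flat C ⬝ᵥ udPt b = ∑ p ∈ b, ∑ q ∈ b, C p q := by
  rw [show udPt b = vecOuter n (udInd b) from rfl, flat_dotProduct_vecOuter]
  have h1 : ∀ p, ∑ q, C p q * (udInd b p * udInd b q) = (∑ q ∈ b, C p q) * udInd b p := fun p => by
    rw [← sum_mul_udInd (fun q => C p q) b, Finset.sum_mul]
    exact Finset.sum_congr rfl fun q _ => by ring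
  simp_rw [h1]
  exact sum_mul_udInd (fun p => ∑ q ∈ b, C p q) b

/-- `flat (A − B) = flat A − flat B`. -/
theorem flat_sub' (A B : Matrix (Fin n) (Fin n) ℝ) : flat (A - B) = flat A - flat B := by
  funext p; simp [flat, Matrix.sub_apply]

/-- `⟨flat C, E_{kl} + E_{lk}⟩ = C_{kl} + C_{lk}` (through `pv k l = x_{kl} − x_k − x_l`). -/
theorem flat_dotProduct_pv (C : Matrix (Fin n) (Fin n) ℝ) {k l : Fin n} (hkl : k ≠ l) :
    flat C ⬝ᵥ pv k l = C k l + C l k := by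
  rw [pv, dotProduct_sub, dotProduct_sub, flat_dotProduct_udPt_eq, flat_dotProduct_udPt_eq, flat_dotProduct_udPt_eq]
  simp only [Finset.sum_pair hkl, Finset.sum_singleton]
  ring

/-- `⟨flat C, E^s_{kl} − E^s_{km}⟩ = (C_{kl} + C_{lk}) − (C_{km} + C_{mk})`. -/
theorem flat_dotProduct_flat_zgen (C : Matrix (Fin n) (Fin n) ℝ) {k l m : Fin n} (hkl : k ≠ l) (hkm : k ≠ m) :
    flat C ⬝ᵥ flat (zgen k l m) = (C k l + C l k) - (C k m + C m k) := by
  rw [show zgen k l m = pairMat k l 1 - pairMat k m 1 from rfl, flat_sub', flat_pairMat hkl, flat_pairMat hkm, one_smul,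
    one_smul, dotProduct_sub, flat_dotProduct_pv C hkl, flat_dotProduct_pv C hkm]

/-- the MIXED SECOND DIFFERENCE of `b ↦ Σ_{p,q∈b} C_{pq}` along `k, l ∉ S` is the symmetrised entry `C_{kl} + C_{lk}`. -/
theorem mixed_diff (C : Matrix (Fin n) (Fin n) ℝ) {S : Finset (Fin n)} {k l : Fin n} (hk : k ∉ S) (hl : l ∉ S)
    (hkl : k ≠ l) :
    (∑ p ∈ insert k (insert l S), ∑ q ∈ insert k (insert l S), C p q) - (∑ p ∈ insert k S, ∑ q ∈ insert k S, C p q)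
      - (∑ p ∈ insert l S, ∑ q ∈ insert l S, C p q) + (∑ p ∈ S, ∑ q ∈ S, C p q) = C k l + C l k := by
  classical
  have hk' : k ∉ insert l S := by simp [hkl, hk]
  simp only [Finset.sum_insert hk', Finset.sum_insert hk, Finset.sum_insert hl, Finset.sum_add_distrib]
  ring

/-- ★ (i) a direction tight on the whole face `{b ⊇ S}` does not see the `U`-internal zero-diagonal generators. -/
theorem tight_dot_zgen {S : Finset (Fin n)} {w : Fin (n * n) → ℝ}
    (htight : ∀ b : Finset (Fin n), S ⊆ b → w ⬝ᵥ udPt b = w ⬝ᵥ udPt S)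
    {k l m : Fin n} (hk : k ∉ S) (hl : l ∉ S) (hm : m ∉ S) (hkl : k ≠ l) (hkm : k ≠ m) :
    w ⬝ᵥ flat (zgen k l m) = 0 := by
  classical
  have hval : ∀ b : Finset (Fin n), S ⊆ b → ∑ p ∈ b, ∑ q ∈ b, unflat w p q = ∑ p ∈ S, ∑ q ∈ S, unflat w p q := by
    intro b hb
    rw [← flat_dotProduct_udPt_eq, ← flat_dotProduct_udPt_eq, flat_unflat]
    exact htight b hb
  have hsub : ∀ x : Fin n, S ⊆ insert x S := fun x => Finset.subset_insert x S
  have hsym : ∀ {x : Fin n}, x ∉ S → k ≠ x → unflat w k x + unflat w x k = 0 := by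
    intro x hx hkx
    rw [← mixed_diff (unflat w) hk hx hkx, hval _ ((hsub x).trans (Finset.subset_insert k _)), hval _ (hsub k),
      hval _ (hsub x)]
    ring
  rw [← flat_unflat w, flat_dotProduct_flat_zgen _ hkl hkm, hsym hl hkl, hsym hm hkm, sub_self]

/-- (ii) the clique part of the row `a = {k, m}` sees `E^s_{kl} − E^s_{km}` with coefficient `+2` … -/
theorem udRow_pair_dot_zgen_pos {k l m : Fin n} (hkl : k ≠ l) (hkm : k ≠ m) (hlm : l ≠ m) :
    udRow {k, m} ⬝ᵥ flat (zgen k l m) = 2 := by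
  classical
  rw [show udRow {k, m} = flat (udMat {k, m}) from rfl, flat_dotProduct_flat_zgen _ hkl hkm]
  simp [udMat, udInd_apply, hkl, hkl.symm, hkm, hkm.symm, hlm]
  norm_num

/-- … and the clique part of the row `a = {k, l}` sees it with coefficient `−2`. -/
theorem udRow_pair_dot_zgen_neg {k l m : Fin n} (hkl : k ≠ l) (hkm : k ≠ m) (hlm : l ≠ m) :
    udRow {k, l} ⬝ᵥ flat (zgen k l m) = -2 := by
  classical
  rw [show udRow {k, l} = flat (udMat {k, l}) from rfl, flat_dotProduct_flat_zgen _ hkl hkm]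
  simp [udMat, udInd_apply, hkl, hkl.symm, hkm, hkm.symm, hlm.symm]
  norm_num

/-- ★★ **NO PIN-EXPOSURE ON A CUBE WITH `U`-INTERNAL ZERO-DIAGONAL GENERATORS** (the ceiling of §4b's class, typed): if for
every admissible pin set `S` some generator of the cube is `E^s_{kl} − E^s_{km}` with `k, l, m ∉ S` distinct, the passenger
(listed surjectively) is not `PinExposed`. -/
theorem not_pinExposed_of_zgen {N K : ℕ} (Q₀ : Matrix (Fin n) (Fin n) ℝ) (G : Fin N → Matrix (Fin n) (Fin n) ℝ)
    (e : Fin (K + 1) → Finset (Fin N)) (he : Function.Surjective e)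
    (hgen : ∀ S : Finset (Fin n), 2 * S.card ≤ n →
      ∃ (t : Fin N) (k l m : Fin n), k ∉ S ∧ l ∉ S ∧ m ∉ S ∧ k ≠ l ∧ k ≠ m ∧ l ≠ m ∧ G t = zgen k l m) :
    ¬ PinExposed n K (cubePt Q₀ G ∘ e) := by
  classical
  rintro ⟨S, w, jstar, hS, -, htight, hmax⟩
  obtain ⟨t, k, l, m, hk, hl, hm, hkl, hkm, hlm, hG⟩ := hgen S hS
  have hw0 : w ⬝ᵥ flat (G t) = 0 := by rw [hG]; exact tight_dot_zgen htight hk hl hm hkl hkm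
  have hrow : ∀ a : Finset (Fin n), (udRow a + w) ⬝ᵥ flat (G t) = udRow a ⬝ᵥ flat (zgen k l m) := fun a => by
    rw [add_dotProduct, hw0, add_zero, hG]
  have hsub : ∀ {x y : Fin n}, x ∉ S → y ∉ S → ({x, y} : Finset (Fin n)) ⊆ Sᶜ := by
    intro x y hx hy z hz
    rw [Finset.mem_compl]
    rcases Finset.mem_insert.1 hz with rfl | hz
    · exact hx
    · rw [Finset.mem_singleton] at hz; subst hz; exact hy
  -- value of a row at a cube vertex, split at the generator `t`
  have hval : ∀ (ρ : Fin (n * n) → ℝ) (P : Finset (Fin N)), t ∉ P →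
      ρ ⬝ᵥ cubePt Q₀ G (insert t P) = ρ ⬝ᵥ cubePt Q₀ G P + ρ ⬝ᵥ flat (G t) := fun ρ P ht => by
    rw [dotProduct_cubePt, dotProduct_cubePt, Finset.sum_insert ht]
    ring
  by_cases ht : t ∈ e jstar
  · -- the row `{k,l}` (coefficient −2) improves by dropping `t`
    obtain ⟨j', hj'⟩ := he ((e jstar).erase t)
    have h1 := hmax {k, l} (hsub hk hl) j'
    simp only [Function.comp_apply, hj'] at h1
    have h2 := hval (udRow {k, l} + w) ((e jstar).erase t) (Finset.notMem_erase t _)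
    rw [Finset.insert_erase ht, hrow, udRow_pair_dot_zgen_neg hkl hkm hlm] at h2
    linarith
  · -- the row `{k,m}` (coefficient +2) improves by adding `t`
    obtain ⟨j', hj'⟩ := he (insert t (e jstar))
    have h1 := hmax {k, m} (hsub hk hm) j'
    simp only [Function.comp_apply, hj'] at h1
    have h2 := hval (udRow {k, m} + w) (e jstar) ht
    rw [hrow, udRow_pair_dot_zgen_pos hkl hkm hlm] at h2
    linarith

/-- ★★ COROLLARY (`Z_mix`-type passengers): for `n ≥ 6`, an affine cube whose generators include `E^s_{kl} − E^s_{km}` for EVERY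
triple of distinct indices is NOT pin-exposed — every admissible pin set leaves `|Sᶜ| ≥ 3` free indices. -/
theorem not_pinExposed_of_allTriples (hn : 6 ≤ n) {N K : ℕ} (Q₀ : Matrix (Fin n) (Fin n) ℝ)
    (G : Fin N → Matrix (Fin n) (Fin n) ℝ) (e : Fin (K + 1) → Finset (Fin N)) (he : Function.Surjective e)
    (hall : ∀ k l m : Fin n, k ≠ l → k ≠ m → l ≠ m → ∃ t, G t = zgen k l m) :
    ¬ PinExposed n K (cubePt Q₀ G ∘ e) := by
  classical
  refine not_pinExposed_of_zgen Q₀ G e he fun S hS => ?_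
  have hc : 2 < Sᶜ.card := by
    rw [Finset.card_compl, Fintype.card_fin]; omega
  obtain ⟨k, l, m, hk, hl, hm, hkl, hkm, hlm⟩ := Finset.two_lt_card_iff.1 hc
  rw [Finset.mem_compl] at hk hl hm
  obtain ⟨t, ht⟩ := hall k l m hkl hkm hlm
  exact ⟨t, k, l, m, hk, hl, hm, hkl, hkm, hlm, ht⟩

/-! ### §5c ★★ The ceiling of the TEMPLATE, typed: no PURE located block for ANY exact-tilted rows on such a cube

One level above §5b (which concerns ONE common direction `w`): let the rows be `(a, W_a)`, `a ⊆ U`, with an ARBITRARY tilt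
`W_a` per row and the exact rhs `1 + h_COR(W_a)`, let the columns be `(S ∪ b, j_b)`, `b ⊆ U`, with an ARBITRARY listed passenger
index `j_b` per column (`S ∩ U = ∅`), and let `m_a` be any upper bound of row `a` over the listed passenger points.  If the
exact-law slack matrix carries the PURE unique-disjointness pattern `(1 − |a ∩ b|)²` on this block (the hypothesis `hblock` of the
block count `three_pow_le_of_block`, i.e. the template of every certificate in this file), then (`no_pure_block_of_zgen`) the cube
has NO generator `E^s_{kl} − E^s_{km}` with `k, l, m ∈ U`: purity forces, entry by entry, `⟨W_a, x_{S∪b}⟩ = h_COR(W_a)` (so by the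
four-point mixed differences `tight4_dot_zgen` every `W_a` is orthogonal to the `U`-internal generators) and `j_b` to maximise EVERY
row — and then the rows `{k,m}` / `{k,l}` flip as in §5b.  So for `Z_mix`-shape cubes a C′-certificate cannot be a pure located
block at a COORDINATE face: it must use a non-coordinate face of COR (38 g2 `ExactPencil.cor_add_zgenCube_decided`: the
transversal face `ι₁(S) ∪ ι₂(Sᶜ)` works, with one common direction) or count junk-tolerantly. -/

/-- (i′) FOUR-POINT version of `tight_dot_zgen`: tightness of `w` at `S`, `S+k`, `S+l`, `S+m`, `S+k+l`, `S+k+m` already kills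
`⟨w, E^s_{kl} − E^s_{km}⟩`. -/
theorem tight4_dot_zgen {S : Finset (Fin n)} {w : Fin (n * n) → ℝ} {k l m : Fin n}
    (hk : k ∉ S) (hl : l ∉ S) (hm : m ∉ S) (hkl : k ≠ l) (hkm : k ≠ m)
    (hK : w ⬝ᵥ udPt (insert k S) = w ⬝ᵥ udPt S) (hL : w ⬝ᵥ udPt (insert l S) = w ⬝ᵥ udPt S)
    (hM : w ⬝ᵥ udPt (insert m S) = w ⬝ᵥ udPt S)
    (hKL : w ⬝ᵥ udPt (insert k (insert l S)) = w ⬝ᵥ udPt S)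
    (hKM : w ⬝ᵥ udPt (insert k (insert m S)) = w ⬝ᵥ udPt S) :
    w ⬝ᵥ flat (zgen k l m) = 0 := by
  classical
  have hval : ∀ b : Finset (Fin n), w ⬝ᵥ udPt b = ∑ p ∈ b, ∑ q ∈ b, unflat w p q := fun b => by
    rw [← flat_dotProduct_udPt_eq, flat_unflat]
  simp only [hval] at hK hL hM hKL hKM
  have h1 := mixed_diff (unflat w) hk hl hkl
  have h2 := mixed_diff (unflat w) hk hm hkm
  rw [hKL, hK, hL] at h1
  rw [hKM, hK, hM] at h2
  rw [← flat_unflat w, flat_dotProduct_flat_zgen _ hkl hkm]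
  linarith

/-- ★★ **NO PURE LOCATED BLOCK ON A CUBE WITH A `U`-INTERNAL ZERO-DIAGONAL GENERATOR — for ANY exact-tilted rows.**  Rows
`(a, W a)` (`a ⊆ U`, arbitrary tilts, exact rhs `1 + h_COR(W a)`), columns `(S ∪ b, jc b)` (`b ⊆ U`, arbitrary listed passenger index
per column), `Disjoint S U`, `mrow a` any upper bound of row `a` on the listed cube vertices (`e` surjective): the exact-law slack
`(1 + h_COR(W a) + mrow a) − ⟨udRow a + W a, x_{S∪b} + q_{jc b}⟩` is NOT the pure pattern `(1 − |a∩b|)²` on the block, as soon as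
some generator is `E^s_{kl} − E^s_{km}` with `k, l, m ∈ U` distinct. -/
theorem no_pure_block_of_zgen {N K : ℕ} (Q₀ : Matrix (Fin n) (Fin n) ℝ) (G : Fin N → Matrix (Fin n) (Fin n) ℝ)
    (e : Fin (K + 1) → Finset (Fin N)) (he : Function.Surjective e) (S U : Finset (Fin n)) (hSU : Disjoint S U)
    {t : Fin N} {k l m : Fin n} (hk : k ∈ U) (hl : l ∈ U) (hm : m ∈ U) (hkl : k ≠ l) (hkm : k ≠ m) (hlm : l ≠ m)
    (hG : G t = zgen k l m)
    (W : Finset (Fin n) → Matrix (Fin n) (Fin n) ℝ) (jc : Finset (Fin n) → Fin (K + 1)) (mrow : Finset (Fin n) → ℝ)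
    (hmq : ∀ a j, (udRow a + flat (W a)) ⬝ᵥ cubePt Q₀ G (e j) ≤ mrow a) :
    ¬ ∀ a, a ⊆ U → ∀ b, b ⊆ U →
        (1 + hCOR (W a) + mrow a) - (udRow a + flat (W a)) ⬝ᵥ (udPt (S ∪ b) + cubePt Q₀ G (e (jc b)))
          = (1 - ((a ∩ b).card : ℝ)) ^ 2 := by
  classical
  intro hblock
  obtain ⟨-, -, slack, -⟩ := ud_data n
  have notS : ∀ {x : Fin n}, x ∈ U → x ∉ S := fun hx h => Finset.disjoint_left.1 hSU h hx
  -- purity ⇒ both nonnegative junk terms vanish entrywise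
  have hdec : ∀ a, a ⊆ U → ∀ b, b ⊆ U →
      flat (W a) ⬝ᵥ udPt (S ∪ b) = hCOR (W a) ∧ (udRow a + flat (W a)) ⬝ᵥ cubePt Q₀ G (e (jc b)) = mrow a := by
    intro a ha b hb
    have h := hblock a ha b hb
    have hab : a ∩ (S ∪ b) = a ∩ b := by
      ext x
      simp only [Finset.mem_inter, Finset.mem_union]
      constructor
      · rintro ⟨hx, hx' | hx'⟩
        · exact absurd hx' (notS (ha hx))
        · exact ⟨hx, hx'⟩
      · rintro ⟨hx, hx'⟩
        exact ⟨hx, Or.inr hx'⟩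
    have hs := slack a (S ∪ b)
    rw [hab] at hs
    have hA := le_hCOR (W a) (S ∪ b)
    have hJ := hmq a (jc b)
    rw [dotProduct_add, add_dotProduct (udRow a) (flat (W a)) (udPt (S ∪ b))] at h
    constructor <;> linarith
  -- every row's tilt is tight at the four/five points ⇒ orthogonal to the generator
  have pairU : ∀ {x y : Fin n}, x ∈ U → y ∈ U → ({x, y} : Finset (Fin n)) ⊆ U := fun hx hy =>
    Finset.insert_subset_iff.2 ⟨hx, Finset.singleton_subset_iff.2 hy⟩
  have singU : ∀ {x : Fin n}, x ∈ U → ({x} : Finset (Fin n)) ⊆ U := fun hx => Finset.singleton_subset_iff.2 hx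
  have hS1 : ∀ x : Fin n, S ∪ {x} = insert x S := fun x => by
    ext y; simp only [Finset.mem_union, Finset.mem_singleton, Finset.mem_insert]; tauto
  have hS2 : ∀ x y : Fin n, S ∪ {x, y} = insert x (insert y S) := fun x y => by
    ext z; simp only [Finset.mem_union, Finset.mem_singleton, Finset.mem_insert]; tauto
  have horth : ∀ a, a ⊆ U → flat (W a) ⬝ᵥ flat (G t) = 0 := by
    intro a ha
    have h0 := (hdec a ha ∅ (Finset.empty_subset _)).1
    rw [Finset.union_empty] at h0
    have hT : ∀ b, b ⊆ U → flat (W a) ⬝ᵥ udPt (S ∪ b) = flat (W a) ⬝ᵥ udPt S := fun b hb => by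
      rw [(hdec a ha b hb).1, h0]
    rw [hG]
    refine tight4_dot_zgen (notS hk) (notS hl) (notS hm) hkl hkm ?_ ?_ ?_ ?_ ?_
    · rw [← hS1]; exact hT _ (singU hk)
    · rw [← hS1]; exact hT _ (singU hl)
    · rw [← hS1]; exact hT _ (singU hm)
    · rw [← hS2]; exact hT _ (pairU hk hl)
    · rw [← hS2]; exact hT _ (pairU hk hm)
  have hrow : ∀ a, a ⊆ U → (udRow a + flat (W a)) ⬝ᵥ flat (G t) = udRow a ⬝ᵥ flat (zgen k l m) := fun a ha => by
    rw [add_dotProduct, horth a ha, add_zero, hG]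
  have hval : ∀ (ρ : Fin (n * n) → ℝ) (P : Finset (Fin N)), t ∉ P →
      ρ ⬝ᵥ cubePt Q₀ G (insert t P) = ρ ⬝ᵥ cubePt Q₀ G P + ρ ⬝ᵥ flat (G t) := fun ρ P ht => by
    rw [dotProduct_cubePt, dotProduct_cubePt, Finset.sum_insert ht]
    ring
  -- the common maximiser `P⋆ = e (jc ∅)` of the rows `{k,m}` and `{k,l}` flips
  have hmaxat : ∀ a, a ⊆ U → (udRow a + flat (W a)) ⬝ᵥ cubePt Q₀ G (e (jc ∅)) = mrow a :=
    fun a ha => (hdec a ha ∅ (Finset.empty_subset _)).2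
  by_cases ht : t ∈ e (jc ∅)
  · obtain ⟨j', hj'⟩ := he ((e (jc ∅)).erase t)
    have h1 := hmq {k, l} j'
    rw [hj'] at h1
    have h2 := hval (udRow {k, l} + flat (W {k, l})) ((e (jc ∅)).erase t) (Finset.notMem_erase t _)
    rw [Finset.insert_erase ht, hrow _ (pairU hk hl), udRow_pair_dot_zgen_neg hkl hkm hlm, hmaxat _ (pairU hk hl)] at h2
    linarith
  · obtain ⟨j', hj'⟩ := he (insert t (e (jc ∅)))
    have h1 := hmq {k, m} j'
    rw [hj'] at h1
    have h2 := hval (udRow {k, m} + flat (W {k, m})) (e (jc ∅)) ht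
    rw [hrow _ (pairU hk hm), udRow_pair_dot_zgen_pos hkl hkm hlm, hmaxat _ (pairU hk hm)] at h2
    linarith

/-! ### §5d ★★ The coordinate-face ceiling for ANY private symmetric generator (covers 38 g2's enemy candidate `Q_II`)

`no_pure_block_of_zgen` used of the generator only two things: it is ZERO-DIAGONAL SYMMETRIC-IN-EFFECT and supported in `U × U`
(so every tilt tight on the coordinate face `{S ∪ b : b ⊆ U}` is blind to it — full tightness kills the symmetrised `U × U`
entries), and its CLIQUE WEIGHT IS SIGN-INDEFINITE across block rows (`+2` on `{k,m}`, `−2` on `{k,l}`).  The general statement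
(`no_pure_block_of_private`): for ANY symmetric `g` with `g p q ≠ 0 ⇒ p, q ∈ U, p ≠ q` occurring among the generators and ANY two
block rows `a₁, a₂ ⊆ U` with `⟨udRow a₁, g⟩ > 0 > ⟨udRow a₂, g⟩`, no exact-tilted located block at a coordinate face over `U` is pure.
Instance: 38 g2's interaction differences `I_{u,v} − I_{u,v'}` (§10 `udRow_map_dotProduct_interDiff = ∓2`), i.e. the enemy
candidate `Q_II` has no coordinate-face pure-block certificate either (38 §10 excludes the transversal face). -/

/-- (i″) FULL coordinate-face tightness over `U` makes a tilt blind to every symmetric matrix supported off-diagonally in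
`U × U`. -/
theorem coordTight_dot_private (W g : Matrix (Fin n) (Fin n) ℝ) (S U : Finset (Fin n)) (hSU : Disjoint S U)
    (hT : ∀ b, b ⊆ U → flat W ⬝ᵥ udPt (S ∪ b) = flat W ⬝ᵥ udPt S)
    (hgsym : ∀ p q, g p q = g q p) (hgU : ∀ p q, g p q ≠ 0 → p ∈ U ∧ q ∈ U ∧ p ≠ q) :
    flat W ⬝ᵥ flat g = 0 := by
  classical
  have notS : ∀ {x : Fin n}, x ∈ U → x ∉ S := fun hx h => Finset.disjoint_left.1 hSU h hx
  have pairU : ∀ {x y : Fin n}, x ∈ U → y ∈ U → ({x, y} : Finset (Fin n)) ⊆ U := fun hx hy =>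
    Finset.insert_subset_iff.2 ⟨hx, Finset.singleton_subset_iff.2 hy⟩
  have singU : ∀ {x : Fin n}, x ∈ U → ({x} : Finset (Fin n)) ⊆ U := fun hx => Finset.singleton_subset_iff.2 hx
  have hS1 : ∀ x : Fin n, S ∪ {x} = insert x S := fun x => by
    ext y; simp only [Finset.mem_union, Finset.mem_singleton, Finset.mem_insert]; tauto
  have hS2 : ∀ x y : Fin n, S ∪ {x, y} = insert x (insert y S) := fun x y => by
    ext z; simp only [Finset.mem_union, Finset.mem_singleton, Finset.mem_insert]; tauto
  have hval : ∀ b, b ⊆ U → ∑ p ∈ S ∪ b, ∑ q ∈ S ∪ b, W p q = ∑ p ∈ S, ∑ q ∈ S, W p q := fun b hb => by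
    rw [← flat_dotProduct_udPt_eq, ← flat_dotProduct_udPt_eq]; exact hT b hb
  have hsym : ∀ k l, k ∈ U → l ∈ U → k ≠ l → W k l + W l k = 0 := by
    intro k l hk hl hkl
    have h := mixed_diff W (notS hk) (notS hl) hkl
    rw [← hS2 k l, ← hS1 k, ← hS1 l, hval _ (pairU hk hl), hval _ (singU hk), hval _ (singU hl)] at h
    linarith
  have hterm : ∀ i j, W i j * g i j + W j i * g j i = 0 := by
    intro i j
    by_cases hg : g i j = 0
    · have hg' : g j i = 0 := by rw [← hgsym i j]; exact hg
      rw [hg, hg', mul_zero, mul_zero, add_zero]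
    · obtain ⟨hi, hj, hij⟩ := hgU i j hg
      rw [← hgsym i j, ← add_mul, hsym i j hi hj hij, zero_mul]
  have htot : ∑ i, ∑ j, (W i j * g i j + W j i * g j i) = 0 :=
    Finset.sum_eq_zero fun i _ => Finset.sum_eq_zero fun j _ => hterm i j
  have hB : ∑ i, ∑ j, W j i * g j i = ∑ i, ∑ j, W i j * g i j := Finset.sum_comm
  simp only [Finset.sum_add_distrib] at htot
  rw [hB] at htot
  rw [flat_dotProduct_flat]
  linarith

/-- ★★ **NO PURE COORDINATE-FACE LOCATED BLOCK ON A CUBE WITH A PRIVATE SYMMETRIC GENERATOR OF SIGN-INDEFINITE CLIQUE WEIGHT —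
for ANY exact-tilted rows.**  As `no_pure_block_of_zgen`, with the generator `zgen k l m` replaced by any symmetric `g` supported
off-diagonally in `U × U` and two block rows `a₁, a₂ ⊆ U` on which `udRow` weighs `g` with opposite strict signs. -/
theorem no_pure_block_of_private {N K : ℕ} (Q₀ : Matrix (Fin n) (Fin n) ℝ) (G : Fin N → Matrix (Fin n) (Fin n) ℝ)
    (e : Fin (K + 1) → Finset (Fin N)) (he : Function.Surjective e) (S U : Finset (Fin n)) (hSU : Disjoint S U)
    {t : Fin N} (g : Matrix (Fin n) (Fin n) ℝ) (hG : G t = g)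
    (hgsym : ∀ p q, g p q = g q p) (hgU : ∀ p q, g p q ≠ 0 → p ∈ U ∧ q ∈ U ∧ p ≠ q)
    {a₁ a₂ : Finset (Fin n)} (ha₁ : a₁ ⊆ U) (ha₂ : a₂ ⊆ U)
    (hpos : 0 < udRow a₁ ⬝ᵥ flat g) (hneg : udRow a₂ ⬝ᵥ flat g < 0)
    (W : Finset (Fin n) → Matrix (Fin n) (Fin n) ℝ) (jc : Finset (Fin n) → Fin (K + 1)) (mrow : Finset (Fin n) → ℝ)
    (hmq : ∀ a j, (udRow a + flat (W a)) ⬝ᵥ cubePt Q₀ G (e j) ≤ mrow a) :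
    ¬ ∀ a, a ⊆ U → ∀ b, b ⊆ U →
        (1 + hCOR (W a) + mrow a) - (udRow a + flat (W a)) ⬝ᵥ (udPt (S ∪ b) + cubePt Q₀ G (e (jc b)))
          = (1 - ((a ∩ b).card : ℝ)) ^ 2 := by
  classical
  intro hblock
  obtain ⟨-, -, slack, -⟩ := ud_data n
  have notS : ∀ {x : Fin n}, x ∈ U → x ∉ S := fun hx h => Finset.disjoint_left.1 hSU h hx
  have hdec : ∀ a, a ⊆ U → ∀ b, b ⊆ U →
      flat (W a) ⬝ᵥ udPt (S ∪ b) = hCOR (W a) ∧ (udRow a + flat (W a)) ⬝ᵥ cubePt Q₀ G (e (jc b)) = mrow a := by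
    intro a ha b hb
    have h := hblock a ha b hb
    have hab : a ∩ (S ∪ b) = a ∩ b := by
      ext x
      simp only [Finset.mem_inter, Finset.mem_union]
      constructor
      · rintro ⟨hx, hx' | hx'⟩
        · exact absurd hx' (notS (ha hx))
        · exact ⟨hx, hx'⟩
      · rintro ⟨hx, hx'⟩
        exact ⟨hx, Or.inr hx'⟩
    have hs := slack a (S ∪ b)
    rw [hab] at hs
    have hA := le_hCOR (W a) (S ∪ b)
    have hJ := hmq a (jc b)
    rw [dotProduct_add, add_dotProduct (udRow a) (flat (W a)) (udPt (S ∪ b))] at h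
    constructor <;> linarith
  have horth : ∀ a, a ⊆ U → flat (W a) ⬝ᵥ flat (G t) = 0 := by
    intro a ha
    have h0 := (hdec a ha ∅ (Finset.empty_subset _)).1
    rw [Finset.union_empty] at h0
    rw [hG]
    exact coordTight_dot_private (W a) g S U hSU (fun b hb => by rw [(hdec a ha b hb).1, h0]) hgsym hgU
  have hrow : ∀ a, a ⊆ U → (udRow a + flat (W a)) ⬝ᵥ flat (G t) = udRow a ⬝ᵥ flat g := fun a ha => by
    rw [add_dotProduct, horth a ha, add_zero, hG]
  have hval : ∀ (ρ : Fin (n * n) → ℝ) (P : Finset (Fin N)), t ∉ P →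
      ρ ⬝ᵥ cubePt Q₀ G (insert t P) = ρ ⬝ᵥ cubePt Q₀ G P + ρ ⬝ᵥ flat (G t) := fun ρ P ht => by
    rw [dotProduct_cubePt, dotProduct_cubePt, Finset.sum_insert ht]
    ring
  have hmaxat : ∀ a, a ⊆ U → (udRow a + flat (W a)) ⬝ᵥ cubePt Q₀ G (e (jc ∅)) = mrow a :=
    fun a ha => (hdec a ha ∅ (Finset.empty_subset _)).2
  by_cases ht : t ∈ e (jc ∅)
  · obtain ⟨j', hj'⟩ := he ((e (jc ∅)).erase t)
    have h1 := hmq a₂ j'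
    rw [hj'] at h1
    have h2 := hval (udRow a₂ + flat (W a₂)) ((e (jc ∅)).erase t) (Finset.notMem_erase t _)
    rw [Finset.insert_erase ht, hrow _ ha₂, hmaxat _ ha₂] at h2
    linarith
  · obtain ⟨j', hj'⟩ := he (insert t (e (jc ∅)))
    have h1 := hmq a₁ j'
    rw [hj'] at h1
    have h2 := hval (udRow a₁ + flat (W a₁)) (e (jc ∅)) ht
    rw [hrow _ ha₁, hmaxat _ ha₁] at h2
    linarith

end Ceiling

/-! ## §6 (rev 7) The law chain with its DEAD bottom rung, BY NAME

N22 is in the kernel (✓ p679540 `…NNDivisionHardNegative.LocatedPencil.locatedPencilLaw_false`, crit-9 g2; director R321): the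
BOX-rhs located pencil law C⁺_entry is FALSE.  Its statement is this file's `LocatedPencilLaw` up to δ (same `RowFamily.Law` body,
same `entryTilted` rows and rhs, same `T`), so the refutation is imported BY NAME, and the chain of record reads, in kernel:
`¬ LocatedPencilLaw` (dead, misstated: box rhs) · `pinnedRows.Law → ExactPencilLaw → allRows.Law → COR-VIRTUAL` (open, exact rhs) ·
`ExactPencilLaw`'s body HOLDS on `Q∘`, `Q^Π`, `PinExposed`, `ColumnCoupled` cubes (§4e) and on zgen cubes (38 g2
`ExactPencil.cor_add_zgenCube_decided`, transversal face), while no coordinate-face pure block exists on the latter (§5b/§5c). -/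

section Chain

/-- ★ C⁺_entry IS DEAD, BY NAME: `¬ LocatedPencilLaw` is ✓ p679540 `locatedPencilLaw_false` by `exact` (δ-unfolding of
`entryTilted.Law`). -/
theorem locatedPencilLaw_refuted : ¬ LocatedPencilLaw :=
  Summit.ValiantsHypothesis.Theorems.NNDivisionHardNegative.LocatedPencil.locatedPencilLaw_false

/-- The located-pencil law does NOT follow from the exact law for free any more than it holds: the implication
`LocatedPencilLaw → ExactPencilLaw` is (vacuously) a theorem, the converse would refute C′. -/
theorem exactPencilLaw_of_locatedPencilLaw : LocatedPencilLaw → ExactPencilLaw :=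
  fun h => absurd h locatedPencilLaw_refuted

/-- ★ THE CHAIN OF RECORD after N22 (one conjunction, by name): bottom rung dead, the three live implications, and the top
target named. -/
theorem law_chain_of_record :
    ¬ LocatedPencilLaw ∧ (pinnedRows.Law → ExactPencilLaw) ∧ (ExactPencilLaw → allRows.Law) ∧
      (allRows.Law → CorVirtualHardN) :=
  ⟨locatedPencilLaw_refuted, exact_law_chain⟩

end Chain

/-! ## §7 (rev 9) The TOGETHER FACE of a block partition is EXPOSED EXACTLY (first kernel lemma of 38 g2's W7-K1)

38 g2 (00:11:44Z, paper): for blocks `A₁, …, A_k ⊆ [n]` the set `F_𝒜 = {b : b ∩ A_i ∈ {∅, A_i} ∀ i}` is a face of COR(n), exposed by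
`W₀ := Σ_i (𝟙_{A_i} 𝟙_{A_i}ᵀ − |A_i| · diag 𝟙_{A_i})` with `h_COR(W₀) = 0`; together with a generic `V ⊥ dir F_𝒜` this decides every
affine cube with SPARSE generators (vertex support `< min |A_i|`) at the top law.  Here: the exposure half, in kernel —
`⟨W₀, x_b x_bᵀ⟩ = Σ_i |b ∩ A_i| (|b ∩ A_i| − |A_i|) ≤ 0` (no disjointness needed), `= 0 ↔ ∀ i, b ∩ A_i = ∅ ∨ A_i ⊆ b`, and
`h_COR(W₀) = 0`.  (The pinning half — a generic vector in `dir(F_𝒜)^⊥` avoiding finitely many hyperplanes — is W7-K1 proper.) -/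

section TogetherFace
variable {n : ℕ}

/-- The block weight `W₀ = Σ_i (𝟙_{A_i} 𝟙_{A_i}ᵀ − |A_i| · diag 𝟙_{A_i})` of a family of blocks. -/
def blockW {k : ℕ} (A : Fin k → Finset (Fin n)) : Matrix (Fin n) (Fin n) ℝ := fun x y =>
  ∑ i, (udInd (A i) x * udInd (A i) y - ((A i).card : ℝ) * udInd (A i) x * (if x = y then 1 else 0))

/-- `⟨W₀, x_b x_bᵀ⟩ = Σ_i |b ∩ A_i| · (|b ∩ A_i| − |A_i|)`. -/
theorem blockW_dotProduct_udPt {k : ℕ} (A : Fin k → Finset (Fin n)) (b : Finset (Fin n)) :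
    flat (blockW A) ⬝ᵥ udPt b = ∑ i, ((b ∩ A i).card : ℝ) * (((b ∩ A i).card : ℝ) - ((A i).card : ℝ)) := by
  classical
  rw [flat_dotProduct_udPt_eq]
  have step : ∑ p ∈ b, ∑ q ∈ b, blockW A p q
      = ∑ i, ∑ p ∈ b, ∑ q ∈ b,
          (udInd (A i) p * udInd (A i) q - ((A i).card : ℝ) * udInd (A i) p * (if p = q then 1 else 0)) := by
    calc ∑ p ∈ b, ∑ q ∈ b, blockW A p q
        = ∑ p ∈ b, ∑ i, ∑ q ∈ b,
            (udInd (A i) p * udInd (A i) q - ((A i).card : ℝ) * udInd (A i) p * (if p = q then 1 else 0)) := by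
          refine Finset.sum_congr rfl fun p _ => ?_
          unfold blockW
          exact Finset.sum_comm
      _ = _ := Finset.sum_comm
  rw [step]
  refine Finset.sum_congr rfl fun i _ => ?_
  have hδ : ∀ p ∈ b, ∑ q ∈ b, ((A i).card : ℝ) * udInd (A i) p * (if p = q then 1 else 0)
      = ((A i).card : ℝ) * udInd (A i) p := by
    intro p hp
    simp only [mul_ite, mul_one, mul_zero, Finset.sum_ite_eq, if_pos hp]
  have inner : ∀ p ∈ b, ∑ q ∈ b,
      (udInd (A i) p * udInd (A i) q - ((A i).card : ℝ) * udInd (A i) p * (if p = q then 1 else 0))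
        = udInd (A i) p * (∑ q ∈ b, udInd (A i) q) - ((A i).card : ℝ) * udInd (A i) p := by
    intro p hp
    rw [Finset.sum_sub_distrib, Finset.mul_sum, hδ p hp]
  rw [Finset.sum_congr rfl inner, Finset.sum_sub_distrib, ← Finset.sum_mul, ← Finset.mul_sum, sum_udInd_mem]
  ring

/-- Every term is nonpositive: `⟨W₀, x_b x_bᵀ⟩ ≤ 0`. -/
theorem blockW_dotProduct_udPt_nonpos {k : ℕ} (A : Fin k → Finset (Fin n)) (b : Finset (Fin n)) :
    flat (blockW A) ⬝ᵥ udPt b ≤ 0 := by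
  rw [blockW_dotProduct_udPt]
  refine Finset.sum_nonpos fun i _ => ?_
  have hle : ((b ∩ A i).card : ℝ) ≤ ((A i).card : ℝ) := by
    exact_mod_cast Finset.card_le_card Finset.inter_subset_right
  have h0 : (0 : ℝ) ≤ ((b ∩ A i).card : ℝ) := Nat.cast_nonneg _
  nlinarith

/-- ★ THE TOGETHER FACE: `⟨W₀, x_b x_bᵀ⟩ = 0` iff `b` meets every block in `∅` or in the whole block. -/
theorem blockW_dotProduct_udPt_eq_zero_iff {k : ℕ} (A : Fin k → Finset (Fin n)) (b : Finset (Fin n)) :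
    flat (blockW A) ⬝ᵥ udPt b = 0 ↔ ∀ i, b ∩ A i = ∅ ∨ A i ⊆ b := by
  classical
  rw [blockW_dotProduct_udPt]
  have hterm : ∀ i, ((b ∩ A i).card : ℝ) * (((b ∩ A i).card : ℝ) - ((A i).card : ℝ)) ≤ 0 := fun i => by
    have hle : ((b ∩ A i).card : ℝ) ≤ ((A i).card : ℝ) := by
      exact_mod_cast Finset.card_le_card Finset.inter_subset_right
    have h0 : (0 : ℝ) ≤ ((b ∩ A i).card : ℝ) := Nat.cast_nonneg _
    nlinarith
  rw [Finset.sum_eq_zero_iff_of_nonpos fun i _ => hterm i]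
  refine forall_congr' fun i => ?_
  simp only [Finset.mem_univ, forall_true_left]
  rw [mul_eq_zero, sub_eq_zero, Nat.cast_inj, Nat.cast_eq_zero, Finset.card_eq_zero]
  refine or_congr Iff.rfl ⟨fun h => ?_, fun h => ?_⟩
  · have := Finset.eq_of_subset_of_card_le Finset.inter_subset_right h.ge
    exact this ▸ Finset.inter_subset_left
  · rw [Finset.inter_eq_right.2 h]

/-- `h_COR(W₀) = 0`: the together face is exposed with support value `0` (attained at `b = ∅`). -/
theorem hCOR_blockW {k : ℕ} (A : Fin k → Finset (Fin n)) : hCOR (blockW A) = 0 := by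
  apply le_antisymm
  · obtain ⟨b, hb⟩ := exists_eq_hCOR (blockW A)
    rw [← hb]; exact blockW_dotProduct_udPt_nonpos A b
  · have h := le_hCOR (blockW A) ∅
    have h0 : flat (blockW A) ⬝ᵥ udPt (∅ : Finset (Fin n)) = 0 :=
      (blockW_dotProduct_udPt_eq_zero_iff A ∅).2 fun i => Or.inl (Finset.empty_inter _)
    linarith

/-- OFF the together face the block weight is STRICTLY negative by at least `min_i (|A_i| − 1)`-margin per offending block; here
the qualitative form: `⟨W₀, x_b x_bᵀ⟩ ≤ −1` whenever some block is met partially (integrality). -/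
theorem blockW_dotProduct_udPt_le_neg_one {k : ℕ} (A : Fin k → Finset (Fin n)) (b : Finset (Fin n))
    (hb : ¬ ∀ i, b ∩ A i = ∅ ∨ A i ⊆ b) : flat (blockW A) ⬝ᵥ udPt b ≤ -1 := by
  classical
  rw [← blockW_dotProduct_udPt_eq_zero_iff] at hb
  have hle := blockW_dotProduct_udPt_nonpos A b
  -- the value is an integer
  have hint : ∃ z : ℤ, flat (blockW A) ⬝ᵥ udPt b = (z : ℝ) := by
    refine ⟨∑ i, ((b ∩ A i).card : ℤ) * (((b ∩ A i).card : ℤ) - ((A i).card : ℤ)), ?_⟩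
    rw [blockW_dotProduct_udPt]; push_cast; rfl
  obtain ⟨z, hz⟩ := hint
  rw [hz] at hb hle ⊢
  have hz0 : z ≠ 0 := fun h => hb (by rw [h]; simp)
  have hzle : z ≤ 0 := by exact_mod_cast hle
  have : z ≤ -1 := by omega
  exact_mod_cast this

/-- On the block unions `b_S = ⋃_{i ∈ S} A_i` of PAIRWISE DISJOINT blocks the block weight is TIGHT: the together face contains
the embedded `COR(k)` (`S ↦ b_S`). -/
theorem blockW_tight_biUnion {k : ℕ} (A : Fin k → Finset (Fin n)) (hA : ∀ i j, i ≠ j → Disjoint (A i) (A j))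
    (S : Finset (Fin k)) : flat (blockW A) ⬝ᵥ udPt (S.biUnion A) = 0 := by
  classical
  refine (blockW_dotProduct_udPt_eq_zero_iff A _).2 fun i => ?_
  by_cases hi : i ∈ S
  · exact Or.inr (Finset.subset_biUnion_of_mem A hi)
  · refine Or.inl (Finset.disjoint_iff_inter_eq_empty.1 ?_)
    exact Finset.disjoint_biUnion_left _ _ _ |>.2 fun j hj => hA j i (ne_of_mem_of_not_mem hj hi)

/-- … and the representative rows meet the block unions in UDISJ pattern: for representatives `x i ∈ A i` of pairwise disjoint
blocks, `|{x i : i ∈ α} ∩ b_S| = |α ∩ S|`. -/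
theorem card_reps_inter_biUnion {k : ℕ} (A : Fin k → Finset (Fin n)) (hA : ∀ i j, i ≠ j → Disjoint (A i) (A j))
    (x : Fin k → Fin n) (hx : ∀ i, x i ∈ A i) (α S : Finset (Fin k)) :
    ((α.image x) ∩ S.biUnion A).card = (α ∩ S).card := by
  classical
  have hinj : Function.Injective x := fun i j hij => by
    by_contra hne
    exact Finset.disjoint_left.1 (hA i j hne) (hx i) (hij ▸ hx j)
  have hmem : ∀ i, x i ∈ S.biUnion A ↔ i ∈ S := fun i => by
    constructor
    · intro h
      obtain ⟨j, hj, hij⟩ := Finset.mem_biUnion.1 h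
      by_cases hji : j = i
      · exact hji ▸ hj
      · exact absurd (hx i) (Finset.disjoint_left.1 (hA j i hji) hij)
    · intro hi
      exact Finset.mem_biUnion.2 ⟨i, hi, hx i⟩
  have : (α.image x) ∩ S.biUnion A = (α ∩ S).image x := by
    ext y
    simp only [Finset.mem_inter, Finset.mem_image]
    constructor
    · rintro ⟨⟨i, hi, rfl⟩, hy⟩
      exact ⟨i, ⟨hi, (hmem i).1 hy⟩, rfl⟩
    · rintro ⟨i, ⟨hi, hiS⟩, rfl⟩
      exact ⟨⟨i, hi, rfl⟩, (hmem i).2 hiS⟩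
  rw [this, Finset.card_image_of_injective _ hinj]

/-- ★ GENERIC COMMON PIN (the «one non-mechanical step» of W7-K1, in kernel): if a property `P` of weight vectors is closed under
`0`, `+` and scalar multiples (e.g. `P V ↔ V ⊥ dir F`), and EACH test vector `g t` is seen by SOME `P`-vector, then ONE `P`-vector
sees them ALL (finitely many hyperplanes do not cover a line through two of their complements: pick `c` off a finite bad set). -/
theorem exists_common_pin {d N : ℕ} (P : (Fin d → ℝ) → Prop) (hP0 : P 0) (hPadd : ∀ u v, P u → P v → P (u + v))
    (hPsmul : ∀ (c : ℝ) u, P u → P (c • u)) (g : Fin N → Fin d → ℝ)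
    (hg : ∀ t, ∃ V, P V ∧ V ⬝ᵥ g t ≠ 0) : ∃ V, P V ∧ ∀ t, V ⬝ᵥ g t ≠ 0 := by
  classical
  suffices h : ∀ T : Finset (Fin N), ∃ V, P V ∧ ∀ t ∈ T, V ⬝ᵥ g t ≠ 0 by
    obtain ⟨V, hV, hT⟩ := h Finset.univ
    exact ⟨V, hV, fun t => hT t (Finset.mem_univ t)⟩
  intro T
  induction T using Finset.induction_on with
  | empty => exact ⟨0, hP0, fun t ht => absurd ht (Finset.notMem_empty t)⟩
  | @insert t₀ T ht₀ ih =>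
    obtain ⟨V, hV, hVT⟩ := ih
    obtain ⟨V', hV', hV't⟩ := hg t₀
    -- the finite set of bad parameters
    let bad : Finset ℝ := insert (-(V ⬝ᵥ g t₀) / (V' ⬝ᵥ g t₀)) (T.image fun t => -(V ⬝ᵥ g t) / (V' ⬝ᵥ g t))
    obtain ⟨c, hc⟩ := Infinite.exists_notMem_finset bad
    refine ⟨V + c • V', hPadd _ _ hV (hPsmul c V' hV'), fun t ht => ?_⟩
    have hexp : (V + c • V') ⬝ᵥ g t = V ⬝ᵥ g t + c * (V' ⬝ᵥ g t) := by
      rw [add_dotProduct, smul_dotProduct, smul_eq_mul]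
    rw [hexp]
    rcases Finset.mem_insert.1 ht with rfl | htT
    · intro h
      apply hc
      have : c = -(V ⬝ᵥ g t) / (V' ⬝ᵥ g t) := by
        rw [eq_div_iff hV't]; linarith
      rw [this]; exact Finset.mem_insert_self _ _
    · by_cases hz : V' ⬝ᵥ g t = 0
      · rw [hz, mul_zero, add_zero]; exact hVT t htT
      · intro h
        apply hc
        have : c = -(V ⬝ᵥ g t) / (V' ⬝ᵥ g t) := by
          rw [eq_div_iff hz]; linarith
        rw [this]
        exact Finset.mem_insert_of_mem (Finset.mem_image.2 ⟨t, htT, rfl⟩)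

/-- The explicit pin of ONE sparse generator: if `g x₀ y₀ ≠ 0`, `y₀ ∈ A j`, and some column `z ∈ A j` of `g` vanishes identically
(e.g. `z` outside the vertex support of `g`, which exists as soon as `|V(g)| < |A j|`), then `V := e_{x₀} (e_{y₀} − e_z)ᵀ` is
ORTHOGONAL to the whole together face (`y₀, z` lie in the same block) and sees `g`: `⟨V, g⟩ = g x₀ y₀ ≠ 0` (38 g2's NON-BLOCKY
LEMMA, constructive form). -/
theorem exists_pin_of_vanishing_column {k : ℕ} (A : Fin k → Finset (Fin n)) (g : Matrix (Fin n) (Fin n) ℝ)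
    {x₀ y₀ z : Fin n} (h0 : g x₀ y₀ ≠ 0) {j : Fin k} (hy : y₀ ∈ A j) (hz : z ∈ A j) (hgz : ∀ p, g p z = 0) :
    ∃ V : Matrix (Fin n) (Fin n) ℝ,
      (∀ b : Finset (Fin n), (∀ i, b ∩ A i = ∅ ∨ A i ⊆ b) → flat V ⬝ᵥ udPt b = 0) ∧ flat V ⬝ᵥ flat g ≠ 0 := by
  classical
  refine ⟨fun p q => udInd {x₀} p * (udInd {y₀} q - udInd {z} q), fun b hb => ?_, ?_⟩
  · rw [flat_dotProduct_udPt_eq]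
    have h1 : ∑ p ∈ b, ∑ q ∈ b, udInd {x₀} p * (udInd {y₀} q - udInd {z} q)
        = (∑ p ∈ b, udInd {x₀} p) * ∑ q ∈ b, (udInd {y₀} q - udInd {z} q) := by
      rw [Finset.sum_mul_sum]
    rw [h1, Finset.sum_sub_distrib, sum_udInd_mem, sum_udInd_mem, sum_udInd_mem]
    rcases hb j with hj | hj
    · have hy' : b ∩ {y₀} = ∅ := Finset.eq_empty_of_forall_notMem fun w hw => by
        rw [Finset.mem_inter, Finset.mem_singleton] at hw
        have : y₀ ∈ b ∩ A j := Finset.mem_inter.2 ⟨hw.2 ▸ hw.1, hy⟩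
        rw [hj] at this; exact absurd this (Finset.notMem_empty _)
      have hz' : b ∩ {z} = ∅ := Finset.eq_empty_of_forall_notMem fun w hw => by
        rw [Finset.mem_inter, Finset.mem_singleton] at hw
        have : z ∈ b ∩ A j := Finset.mem_inter.2 ⟨hw.2 ▸ hw.1, hz⟩
        rw [hj] at this; exact absurd this (Finset.notMem_empty _)
      rw [hy', hz']; simp
    · have hy' : b ∩ {y₀} = {y₀} := Finset.inter_singleton_of_mem (hj hy)
      have hz' : b ∩ {z} = {z} := Finset.inter_singleton_of_mem (hj hz)
      rw [hy', hz']; simp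
  · rw [flat_dotProduct_flat]
    have h2 : ∑ p, ∑ q, udInd {x₀} p * (udInd {y₀} q - udInd {z} q) * g p q = g x₀ y₀ - g x₀ z := by
      simp only [udInd_apply, Finset.mem_singleton]
      simp [Finset.sum_ite_eq', sub_mul, Finset.sum_sub_distrib, ite_mul, one_mul, zero_mul]
    rw [h2, hgz x₀, sub_zero]
    exact h0

/-- ★★ COMMON PIN FOR A SPARSE CUBE (W7-K1's non-mechanical step, DONE): if every generator `G t` has a nonzero entry
`G t x₀ y₀ ≠ 0` together with a column `z` in `y₀`'s block on which `G t` vanishes (automatic when the vertex support of `G t` is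
smaller than every block), then ONE weight `V` is orthogonal to the whole together face and sees EVERY generator. -/
theorem exists_common_pin_of_sparse {k N : ℕ} (A : Fin k → Finset (Fin n)) (G : Fin N → Matrix (Fin n) (Fin n) ℝ)
    (hG : ∀ t, ∃ x₀ y₀ z : Fin n, ∃ j : Fin k, G t x₀ y₀ ≠ 0 ∧ y₀ ∈ A j ∧ z ∈ A j ∧ ∀ p, G t p z = 0) :
    ∃ V : Matrix (Fin n) (Fin n) ℝ,
      (∀ b : Finset (Fin n), (∀ i, b ∩ A i = ∅ ∨ A i ⊆ b) → flat V ⬝ᵥ udPt b = 0) ∧ ∀ t, flat V ⬝ᵥ flat (G t) ≠ 0 := by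
  classical
  let P : (Fin (n * n) → ℝ) → Prop := fun w => ∀ b : Finset (Fin n), (∀ i, b ∩ A i = ∅ ∨ A i ⊆ b) → w ⬝ᵥ udPt b = 0
  have hP0 : P 0 := fun b _ => by simp
  have hPadd : ∀ u v, P u → P v → P (u + v) := fun u v hu hv b hb => by
    rw [add_dotProduct, hu b hb, hv b hb, add_zero]
  have hPsmul : ∀ (c : ℝ) u, P u → P (c • u) := fun c u hu b hb => by
    rw [smul_dotProduct, hu b hb, smul_zero]
  have hg : ∀ t, ∃ w, P w ∧ w ⬝ᵥ flat (G t) ≠ 0 := fun t => by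
    obtain ⟨x₀, y₀, z, j, h0, hy, hz, hgz⟩ := hG t
    obtain ⟨V, hV, hVg⟩ := exists_pin_of_vanishing_column A (G t) h0 hy hz hgz
    exact ⟨flat V, hV, hVg⟩
  obtain ⟨w, hw, hwt⟩ := exists_common_pin P hP0 hPadd hPsmul (fun t => flat (G t)) hg
  refine ⟨unflat w, fun b hb => ?_, fun t => ?_⟩
  · rw [flat_unflat]; exact hw b hb
  · rw [flat_unflat]; exact hwt t

/-- ★ THE UD-PART OF THE TOGETHER-FACE BLOCK: for pairwise disjoint blocks with representatives `x i ∈ A i` and ANY weight `W`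
tight on the block unions with `h_COR(W) = 0` (e.g. `W = μ • blockW A + λ • V`, `V ⊥` the face, `μ ≫ λ`), the located exact slack of
row `(x(α), W)` against column `b_S = ⋃_{i∈S} A_i` is the UDISJ_k entry `(1 − |α ∩ S|)²`.  (The passenger part — a COMMON maximiser
`H⋆ = {t : 0 < ⟨W, G t⟩}` once `W` pins every generator beyond the clique weights — is 38 g2's §9 engine; with it the block is pure
and `three_pow_le_of_block` gives `3^k ≤ (r+1)·2^k`.) -/
theorem togetherFace_ud_block {k : ℕ} (A : Fin k → Finset (Fin n)) (hA : ∀ i j, i ≠ j → Disjoint (A i) (A j))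
    (x : Fin k → Fin n) (hx : ∀ i, x i ∈ A i) (W : Matrix (Fin n) (Fin n) ℝ)
    (hface : ∀ S : Finset (Fin k), flat W ⬝ᵥ udPt (S.biUnion A) = 0) (hW : hCOR W = 0) (α S : Finset (Fin k)) :
    (1 + hCOR W) - (udRow (α.image x) + flat W) ⬝ᵥ udPt (S.biUnion A) = (1 - ((α ∩ S).card : ℝ)) ^ 2 := by
  classical
  obtain ⟨-, -, slack, -⟩ := ud_data n
  have hs := slack (α.image x) (S.biUnion A)
  rw [card_reps_inter_biUnion A hA x hx α S] at hs
  rw [add_dotProduct, hface S, hW]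
  linarith

/-- ★ THE PASSENGER PART (row-free common maximiser from STRONG PINS): if the weight `W` pins every generator beyond the clique
weight of the row (`|⟨udRow a, G t⟩| < |⟨W, G t⟩|`), then `H⋆ := {t : 0 < ⟨W, G t⟩}` — which does not depend on the row — maximises
the row `udRow a + flat W` over ALL cube points.  (With `W = μ • blockW A + λ • V` from `exists_common_pin_of_sparse` and `μ, λ`
large this holds for every row at once: 38 g2's sparse-cube certificate; only the scaling arithmetic is left.) -/
theorem cubePt_le_of_pins {N : ℕ} (Q₀ : Matrix (Fin n) (Fin n) ℝ) (G : Fin N → Matrix (Fin n) (Fin n) ℝ)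
    (W : Matrix (Fin n) (Fin n) ℝ) (a : Finset (Fin n))
    (hpin : ∀ t, |udRow a ⬝ᵥ flat (G t)| < |flat W ⬝ᵥ flat (G t)|) (P : Finset (Fin N)) :
    (udRow a + flat W) ⬝ᵥ cubePt Q₀ G P
      ≤ (udRow a + flat W) ⬝ᵥ cubePt Q₀ G (Finset.univ.filter fun t => 0 < flat W ⬝ᵥ flat (G t)) := by
  classical
  set ρ := udRow a + flat W with hρ
  have hs : ∀ t, ρ ⬝ᵥ flat (G t) = udRow a ⬝ᵥ flat (G t) + flat W ⬝ᵥ flat (G t) := fun t => by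
    rw [hρ, add_dotProduct]
  have hsgn : ∀ t, 0 < ρ ⬝ᵥ flat (G t) ↔ 0 < flat W ⬝ᵥ flat (G t) := fun t => by
    have h := hpin t
    rw [hs t]
    rw [abs_lt] at h
    rcases lt_or_ge 0 (flat W ⬝ᵥ flat (G t)) with hw | hw
    · rw [abs_of_pos hw] at h
      exact ⟨fun _ => hw, fun _ => by linarith [h.1]⟩
    · rw [abs_of_nonpos hw] at h
      exact ⟨fun h' => by linarith [h.2], fun h' => absurd h' (not_lt.2 hw)⟩
  have hfilter : (Finset.univ.filter fun t => 0 < flat W ⬝ᵥ flat (G t)) = Finset.univ.filter fun t => 0 < ρ ⬝ᵥ flat (G t) :=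
    Finset.filter_congr fun t _ => (hsgn t).symm
  rw [hfilter, dotProduct_cubePt, dotProduct_cubePt]
  have h1 : ∑ t ∈ P, ρ ⬝ᵥ flat (G t) ≤ ∑ t ∈ P.filter (fun t => 0 < ρ ⬝ᵥ flat (G t)), ρ ⬝ᵥ flat (G t) := by
    rw [← Finset.sum_filter_add_sum_filter_not P (fun t => 0 < ρ ⬝ᵥ flat (G t))]
    have : ∑ t ∈ P.filter (fun t => ¬ 0 < ρ ⬝ᵥ flat (G t)), ρ ⬝ᵥ flat (G t) ≤ 0 :=
      Finset.sum_nonpos fun t ht => not_lt.1 (Finset.mem_filter.1 ht).2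
    linarith
  have h2 : ∑ t ∈ P.filter (fun t => 0 < ρ ⬝ᵥ flat (G t)), ρ ⬝ᵥ flat (G t)
      ≤ ∑ t ∈ Finset.univ.filter (fun t => 0 < ρ ⬝ᵥ flat (G t)), ρ ⬝ᵥ flat (G t) :=
    Finset.sum_le_sum_of_subset_of_nonneg (Finset.filter_subset_filter _ (Finset.subset_univ P))
      fun t ht _ => le_of_lt (Finset.mem_filter.1 ht).2
  linarith

/-- entrywise `ℓ¹` mass of a matrix -/
def l1 (M : Matrix (Fin n) (Fin n) ℝ) : ℝ := ∑ i, ∑ j, |M i j|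

/-- `0 ≤ ‖M‖₁`. -/
theorem l1_nonneg (M : Matrix (Fin n) (Fin n) ℝ) : 0 ≤ l1 M :=
  Finset.sum_nonneg fun _ _ => Finset.sum_nonneg fun _ _ => abs_nonneg _

/-- `|⟨M, x_b x_bᵀ⟩| ≤ ‖M‖₁`. -/
theorem abs_flat_dotProduct_udPt_le (M : Matrix (Fin n) (Fin n) ℝ) (b : Finset (Fin n)) :
    |flat M ⬝ᵥ udPt b| ≤ l1 M := by
  classical
  rw [flat_dotProduct_udPt_eq]
  calc |∑ p ∈ b, ∑ q ∈ b, M p q| ≤ ∑ p ∈ b, |∑ q ∈ b, M p q| := Finset.abs_sum_le_sum_abs _ _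
    _ ≤ ∑ p ∈ b, ∑ q ∈ b, |M p q| := Finset.sum_le_sum fun p _ => Finset.abs_sum_le_sum_abs _ _
    _ ≤ ∑ p ∈ b, ∑ q, |M p q| :=
        Finset.sum_le_sum fun p _ => Finset.sum_le_sum_of_subset_of_nonneg (Finset.subset_univ b) fun q _ _ => abs_nonneg _
    _ ≤ ∑ p, ∑ q, |M p q| :=
        Finset.sum_le_sum_of_subset_of_nonneg (Finset.subset_univ b) fun p _ _ =>
          Finset.sum_nonneg fun q _ => abs_nonneg _

/-- The clique matrix has entries in `{−1, 0, 1}`. -/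
theorem abs_udMat_le_one (a : Finset (Fin n)) (i j : Fin n) : |udMat a i j| ≤ 1 := by
  classical
  unfold udMat
  simp only [udInd_apply]
  rcases eq_or_ne i j with rfl | hij
  · by_cases hi : i ∈ a <;> norm_num [hi]
  · by_cases hi : i ∈ a <;> by_cases hj : j ∈ a <;> norm_num [hi, hj, hij]

/-- `|⟨udRow a, g⟩| ≤ ‖g‖₁` for every row index `a`. -/
theorem abs_udRow_dotProduct_flat_le (a : Finset (Fin n)) (g : Matrix (Fin n) (Fin n) ℝ) :
    |udRow a ⬝ᵥ flat g| ≤ l1 g := by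
  classical
  rw [udRow, flat_dotProduct_flat]
  calc |∑ i, ∑ j, udMat a i j * g i j| ≤ ∑ i, |∑ j, udMat a i j * g i j| := Finset.abs_sum_le_sum_abs _ _
    _ ≤ ∑ i, ∑ j, |udMat a i j * g i j| := Finset.sum_le_sum fun i _ => Finset.abs_sum_le_sum_abs _ _
    _ ≤ ∑ i, ∑ j, |g i j| := Finset.sum_le_sum fun i _ => Finset.sum_le_sum fun j _ => by
        rw [abs_mul]
        calc |udMat a i j| * |g i j| ≤ 1 * |g i j| :=
              mul_le_mul_of_nonneg_right (abs_udMat_le_one a i j) (abs_nonneg _)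
          _ = |g i j| := one_mul _

/-- `flat (c • A) = c • flat A`. -/
theorem flat_smul' (c : ℝ) (A : Matrix (Fin n) (Fin n) ℝ) : flat (c • A) = c • flat A := by
  funext p; simp [flat, Matrix.smul_apply]

/-- ★★ THE TOGETHER-FACE WEIGHT (38 g2's `W = μ W₀ + λ V`, SCALING DONE IN KERNEL): from ONE `V` orthogonal to the together face
and seeing every generator (`exists_common_pin_of_sparse`), the weight `W := λ • (c • blockW A + V)` with `c ≥ ‖V‖₁ + 1` off a
finite bad set and `λ` large has `h_COR(W) = 0`, is TIGHT on the whole together face, and PINS EVERY GENERATOR BEYOND EVERY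
CLIQUE WEIGHT: `|⟨udRow a, G t⟩| < |⟨W, G t⟩|` for ALL rows `a` and all `t` — so (`cubePt_le_of_pins`) `H⋆ = {t : 0 < ⟨W, G t⟩}`
is a COMMON maximiser of every located row `(a, W)`, and (`togetherFace_ud_block`) the representative rows × block unions read
UDISJ_k exactly. -/
theorem exists_togetherFace_weight {k N : ℕ} (A : Fin k → Finset (Fin n)) (G : Fin N → Matrix (Fin n) (Fin n) ℝ)
    (V : Matrix (Fin n) (Fin n) ℝ) (hVface : ∀ b : Finset (Fin n), (∀ i, b ∩ A i = ∅ ∨ A i ⊆ b) → flat V ⬝ᵥ udPt b = 0)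
    (hVpin : ∀ t, flat V ⬝ᵥ flat (G t) ≠ 0) :
    ∃ W : Matrix (Fin n) (Fin n) ℝ, hCOR W = 0 ∧
      (∀ b : Finset (Fin n), (∀ i, b ∩ A i = ∅ ∨ A i ⊆ b) → flat W ⬝ᵥ udPt b = 0) ∧
      ∀ (a : Finset (Fin n)) (t : Fin N), |udRow a ⬝ᵥ flat (G t)| < |flat W ⬝ᵥ flat (G t)| := by
  classical
  set w : Fin N → ℝ := fun t => flat (blockW A) ⬝ᵥ flat (G t) with hw_def
  set v : Fin N → ℝ := fun t => flat V ⬝ᵥ flat (G t) with hv_def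
  -- Step 1: a multiplier `c ≥ ‖V‖₁ + 1` avoiding the finitely many cancellations `c * w t + v t = 0`.
  have hc : ∃ c : ℝ, l1 V + 1 ≤ c ∧ ∀ t, c * w t + v t ≠ 0 := by
    let bad : Finset ℝ := Finset.univ.image fun t => -(v t) / (w t)
    by_contra hno
    push Not at hno
    have hsub : ∀ j ∈ Finset.range (bad.card + 1), (l1 V + 1 + (j : ℝ)) ∈ bad := by
      intro j _
      obtain ⟨t, ht⟩ := hno (l1 V + 1 + j) (by have := (Nat.cast_nonneg j : (0 : ℝ) ≤ j); linarith)
      have hw : w t ≠ 0 := by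
        intro hw
        apply hVpin t
        have : v t = 0 := by rw [hw, mul_zero, zero_add] at ht; exact ht
        exact this
      refine Finset.mem_image.2 ⟨t, Finset.mem_univ _, ?_⟩
      rw [eq_comm, eq_div_iff hw]
      linarith
    have hcard := Finset.card_le_card_of_injOn (fun j : ℕ => l1 V + 1 + (j : ℝ))
      (fun j hj => hsub j (Finset.mem_coe.1 hj))
      (fun j₁ _ j₂ _ h => by
        have h' : (j₁ : ℝ) = j₂ := by
          have := h
          simp only at this
          linarith
        exact_mod_cast h')
    rw [Finset.card_range] at hcard
    omega
  obtain ⟨c, hc1, hc2⟩ := hc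
  have hc0 : 0 ≤ c := by linarith [l1_nonneg V]
  -- Step 2: the scale `λ`.
  set lam : ℝ := ∑ t, (l1 (G t) + 1) / |c * w t + v t| + 1 with hlam_def
  have hlam_pos : 0 < lam := by
    have : 0 ≤ ∑ t, (l1 (G t) + 1) / |c * w t + v t| :=
      Finset.sum_nonneg fun t _ => div_nonneg (by linarith [l1_nonneg (G t)]) (abs_nonneg _)
    linarith
  have hlam_t : ∀ t, l1 (G t) + 1 ≤ lam * |c * w t + v t| := by
    intro t
    have hpos : 0 < |c * w t + v t| := abs_pos.2 (hc2 t)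
    have hterm : (l1 (G t) + 1) / |c * w t + v t| ≤ lam := by
      have h1 := Finset.single_le_sum (f := fun t => (l1 (G t) + 1) / |c * w t + v t|)
        (fun t _ => div_nonneg (by linarith [l1_nonneg (G t)]) (abs_nonneg _)) (Finset.mem_univ t)
      linarith
    calc l1 (G t) + 1 = (l1 (G t) + 1) / |c * w t + v t| * |c * w t + v t| := by
          rw [div_mul_cancel₀ _ hpos.ne']
      _ ≤ lam * |c * w t + v t| := mul_le_mul_of_nonneg_right hterm (abs_nonneg _)
  -- The weight.
  have hflat : flat (lam • (c • blockW A + V)) = lam • (c • flat (blockW A) + flat V) := by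
    rw [flat_smul', flat_add', flat_smul']
  have hWb : ∀ b : Finset (Fin n), flat (lam • (c • blockW A + V)) ⬝ᵥ udPt b
      = lam * (c * (flat (blockW A) ⬝ᵥ udPt b) + flat V ⬝ᵥ udPt b) := fun b => by
    rw [hflat, smul_dotProduct, add_dotProduct, smul_dotProduct, smul_eq_mul, smul_eq_mul]
  have hWg : ∀ t, flat (lam • (c • blockW A + V)) ⬝ᵥ flat (G t) = lam * (c * w t + v t) := fun t => by
    rw [hflat, smul_dotProduct, add_dotProduct, smul_dotProduct, smul_eq_mul, smul_eq_mul]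
  have hface : ∀ b : Finset (Fin n), (∀ i, b ∩ A i = ∅ ∨ A i ⊆ b) → flat (lam • (c • blockW A + V)) ⬝ᵥ udPt b = 0 := by
    intro b hb
    rw [hWb, (blockW_dotProduct_udPt_eq_zero_iff A b).2 hb, hVface b hb]; ring
  have hnonpos : ∀ b : Finset (Fin n), flat (lam • (c • blockW A + V)) ⬝ᵥ udPt b ≤ 0 := by
    intro b
    by_cases hb : ∀ i, b ∩ A i = ∅ ∨ A i ⊆ b
    · exact (hface b hb).le
    · rw [hWb]
      have h1 := blockW_dotProduct_udPt_le_neg_one A b hb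
      have h2 := abs_flat_dotProduct_udPt_le V b
      have h3 : flat V ⬝ᵥ udPt b ≤ l1 V := (le_abs_self _).trans h2
      have h4 : c * (flat (blockW A) ⬝ᵥ udPt b) ≤ -c := by nlinarith
      have : c * (flat (blockW A) ⬝ᵥ udPt b) + flat V ⬝ᵥ udPt b ≤ 0 := by linarith
      exact mul_nonpos_iff.2 (Or.inl ⟨hlam_pos.le, this⟩)
  refine ⟨lam • (c • blockW A + V), ?_, hface, fun a t => ?_⟩
  · apply le_antisymm
    · obtain ⟨b, hb⟩ := exists_eq_hCOR (lam • (c • blockW A + V))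
      rw [← hb]; exact hnonpos b
    · have h := le_hCOR (lam • (c • blockW A + V)) ∅
      have h0 := hface ∅ fun i => Or.inl (Finset.empty_inter _)
      linarith
  · rw [hWg, abs_mul, abs_of_pos hlam_pos]
    have := abs_udRow_dotProduct_flat_le a (G t)
    linarith [hlam_t t]

end TogetherFace

end Summit.ValiantsHypothesis.ValiantsHypothesis.Cruxes.NNDivisionHard.ValIdea40.LocatedRows

/-! ## §8 (rev 13) THE C′ CENSUS OF RECORD HAS MOVED → `Cruxes/NNDivisionHard/Census40.lean` (same sibling namespace `…Cruxes.NNDivisionHard.ValIdea40Census`)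

Reason: this workfile sits at the 200 000 B cap (rev 12 = 189 714 B) and the census grows with every landed port part (val-idea-crit-9 g3 V#105b plan (a),
ACCEPTED).  Rev 13 of the census (there): rows 3–9/E/C of the `ExactPencil` port cited BY NAME from the landed `Theorems/FifoMatchingNNDivisionHardExactPencil*`
modules, row V = C′ ≡ COR-VIRTUAL in THEOREMS (✓ p688316 / p688396), the four-valued LEVEL column, the (E-0)/T0 eliminations, the S2 sub-table and the enemy
specification BY POINTER to `CRITIC-wave7.md` §2.  The rev-12 declarations `LawBodyAt`, `law_iff_lawBodyAt`, `TopDecidedAt`, `corVirtual_body_of_topDecidedAt`,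
`decided_species_of_record` moved with it VERBATIM (no duplicate here).  §1–§7 of this file are UNCHANGED since rev 12 (`law_chain_of_record` ✓ p682649 current:
`LocatedPencilLaw` REFUTED ✓ p679540; C′ = `ExactPencilLaw` OPEN ≡ COR-VIRTUAL; crux 21181 OPEN; VP ≠ VNP NOT proved). -/


#print axioms Summit.ValiantsHypothesis.ValiantsHypothesis.Cruxes.NNDivisionHard.ValIdea40.LocatedRows.three_pow_le_of_block
#print axioms Summit.ValiantsHypothesis.ValiantsHypothesis.Cruxes.NNDivisionHard.ValIdea40.LocatedRows.val_le_val_star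
#print axioms Summit.ValiantsHypothesis.ValiantsHypothesis.Cruxes.NNDivisionHard.ValIdea40.LocatedRows.pairPencil_block
#print axioms Summit.ValiantsHypothesis.ValiantsHypothesis.Cruxes.NNDivisionHard.ValIdea40.LocatedRows.pinnedRows_law_holds_on_qOff
#print axioms Summit.ValiantsHypothesis.ValiantsHypothesis.Cruxes.NNDivisionHard.ValIdea40.LocatedRows.entryTilted_law_holds_on_qOff
#print axioms Summit.ValiantsHypothesis.ValiantsHypothesis.Cruxes.NNDivisionHard.ValIdea40.LocatedRows.located_dot_private
#print axioms Summit.ValiantsHypothesis.ValiantsHypothesis.Cruxes.NNDivisionHard.ValIdea40.LocatedRows.located_blind_zgen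
#print axioms Summit.ValiantsHypothesis.ValiantsHypothesis.Cruxes.NNDivisionHard.ValIdea40.LocatedRows.pinnedRows_law_on_pinExposed
#print axioms Summit.ValiantsHypothesis.ValiantsHypothesis.Cruxes.NNDivisionHard.ValIdea40.LocatedRows.pinExposed_qOff
#print axioms Summit.ValiantsHypothesis.ValiantsHypothesis.Cruxes.NNDivisionHard.ValIdea40.LocatedRows.entryTilted_law_on_columnCoupled
#print axioms Summit.ValiantsHypothesis.ValiantsHypothesis.Cruxes.NNDivisionHard.ValIdea40.LocatedRows.columnCoupled_decided
#print axioms Summit.ValiantsHypothesis.ValiantsHypothesis.Cruxes.NNDivisionHard.ValIdea40.LocatedRows.columnCoupled_qOff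
#print axioms Summit.ValiantsHypothesis.ValiantsHypothesis.Cruxes.NNDivisionHard.ValIdea40.LocatedRows.qPerm_decided
#print axioms Summit.ValiantsHypothesis.ValiantsHypothesis.Cruxes.NNDivisionHard.ValIdea40.LocatedRows.pinnedRows_law_holds_on_qPerm
#print axioms Summit.ValiantsHypothesis.ValiantsHypothesis.Cruxes.NNDivisionHard.ValIdea40.LocatedRows.columnTilt_block_family
#print axioms Summit.ValiantsHypothesis.ValiantsHypothesis.Cruxes.NNDivisionHard.ValIdea40.LocatedRows.exact_body_of_pinned_body
#print axioms Summit.ValiantsHypothesis.ValiantsHypothesis.Cruxes.NNDivisionHard.ValIdea40.LocatedRows.exactTilted_law_on_pinExposed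
#print axioms Summit.ValiantsHypothesis.ValiantsHypothesis.Cruxes.NNDivisionHard.ValIdea40.LocatedRows.exactTilted_law_holds_on_qOff
#print axioms Summit.ValiantsHypothesis.ValiantsHypothesis.Cruxes.NNDivisionHard.ValIdea40.LocatedRows.exactTilted_law_holds_on_qPerm
#print axioms Summit.ValiantsHypothesis.ValiantsHypothesis.Cruxes.NNDivisionHard.ValIdea40.LocatedRows.exactTilted_law_on_columnCoupled
#print axioms Summit.ValiantsHypothesis.ValiantsHypothesis.Cruxes.NNDivisionHard.ValIdea40.LocatedRows.exact_law_chain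
#print axioms Summit.ValiantsHypothesis.ValiantsHypothesis.Cruxes.NNDivisionHard.ValIdea40.LocatedRows.not_pinExposed_of_zgen
#print axioms Summit.ValiantsHypothesis.ValiantsHypothesis.Cruxes.NNDivisionHard.ValIdea40.LocatedRows.not_pinExposed_of_allTriples
#print axioms Summit.ValiantsHypothesis.ValiantsHypothesis.Cruxes.NNDivisionHard.ValIdea40.LocatedRows.no_pure_block_of_zgen
#print axioms Summit.ValiantsHypothesis.ValiantsHypothesis.Cruxes.NNDivisionHard.ValIdea40.LocatedRows.law_chain_of_record
#print axioms Summit.ValiantsHypothesis.ValiantsHypothesis.Cruxes.NNDivisionHard.ValIdea40.LocatedRows.no_pure_block_of_private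
#print axioms Summit.ValiantsHypothesis.ValiantsHypothesis.Cruxes.NNDivisionHard.ValIdea40.LocatedRows.hCOR_blockW
#print axioms Summit.ValiantsHypothesis.ValiantsHypothesis.Cruxes.NNDivisionHard.ValIdea40.LocatedRows.blockW_dotProduct_udPt_le_neg_one
#print axioms Summit.ValiantsHypothesis.ValiantsHypothesis.Cruxes.NNDivisionHard.ValIdea40.LocatedRows.exists_common_pin
#print axioms Summit.ValiantsHypothesis.ValiantsHypothesis.Cruxes.NNDivisionHard.ValIdea40.LocatedRows.exists_pin_of_vanishing_column
#print axioms Summit.ValiantsHypothesis.ValiantsHypothesis.Cruxes.NNDivisionHard.ValIdea40.LocatedRows.exists_common_pin_of_sparse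
#print axioms Summit.ValiantsHypothesis.ValiantsHypothesis.Cruxes.NNDivisionHard.ValIdea40.LocatedRows.exists_togetherFace_weight
#print axioms Summit.ValiantsHypothesis.ValiantsHypothesis.Cruxes.NNDivisionHard.ValIdea40.LocatedRows.cubePt_le_of_pins
#print axioms Summit.ValiantsHypothesis.ValiantsHypothesis.Cruxes.NNDivisionHard.ValIdea40.LocatedRows.togetherFace_ud_block
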